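import Literature.Analysis.FluidPDE.SereginZajaczkowski2007
import Literature.Analysis.FluidPDE.SuitableWeakRescaling
import Literature.Analysis.FluidPDE.SuitableWeakInBallTools
import Literature.Analysis.FluidPDE.SereginSverakOffAxisScaling
import Literature.Analysis.FluidPDE.LocalTypeIScaling
import Literature.Analysis.FluidPDE.LeiZhang2011ZoomIn
import Literature.Analysis.FluidPDE.SereginSverakAxisymmetric
import Literature.Analysis.FluidPDE.NewtonKernel
import Literature.Analysis.FluidPDE.CylindricalIntegration
import Literature.Analysis.Calculus.HardyLogarithmic
import Literature.Analysis.Calculus.PlanarPolarIntegral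
import Literature.Analysis.FluidPDE.AxisymHouLiVariables
import Literature.Analysis.FluidPDE.SuitableWeakProofs
import Literature.Analysis.FluidPDE.SqIntegralBalance
import Literature.Analysis.FluidPDE.HouLeiLiEstimate
import Literature.Analysis.FluidPDE.AxisymGradientField
import Literature.Analysis.FluidPDE.HessianLaplacian
import Literature.Analysis.FluidPDE.VorticityCalculus
import Literature.Analysis.FluidPDE.AxisymOmegaEnergy
import Literature.Analysis.FluidPDE.AxisymQuotientEquationsJ
import Literature.Analysis.FluidPDE.AxisymPoloidalCutoff
import Literature.Analysis.FluidPDE.Wei2016PoloidalCurl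
import Literature.Analysis.FluidPDE.CollapseDebris
import Literature.Analysis.FluidPDE.BiotSavartNewtonKernel
import Literature.Analysis.FluidPDE.HouLiSpaceTime
import Literature.Analysis.FluidPDE.SpaceTimeCalculus
import Literature.Analysis.FluidPDE.RusinSverakCompactness
import HarnessLib

/-!
# Seregin 2022 local regularity of axisymmetric solutions (Thm. 1.2 via §2), file 1 of 6: scaling covariance of the clean-slab data, the Step-1 product cut-off, the Leray logarithmic Hardy inequality (Lemma 2.2), the Lei–Zhang elliptic bounds, cut-off calculus, the `Γ`-energy and the div–curl bound (re-homed proofs)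

**G. Seregin, *A note on local regularity of axisymmetric solutions to the Navier–Stokes equations*, J. Math. Fluid Mech. 24
(2022), Paper 27 = arXiv:2201.00153, Theorem 1.2 via §2 from the swirl decay (2.2) [Seregin2022LocalAxisym]: for a suitable weak
solution in the unit parabolic cylinder `Q = 𝒞 × ]-1,0[`, axisymmetric, with `v ∈ L_{2,∞}(Q)`, `∇v ∈ L₂(Q)`, `q ∈ L_{3/2}(Q)` and
`|v_θ(x,t)| ≤ C₁ |x'|⁻¹ / ln³(e/|x'|)` off the axis, the origin is a regular point.**  The named fact
`Literature.Analysis.FluidPDE.seregin2022_logSwirl_regularAtOrigin` (`Seregin2022LogSwirlCriterion.lean`) is PROVED in the tree by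
the Navier–Stokes cell's `AxisymmetricKatoGlobal` line (Steps 1–4 of §2: reduction to a first singular time and a clean slab with a
smooth axisymmetric representative, the product cut-off, the Leray logarithmic Hardy inequality (Lemma 2.2), Lemma 2.1 and the
Chen–Fang–Zhang / Lei–Zhang elliptic bounds for `u_r/r`, the `η⁶`-weighted energy estimates of `Γ = ω_θ/r` and `Φ = ω_r/r` with
the swirl source absorbed through (2.2), the key estimate, the Step-4 assembly `C(R) ≤ C R^{3/2} → 0` and ε-regularity) — until now
Summits-side only (`Summits/NavierStokesRegularity/NavierStokesRegularity/Theorems/AxisymmetricExtremalityAxisymmetricKatoGlobalStubSereginLogSwirlOrigin.lean`,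
`seregin2022_logSwirl_regularAtOrigin_holds := stub_sereginLogSwirlOrigin`).  RE-HOMED into `Literature/` by the Hodge foundations
lane (`lit-hodgefound`, prover p20, generation 39) as SIX files: verbatim DECLARATION-LEVEL ports (the 312 declarations the
discharge needs, in dependency order; each Part header lists the declarations of its source module that are NOT carried) of 55
Summits modules `Summits/NavierStokesRegularity/NavierStokesRegularity/Theorems/AxisymmetricExtremalityAxisymmetricKatoGlobalStub*.lean`,
namespaces `Summit.NavierStokesRegularity.NavierStokesRegularity.Theorems.AxisymmetricKatoGlobal{.EulerScaling,.Registered}` re-rooted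
to `Literature.Analysis.SereginLogSwirlOrigin{.EulerScaling,.Registered}` (a root outside `Literature.Analysis.FluidPDE` on purpose:
namespace-prefix resolution would otherwise shadow the cone's lemmas by same-named `FluidPDE` lemmas); the sources' `local notation`
`ℝ³` is expanded textually; imports from `Literature/` and Mathlib only; no `sorry`, no new axiom, NO named fact (D-0026).
PROVENANCE CONVENTION: docstrings are carried byte-for-byte; declarations the cell cites keep their cites; `[folklore]`-tagged and
untagged declarations (the cell's own lemmas) carry the Part's tag `[cite: <Key>, <loc> (source of the ARGUMENT this module
implements; this declaration is the cell's own lemma or plumbing, NOT a printed statement)]`, because the gate does not admit a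
public Literature theorem without a cite tag.

THIS FILE (1 of 6) ports: …StubSereginLogSwirlOriginCoreNormaliseRescale, …StubSereginLogSwirlOriginStep1Cutoff, …StubSereginLogSwirlOriginLerayLogHardy, …StubSereginLogSwirlOriginStep13Tools, …StubSereginLogSwirlOriginStep3SwirlSource, …StubSereginLogSwirlOriginCFZBounds, …StubSereginLogSwirlOriginStep3CutoffCalculus, …StubSereginLogSwirlOriginStep3Gamma, …StubSereginLogSwirlOriginCutoffDivCurl, …StubSereginLogSwirlOriginStep3Balance, …StubSereginLogSwirlOriginStep3Absorb.
-/

noncomputable section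

/-!
## Part 1 — port of `Summits/NavierStokesRegularity/NavierStokesRegularity/Theorems/AxisymmetricExtremalityAxisymmetricKatoGlobalStubSereginLogSwirlOriginCoreNormaliseRescale.lean` (10 declarations kept)

# Seregin 2022, §2: covariance of the clean-slab data under the Navier–Stokes scaling about an
# axis point —
# crux stmt-NavierStokesRegularity-15453 (`AxisymmetricExtremality.AxisymmetricKatoGlobal`), line registered, support for stub `stub_sereginLogSwirlOrigin`

Support file (`--supports stmt-NavierStokesRegularity-15453`; theorems only, everything proved)
toward the registered stub `stub_sereginLogSwirlOrigin` = the named fact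
`Literature.Analysis.FluidPDE.seregin2022_logSwirl_regularAtOrigin` (G. Seregin, J. Math. Fluid
Mech. 24 (2022), Paper 27 = arXiv:2201.00153, §2).  First of three files normalising the
classical core of the fact (the hypothesis `core` of
`seregin2022_logSwirl_regularAtOrigin_of_cleanRepr`, sibling `…FinalReduction`), stated at a
general axis point `ẑ = (t̂, b e₃)` and scale `R`, to the origin at unit scale by the parabolic
scaling `v_R(s, y) = R v(t̂ + R² s, b e₃ + R y)`, `q_R = R² q(…)` (`ν = 1` is scale invariant;
the accepted vocabulary is `R • stPull (R²) R t̂ (b • eZ) v`, `SpaceTimeRescaling.lean`).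

This file proves the covariance of the individual ingredients:

* `iteratedFDeriv_smul_comp_axisZoom`, `norm_smul_compContinuousLinearMap_smul_id_le` — the
  chain rule `D_yⁿ(a V(t, x̂ + R ·))(y) = a DⁿV(t, x̂ + R y) ∘ (R id)^{⊗n}` and the bound
  `‖…‖ ≤ |a| |R|ⁿ ‖DⁿV‖`;
* `isSmoothAxisymmetricSolutionOn_axisZoom` — **the Seregin–Zajaczkowski class
  `IsSmoothAxisymmetricSolutionOn` is covariant**: `(R V ∘ Φ, R² q ∘ Φ)` is a sufficiently
  smooth axially symmetric solution on `Φ⁻¹(S)` (`Φ(s, y) = (t̂ + R² s, b e₃ + R y)`; suitable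
  weak solutions by the accepted `IsSuitableWeakSolutionOn.stRescale`, axial symmetry because
  `b e₃` is fixed by the rotations, smooth slices and locally Hölder spatial derivatives by the
  chain rule and the Lipschitz map `Φ`);
* `stAffine_preimage_parabolicCylinder_axisZoom`, `parCylOpens_axisZoom` — `Φ` maps `Q_{ρ/R}(0, a)` onto
  `Q_ρ(t̂, b e₃ + R a)` and `Q(0, 1)` onto `Q(ẑ, R)`;
* `abs_swirl_axisZoom_le` — **the swirl bound (2.2) is scale-monotone**: the swirl is invariant,
  `σ_{v_R}(s, y) = σ_v(Φ(s, y))` (`swirl_smul_comp_eZ_smul`), and for `0 < R ≤ 1`,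
  `0 < ϱ < 1`: `ln(e/(Rϱ)) ≥ ln(e/ϱ) > 0`, so `|σ| ≤ C₁/ln³(e/|x'|)` at `Φ(s, y)` gives
  `|σ_{v_R}(s, y)| ≤ max(C₁, 0)/ln³(e/|y'|)`;
* `backwardRegular_of_axisZoom` — an `L_∞` bound of `v_R` on `Q_r(0)` is an `L_∞` bound of `v` on
  `Q_{Rr}(ẑ)` (accepted `eLpNorm_top_nsZoom`).

## References

* G. Seregin, J. Math. Fluid Mech. 24 (2022), Paper No. 27 = arXiv:2201.00153, §2 (the proof is
  written at the origin and unit scale: "`Q = 𝒞 × ]-1, 0[`"). [`Seregin2022LocalAxisym`]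
* G. Seregin, W. Zajaczkowski, SIAM J. Math. Anal. 39 (2007) 669–685, §5 (the scaling
  `u^R(x,t) = R u(Rx + be₃, R²t)` of a sufficiently smooth axially symmetric solution).
  [`SereginZajaczkowski2007`]
* L. Caffarelli, R. Kohn, L. Nirenberg, Comm. Pure Appl. Math. 35 (1982), §2 (scaling).
  [`CaffarelliKohnNirenberg1982`]
-/

section Part1

open _root_.MeasureTheory _root_.Set _root_.Function _root_.Filter _root_.Topology _root_.TopologicalSpace
  _root_.Metric
open scoped _root_.NNReal _root_.ENNReal

namespace Literature.Analysis.SereginLogSwirlOrigin.EulerScaling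

open Literature.Analysis.FluidPDE Literature.Analysis.FluidPDE.SereginZajaczkowski2007
  Literature.Analysis.FluidPDE.SereginSverak2009

/-! ### The chain rule for the spatial zoom -/

open scoped _root_.ContDiff in
/-- **Spatial derivatives of the zoomed slice.** For `f` smooth at `x₀ + c x` (`c ≠ 0`), the `k`-th
derivative of `x' ↦ a f(x₀ + c x')` at `x` is `a` times the `k`-th derivative of `f` at `x₀ + c x`
composed with `c · id` in each slot (Mathlib's `ContinuousLinearEquiv.iteratedFDerivWithin_comp_right`,
`iteratedFDeriv_comp_add_left`, `iteratedFDeriv_const_smul_apply'`). [folklore]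
[cite: Seregin2022LocalAxisym, §2 proof of Thm. 1.2 (arXiv:2201.00153 pp. 4–7) (source of the ARGUMENT this module implements; this declaration is the cell’s own lemma or plumbing, NOT a printed statement)] -/
theorem iteratedFDeriv_smul_comp_axisZoom {c : ℝ} (hc : c ≠ 0) (a : ℝ)
    (f : EuclideanSpace ℝ (Fin 3) → EuclideanSpace ℝ (Fin 3)) (x₀ x : EuclideanSpace ℝ (Fin 3)) (k : ℕ)
    (hf : ContDiffAt ℝ ∞ f (x₀ + c • x)) :
    iteratedFDeriv ℝ k (fun x' => a • f (x₀ + c • x')) x =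
      a • (iteratedFDeriv ℝ k f (x₀ + c • x)).compContinuousLinearMap
        (fun _ => c • ContinuousLinearMap.id ℝ (EuclideanSpace ℝ (Fin 3))) := by
  -- adapted from `iteratedFDeriv_zoom_symm` (`Literature/Analysis/FluidPDE/SuitableWeakInBallTools.lean`)
  set L : EuclideanSpace ℝ (Fin 3) ≃L[ℝ] EuclideanSpace ℝ (Fin 3) :=
    ContinuousLinearEquiv.equivOfInverse (c • ContinuousLinearMap.id ℝ (EuclideanSpace ℝ (Fin 3)))
      (c⁻¹ • ContinuousLinearMap.id ℝ (EuclideanSpace ℝ (Fin 3)))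
      (fun y => by simp [smul_smul, hc]) (fun y => by simp [smul_smul, hc]) with hL
  have hLapply : ∀ y, L y = c • y := fun y => rfl
  have hLcoe : (L : EuclideanSpace ℝ (Fin 3) →L[ℝ] EuclideanSpace ℝ (Fin 3)) =
      c • ContinuousLinearMap.id ℝ (EuclideanSpace ℝ (Fin 3)) := rfl
  set g : EuclideanSpace ℝ (Fin 3) → EuclideanSpace ℝ (Fin 3) := fun x' => f (x₀ + c • x') with hg
  have hgcomp : g = (fun y => f (x₀ + y)) ∘ L := by
    funext x'
    simp only [hg, comp_apply, hLapply]
  have h1 : iteratedFDeriv ℝ k g x =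
      (iteratedFDeriv ℝ k f (x₀ + c • x)).compContinuousLinearMap fun _ =>
        (L : EuclideanSpace ℝ (Fin 3) →L[ℝ] EuclideanSpace ℝ (Fin 3)) := by
    have h := L.iteratedFDerivWithin_comp_right (fun y => f (x₀ + y)) uniqueDiffOn_univ
      (x := x) (mem_univ _) k
    rw [preimage_univ, iteratedFDerivWithin_univ, iteratedFDerivWithin_univ, ← hgcomp,
      iteratedFDeriv_comp_add_left] at h
    rw [h, hLapply]
  have haff : ContDiff ℝ ∞ fun x' : EuclideanSpace ℝ (Fin 3) => x₀ + c • x' :=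
    contDiff_const.add (contDiff_id.const_smul _)
  have hgx : ContDiffAt ℝ k g x := by
    have := hf.comp x haff.contDiffAt
    exact this.of_le (by exact_mod_cast le_top)
  have h2 : iteratedFDeriv ℝ k (fun x' => a • g x') x = a • iteratedFDeriv ℝ k g x :=
    iteratedFDeriv_const_smul_apply' hgx
  show iteratedFDeriv ℝ k (fun x' => a • g x') x = _
  rw [h2, h1, hLcoe]

/-- `‖a M ∘ (c id)^{⊗k}‖ ≤ |a| |c|ᵏ ‖M‖` for a continuous `k`-linear map `M`. [folklore]
[cite: Seregin2022LocalAxisym, §2 proof of Thm. 1.2 (arXiv:2201.00153 pp. 4–7) (source of the ARGUMENT this module implements; this declaration is the cell’s own lemma or plumbing, NOT a printed statement)] -/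
theorem norm_smul_compContinuousLinearMap_smul_id_le {k : ℕ} (a c : ℝ)
    (M : ContinuousMultilinearMap ℝ (fun _ : Fin k => EuclideanSpace ℝ (Fin 3)) (EuclideanSpace ℝ (Fin 3))) :
    ‖a • M.compContinuousLinearMap (fun _ => c • ContinuousLinearMap.id ℝ (EuclideanSpace ℝ (Fin 3)))‖ ≤
      |a| * |c| ^ k * ‖M‖ := by
  rw [norm_smul, Real.norm_eq_abs, mul_assoc]
  refine mul_le_mul_of_nonneg_left ?_ (abs_nonneg a)
  refine (ContinuousMultilinearMap.norm_compContinuousLinearMap_le _ _).trans ?_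
  rw [Finset.prod_const, Finset.card_univ, Fintype.card_fin, mul_comm]
  have hn : ‖c • ContinuousLinearMap.id ℝ (EuclideanSpace ℝ (Fin 3))‖ ≤ |c| := by
    rw [norm_smul, Real.norm_eq_abs]
    exact mul_le_of_le_one_right (abs_nonneg c) ContinuousLinearMap.norm_id_le
  exact mul_le_mul_of_nonneg_right (pow_le_pow_left₀ (norm_nonneg _) hn k) (norm_nonneg _)

/-! ### Covariance of the Seregin–Zajaczkowski class -/

open scoped _root_.ContDiff in
/-- **The Seregin–Zajaczkowski class is covariant under the Navier–Stokes scaling about an axis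
point** (Seregin–Zajaczkowski 2007, §5: "`u^R(x, t) = R u(Rx + be₃, R²t)`" is again a sufficiently
smooth axially symmetric solution): if `(V, P)` is a sufficiently smooth axially symmetric solution
on the open set `S`, then `(R V ∘ Φ, R² P ∘ Φ)`, `Φ(s, y) = (t₀ + R² s, b e₃ + R y)`, `R > 0`, is one
on `Φ⁻¹(S)`: the suitable weak solution is rescaled by the accepted covariance
`IsSuitableWeakSolutionOn.stRescale` (viscosity `R · 1 / R = 1`, force `0`), the axial symmetry
survives because the rotations about the axis fix `b e₃` and commute with dilations, the slices stay
`C^∞` by the chain rule, and the spatial derivatives `D_yⁿ(R V ∘ Φ) = R (DⁿV ∘ Φ) ∘ (R id)^{⊗n}` stay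
locally Hölder continuous (`Φ` Lipschitz, `M ↦ R M ∘ (R id)^{⊗n}` linear and bounded).
[cite: SereginZajaczkowski2007, §5 (the scaling `u^R`), with Prop. 4.1 (the class)] -/
theorem isSmoothAxisymmetricSolutionOn_axisZoom : ∀ (S : TopologicalSpace.Opens (ℝ × EuclideanSpace ℝ (Fin 3))) (V : ℝ → EuclideanSpace ℝ (Fin 3) → EuclideanSpace ℝ (Fin 3)) (P : ℝ → EuclideanSpace ℝ (Fin 3) → ℝ), SereginZajaczkowski2007.IsSmoothAxisymmetricSolutionOn S V P → ∀ (R t₀ b : ℝ), 0 < R → SereginZajaczkowski2007.IsSmoothAxisymmetricSolutionOn (stPreimage (R ^ 2) R t₀ (b • eZ) S) (R • stPull (R ^ 2) R t₀ (b • eZ) V) (R ^ 2 • stPull (R ^ 2) R t₀ (b • eZ) P) := by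
  intro S V P h R t₀ b hR
  refine ⟨?_, ?_, ?_, ?_⟩
  · -- suitable weak solution
    have h0 := h.suitable.stRescale hR hR (by ring : R ^ 2 = R * R) t₀ (b • eZ)
    have hvisc : R * 1 / R = 1 := by field_simp
    have hforce : ((R ^ 2 * R) • stPull (R ^ 2) R t₀ (b • eZ)
        (0 : ℝ → EuclideanSpace ℝ (Fin 3) → EuclideanSpace ℝ (Fin 3))) = 0 := by
      funext s y; simp [stPull]
    rwa [hvisc, hforce] at h0
  · -- axial symmetry
    intro θ z hz
    show R • V (t₀ + R ^ 2 * z.1) (b • eZ + R • rotZ θ z.2) =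
      rotZ θ (R • V (t₀ + R ^ 2 * z.1) (b • eZ + R • z.2))
    rw [← rotZ_smul_eZ_add_smul, rotZ_smul_vec]
    exact congrArg (R • ·) (h.axisymmetric θ (stAffine (R ^ 2) R t₀ (b • eZ) z) hz)
  · -- smooth slices
    intro z hz
    have haff : ContDiff ℝ ∞ fun x' : EuclideanSpace ℝ (Fin 3) => b • eZ + R • x' :=
      contDiff_const.add (contDiff_id.const_smul _)
    have h1 : ContDiffAt ℝ ∞ (fun x' => V (t₀ + R ^ 2 * z.1) (b • eZ + R • x')) z.2 :=
      (h.contDiffAt _ hz).comp z.2 haff.contDiffAt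
    exact h1.const_smul R
  · -- locally Hölder continuous spatial derivatives
    intro n z hz
    obtain ⟨U, hU, C, r, hr, hH⟩ := h.holder n (stAffine (R ^ 2) R t₀ (b • eZ) z) hz
    set Φ : ℝ × EuclideanSpace ℝ (Fin 3) → ℝ × EuclideanSpace ℝ (Fin 3) :=
      stAffine (R ^ 2) R t₀ (b • eZ) with hΦ
    set S' : Set (ℝ × EuclideanSpace ℝ (Fin 3)) :=
      ((stPreimage (R ^ 2) R t₀ (b • eZ) S : Opens (ℝ × EuclideanSpace ℝ (Fin 3))) :
        Set (ℝ × EuclideanSpace ℝ (Fin 3))) with hS'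
    -- the linear map `M ↦ R M ∘ (R id)^{⊗n}` and the Lipschitz zoom
    set Ψ : ContinuousMultilinearMap ℝ (fun _ : Fin n => EuclideanSpace ℝ (Fin 3)) (EuclideanSpace ℝ (Fin 3)) →L[ℝ]
        ContinuousMultilinearMap ℝ (fun _ : Fin n => EuclideanSpace ℝ (Fin 3)) (EuclideanSpace ℝ (Fin 3)) :=
      R • ContinuousMultilinearMap.compContinuousLinearMapL
        (fun _ : Fin n => R • ContinuousLinearMap.id ℝ (EuclideanSpace ℝ (Fin 3))) with hΨ
    have hΨapply : ∀ M : ContinuousMultilinearMap ℝ (fun _ : Fin n => EuclideanSpace ℝ (Fin 3))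
        (EuclideanSpace ℝ (Fin 3)),
        Ψ M = R • M.compContinuousLinearMap
          (fun _ => R • ContinuousLinearMap.id ℝ (EuclideanSpace ℝ (Fin 3))) := fun M => rfl
    have hΨlip : LipschitzWith ‖Ψ‖₊ Ψ := Ψ.lipschitz
    have hΦlip : LipschitzWith (max (Real.toNNReal (R ^ 2)) (Real.toNNReal R)) Φ :=
      lipschitzWith_stAffine (sq_nonneg R) hR.le _ _
    have hmaps : MapsTo Φ (Φ ⁻¹' U ∩ S') (U ∩ (S : Set (ℝ × EuclideanSpace ℝ (Fin 3)))) :=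
      fun w hw => ⟨hw.1, hw.2⟩
    have hcomp1 : HolderOnWith (C * max (Real.toNNReal (R ^ 2)) (Real.toNNReal R) ^ (r : ℝ)) (r * 1)
        ((fun w : ℝ × EuclideanSpace ℝ (Fin 3) => iteratedFDeriv ℝ n (V w.1) w.2) ∘ Φ)
        (Φ ⁻¹' U ∩ S') :=
      hH.comp hΦlip.lipschitzOnWith.holderOnWith hmaps
    have hcomp2 := (hΨlip.lipschitzOnWith (s := univ)).holderOnWith.comp hcomp1
      (fun _ _ => mem_univ _)
    have hformula : ∀ w ∈ Φ ⁻¹' U ∩ S',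
        iteratedFDeriv ℝ n ((R • stPull (R ^ 2) R t₀ (b • eZ) V) w.1) w.2 =
          (Ψ ∘ ((fun w : ℝ × EuclideanSpace ℝ (Fin 3) => iteratedFDeriv ℝ n (V w.1) w.2) ∘ Φ)) w := by
      intro w hw
      rw [comp_apply, comp_apply, hΨapply]
      exact iteratedFDeriv_smul_comp_axisZoom hR.ne' R (V (t₀ + R ^ 2 * w.1)) (b • eZ) w.2 n
        (h.contDiffAt (Φ w) hw.2)
    refine ⟨Φ ⁻¹' U, (continuous_stAffine _ _ _ _).continuousAt.preimage_mem_nhds hU,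
      ‖Ψ‖₊ * (C * max (Real.toNNReal (R ^ 2)) (Real.toNNReal R) ^ (r : ℝ)) ^ ((1 : ℝ≥0) : ℝ),
      1 * (r * 1), by positivity, ?_⟩
    intro w hw w' hw'
    show edist (iteratedFDeriv ℝ n ((R • stPull (R ^ 2) R t₀ (b • eZ) V) w.1) w.2)
      (iteratedFDeriv ℝ n ((R • stPull (R ^ 2) R t₀ (b • eZ) V) w'.1) w'.2) ≤ _
    rw [hformula w hw, hformula w' hw']
    exact hcomp2 w hw w' hw'

/-! ### Geometry of the zoom about an axis point -/

/-- `Φ(s, y) = (t̂ + R² s, x̂ + R y)` pulls the top-time cylinder `Q_ρ(t̂, x̂ + R a)` back to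
`Q_{ρ/R}(0, a)` (`R > 0`). [folklore]
[cite: Seregin2022LocalAxisym, §2 proof of Thm. 1.2 (arXiv:2201.00153 pp. 4–7) (source of the ARGUMENT this module implements; this declaration is the cell’s own lemma or plumbing, NOT a printed statement)] -/
theorem stAffine_preimage_parabolicCylinder_axisZoom {R : ℝ} (hR : 0 < R) (t₀ : ℝ)
    (x₀ a : EuclideanSpace ℝ (Fin 3)) (ρ : ℝ) :
    stAffine (R ^ 2) R t₀ x₀ ⁻¹' parabolicCylinder ρ ((t₀, x₀ + R • a) : ℝ × EuclideanSpace ℝ (Fin 3)) =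
      parabolicCylinder (ρ / R) (((0 : ℝ), a) : ℝ × EuclideanSpace ℝ (Fin 3)) := by
  have h := LocalTypeIScaling.stAffine_preimage_parabolicCylinder hR t₀ x₀ (ρ / R)
    (((0 : ℝ), a) : ℝ × EuclideanSpace ℝ (Fin 3))
  have h0 : stAffine (R ^ 2) R t₀ x₀ (((0 : ℝ), a) : ℝ × EuclideanSpace ℝ (Fin 3)) = (t₀, x₀ + R • a) := by
    simp [stAffine]
  rwa [h0, mul_div_cancel₀ _ hR.ne'] at h

/-- `Φ(s, y) = (t̂ + R² s, x̂ + R y)` pulls `Q(ẑ, R)`, `ẑ = (t̂, x̂)`, back to `Q(0, 1)` (`R > 0`).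
[folklore]
[cite: Seregin2022LocalAxisym, §2 proof of Thm. 1.2 (arXiv:2201.00153 pp. 4–7) (source of the ARGUMENT this module implements; this declaration is the cell’s own lemma or plumbing, NOT a printed statement)] -/
theorem stAffine_preimage_parCyl_self {R : ℝ} (hR : 0 < R) (t₀ : ℝ) (x₀ : EuclideanSpace ℝ (Fin 3)) :
    stAffine (R ^ 2) R t₀ x₀ ⁻¹' parCyl ((t₀, x₀) : ℝ × EuclideanSpace ℝ (Fin 3)) R =
      parCyl (0 : ℝ × EuclideanSpace ℝ (Fin 3)) 1 := by
  rw [stAffine_preimage_parCyl hR, div_self hR.ne']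

/-- The same for the open sets: `Φ⁻¹(Q(ẑ, R)) = Q(0, 1)` in `Opens`. [folklore]
[cite: Seregin2022LocalAxisym, §2 proof of Thm. 1.2 (arXiv:2201.00153 pp. 4–7) (source of the ARGUMENT this module implements; this declaration is the cell’s own lemma or plumbing, NOT a printed statement)] -/
theorem parCylOpens_axisZoom {R : ℝ} (hR : 0 < R) (t₀ : ℝ) (x₀ : EuclideanSpace ℝ (Fin 3)) :
    stPreimage (R ^ 2) R t₀ x₀ (parCylOpens ((t₀, x₀) : ℝ × EuclideanSpace ℝ (Fin 3)) R) =
      parCylOpens (0 : ℝ × EuclideanSpace ℝ (Fin 3)) 1 :=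
  TopologicalSpace.Opens.ext (by
    rw [coe_stPreimage, coe_parCylOpens, coe_parCylOpens, stAffine_preimage_parCyl_self hR])

/-- Membership in `𝒞 = 𝒞(0, ρ)`: `|y'| < ρ`, `|y₃| < ρ`. [folklore]
[cite: Seregin2022LocalAxisym, §2 proof of Thm. 1.2 (arXiv:2201.00153 pp. 4–7) (source of the ARGUMENT this module implements; this declaration is the cell’s own lemma or plumbing, NOT a printed statement)] -/
theorem mem_spaceCyl_zero_iff {y : EuclideanSpace ℝ (Fin 3)} {ρ : ℝ} :
    y ∈ spaceCyl (0 : EuclideanSpace ℝ (Fin 3)) ρ ↔ cylRadius y < ρ ∧ |y 2| < ρ := by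
  simp only [mem_spaceCyl, sub_zero, PiLp.zero_apply]

/-- The space zoom `y ↦ b e₃ + R y` maps `𝒞(0, 1)` onto `𝒞(b e₃, R)` (`R > 0`). [folklore]
[cite: Seregin2022LocalAxisym, §2 proof of Thm. 1.2 (arXiv:2201.00153 pp. 4–7) (source of the ARGUMENT this module implements; this declaration is the cell’s own lemma or plumbing, NOT a printed statement)] -/
theorem axisZoom_mem_spaceCyl {R : ℝ} (hR : 0 < R) (b : ℝ) {y : EuclideanSpace ℝ (Fin 3)}
    (hy : y ∈ spaceCyl (0 : EuclideanSpace ℝ (Fin 3)) 1) : b • eZ + R • y ∈ spaceCyl (b • eZ) R := by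
  have h : y ∈ (fun y : EuclideanSpace ℝ (Fin 3) => b • eZ + R • y) ⁻¹' spaceCyl (b • eZ) (R * 1) := by
    rw [preimage_spaceCyl_axisAffine hR b 1]; exact hy
  rwa [mul_one] at h

/-! ### The swirl bound under the zoom -/

/-- **The swirl bound (2.2) is scale-monotone.** The swirl is invariant under the scaling about an
axis point, `σ_{R v(t, b e₃ + R ·)}(y) = σ_{v(t, ·)}(b e₃ + R y)` (`ϱ v_φ` with `ϱ = R ϱ'`,
`v ↦ R v`), `|(b e₃ + R y)'| = R |y'|`, and for `0 < R ≤ 1`, `0 < |y'| < 1` the logarithmic weight is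
monotone, `ln(e/(R|y'|)) ≥ ln(e/|y'|) > 0`; hence `|σ_v(t, x)| ≤ C₁/ln³(e/|x'|)` at `x = b e₃ + R y`
gives `|σ_{v_R}(y)| ≤ max(C₁, 0)/ln³(e/|y'|)`. [cite: Seregin2022LocalAxisym, (2.2) and §2 (reduction to `Q = 𝒞 × ]-1,0[`, arXiv:2201.00153 p. 5)] -/
theorem abs_swirl_axisZoom_le {w : EuclideanSpace ℝ (Fin 3) → EuclideanSpace ℝ (Fin 3)} {R b C₁ : ℝ}
    (hR : 0 < R) (hR1 : R ≤ 1) {y : EuclideanSpace ℝ (Fin 3)} (hy0 : 0 < cylRadius y)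
    (hy1 : cylRadius y < 1)
    (hσ : |swirl w (b • eZ + R • y)| ≤ C₁ / Real.log (Real.exp 1 / cylRadius (b • eZ + R • y)) ^ 3) :
    |swirl (fun y' => R • w (b • eZ + R • y')) y| ≤
      max C₁ 0 / Real.log (Real.exp 1 / cylRadius y) ^ 3 := by
  rw [swirl_smul_comp_eZ_smul w R b hR.ne' y, div_self hR.ne', one_mul]
  rw [cylRadius_axisAffine hR.le b y] at hσ
  have he : (1 : ℝ) < Real.exp 1 := by
    have := Real.add_one_lt_exp (one_ne_zero (α := ℝ))
    linarith
  have hL1 : 0 < Real.log (Real.exp 1 / cylRadius y) := by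
    apply Real.log_pos
    rw [lt_div_iff₀ hy0]
    nlinarith
  have hL2 : Real.log (Real.exp 1 / cylRadius y) ≤ Real.log (Real.exp 1 / (R * cylRadius y)) := by
    apply Real.log_le_log (div_pos (Real.exp_pos 1) hy0)
    exact div_le_div_of_nonneg_left (Real.exp_pos 1).le (mul_pos hR hy0) (by nlinarith)
  have hL3 : Real.log (Real.exp 1 / cylRadius y) ^ 3 ≤ Real.log (Real.exp 1 / (R * cylRadius y)) ^ 3 :=
    pow_le_pow_left₀ hL1.le hL2 3
  have hL4 : 0 < Real.log (Real.exp 1 / (R * cylRadius y)) ^ 3 := pow_pos (hL1.trans_le hL2) 3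
  calc |swirl w (b • eZ + R • y)| ≤ C₁ / Real.log (Real.exp 1 / (R * cylRadius y)) ^ 3 := hσ
    _ ≤ max C₁ 0 / Real.log (Real.exp 1 / (R * cylRadius y)) ^ 3 :=
      div_le_div_of_nonneg_right (le_max_left _ _) hL4.le
    _ ≤ max C₁ 0 / Real.log (Real.exp 1 / cylRadius y) ^ 3 :=
      div_le_div_of_nonneg_left (le_max_right _ _) (pow_pos hL1 3) hL3

/-! ### Transport of the `L_∞` bound back to the axis point -/

/-- **Backward regularity is transported back along the zoom**: if `v_R = R v ∘ Φ`,
`Φ(s, y) = (t̂ + R² s, x̂ + R y)`, is essentially bounded on `Q_r(0)`, then `v` is essentially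
bounded on `Q_{Rr}(ẑ) = Φ(Q_r(0))`, `ẑ = (t̂, x̂)` (`‖v_R‖_{L_∞(Q_r(0))} = R ‖v‖_{L_∞(Q_{Rr}(ẑ))}`,
accepted `eLpNorm_top_nsZoom`). [folklore]
[cite: Seregin2022LocalAxisym, §2 proof of Thm. 1.2 (arXiv:2201.00153 pp. 4–7) (source of the ARGUMENT this module implements; this declaration is the cell’s own lemma or plumbing, NOT a printed statement)] -/
theorem backwardRegular_of_axisZoom {v : ℝ → EuclideanSpace ℝ (Fin 3) → EuclideanSpace ℝ (Fin 3)}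
    {R : ℝ} (hR : 0 < R) (t₀ : ℝ) (x₀ : EuclideanSpace ℝ (Fin 3))
    (h : ∃ r > 0, eLpNorm (uncurry (R • stPull (R ^ 2) R t₀ x₀ v)) ∞
      (volume.restrict (parabolicCylinder r (0 : ℝ × EuclideanSpace ℝ (Fin 3)))) < ∞) :
    ∃ r > 0, eLpNorm (uncurry v) ∞
      (volume.restrict (parabolicCylinder r ((t₀, x₀) : ℝ × EuclideanSpace ℝ (Fin 3)))) < ∞ := by
  obtain ⟨r, hr, hfin⟩ := h
  have h1 := eLpNorm_top_nsZoom hR t₀ x₀ r (0 : ℝ × EuclideanSpace ℝ (Fin 3)) v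
  have h0 : stAffine (R ^ 2) R t₀ x₀ (0 : ℝ × EuclideanSpace ℝ (Fin 3)) = (t₀, x₀) := by
    simp [stAffine]
  rw [h0] at h1
  rw [h1] at hfin
  refine ⟨R * r, mul_pos hR hr, ?_⟩
  rcases ENNReal.mul_lt_top_iff.1 hfin with h2 | h2 | h2
  · exact h2.2
  · exact absurd h2 (ENNReal.ofReal_pos.2 hR).ne'
  · rw [h2]; exact ENNReal.zero_lt_top

end Literature.Analysis.SereginLogSwirlOrigin.EulerScaling

end Part1

/-!
## Part 2 — port of `Summits/NavierStokesRegularity/NavierStokesRegularity/Theorems/AxisymmetricExtremalityAxisymmetricKatoGlobalStubSereginLogSwirlOriginStep1Cutoff.lean` (11 declarations kept)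

# Seregin 2022, §2 Step 1: the product cut-off `ζ = φ(ϱ)ψ(x₃)` adapted to two regular heights —
# crux stmt-NavierStokesRegularity-15453 (`AxisymmetricExtremality.AxisymmetricKatoGlobal`), line registered, support for stub `stub_sereginLogSwirlOrigin`

Support file (`--supports stmt-NavierStokesRegularity-15453`; theorems only, everything proved)
toward the registered stub `stub_sereginLogSwirlOrigin` = the named fact
`Literature.Analysis.FluidPDE.seregin2022_logSwirl_regularAtOrigin` (G. Seregin, J. Math. Fluid
Mech. 24 (2022), Paper 27 = arXiv:2201.00153, §2).  Step 1 (arXiv p. 5) fixes "a smooth cut-off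
function `η(r, x₃, t) = φ(r)ψ(x₃)ξ(t)`" with `φ = 1` for `r < 1/2`, `φ = 0` for `r ≥ 5/6`,
`ψ = 1` for `0 ≤ x₃ < 1/2`, `ψ = 0` for `x₃ ≥ 5/6`, all valued in `[0, 1]`, adapted to the partial
regularity of `v`: `v` is smooth "in the set `supp |∇η|`" — off the axis where `φ' ≠ 0`, and near
the two regular axis points `(0, h₁, 0)`, `(0, -h₂, 0)` where `ψ' ≠ 0`.  In the tree's reduction
of the fact to its classical core (`seregin2022_logSwirl_regularAtOrigin_of_cleanRepr`,
`…FinalReduction.lean`) the configuration at the normalised position `(0, 1)` consists of two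
heights `h₋ < 0 < h₊` and a width `δ > 0` with `-1 ≤ h₋ - δ`, `h₋ + δ < 0 < h₊ - δ`, `h₊ + δ ≤ 1`,
every top-slice point of `𝒞 = 𝒞(0, 1)` off the axis or of height within `δ` of `h₊` or `h₋`
being regular; and on the final slab the time factor is `ξ = 1`.  This file constructs the
time-independent spatial cut-off for that configuration and records the bookkeeping of its
support and of the support of its gradient:

* `radialFactor_props` — `φ(x) = Θ_{ρ₁,ρ₂}(x₀² + x₁²)` (`Θ = cutoffProfile`, the profile of the
  tree's `radialCutoff`, in the variable `ϱ²`, so that no non-smoothness of `ϱ` at the axis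
  enters): `C^∞`, valued in `[0, 1]`, `= 1` for `ϱ ≤ ρ₁`, `= 0` for `ϱ ≥ ρ₂`, rotation invariant;
* `axialFactor_props` — `ψ(x) = Θ_{a,b}((x₃ - c)²)`: `C^∞`, valued in `[0, 1]`, `= 1` for
  `|x₃ - c| ≤ a`, `= 0` for `|x₃ - c| ≥ b`, rotation invariant;
* `fderiv_eq_zero_of_eqOn_isOpen` — a function constant on an open set has zero derivative there;
* `exists_step1_cutoff` (registered sub-goal) — **the cut-off**: for `0 < ρ₁ < ρ₂ < 1` and
  heights/width as above there is `ζ : ℝ³ → ℝ`, `C^∞`, axisymmetric, compactly supported,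
  `0 ≤ ζ ≤ 1`, `ζ = 1` on the closed box `{ϱ ≤ ρ₁, h₋ + δ/2 ≤ x₃ ≤ h₊ - δ/2}` (which contains
  `𝒞(r)` for small `r`, `spaceCyl_subset_box`), `ζ ≠ 0` only in the open box
  `{ϱ < ρ₂, h₋ - δ/2 < x₃ < h₊ + δ/2}`, `tsupport ζ ⊆ {ϱ ≤ ρ₂, h₋ - δ/2 ≤ x₃ ≤ h₊ + δ/2} ⊆ 𝒞`,
  and **`supp ∇ζ` lies in the regular region**:
  `tsupport (∇ζ) ⊆ {ϱ ≤ ρ₂, h₋ - δ/2 ≤ x₃ ≤ h₊ + δ/2} ∩ ({ρ₁ ≤ ϱ} ∪ {|x₃ - h₊| ≤ δ/2} ∪ {|x₃ - h₋| ≤ δ/2})`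
  (so every point of it is off the axis or strictly within `δ` of a height);
* `spaceCyl_subset_box`, `good_of_mem_gradBox`, `gradBox_subset_spaceCyl`, `isCompact_gradBox` —
  the elementary geometry used downstream (Step 3's far field `{ϱ ≥ r₁}` and `supp ∇ζ` are
  compact sets of regular top-slice points inside `𝒞`).

## Mathlib / tree search

Tree: `cutoffProfile`, `cutoffProfile_contDiff/_nonneg/_le_one/_eq_one/_eq_zero`
(`NewtonKernel`), `cylRadius_sq`, `cylRadius_rotZ`, `rotZ_apply_two`, `continuous_cylRadius`
(`AxisymmetricEuler`), `SereginSverak2009.spaceCyl`, `mem_spaceCyl`, `spaceCyl_subset_ball`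
(`SereginSverakAxisymmetric`); siblings `Seregin2020.axisCutoff_props`, `productCutoff_props`
(`Seregin2020SwirlMoserCutoffs`, cut-offs vanishing AT the axis — not the shape needed here),
`exists_cylindrical_cutoff` (`PeriodicCylinderNeumannInterior`, radial factor only).
Mathlib: `Filter.EventuallyEq.fderiv_eq`, `fderiv_const_apply`, `tsupport_fderiv_subset`,
`closure_minimal`, `isClosed_le`. `lean search 'step1_cutoff|exists_productCutoff' --decl`: no
matches (2026-08-17).

## References

* G. Seregin, J. Math. Fluid Mech. 24 (2022), Paper No. 27 = arXiv:2201.00153, §2 Step 1 (arXiv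
  p. 5: the cut-off `η = φ(r)ψ(x₃)ξ(t)` and `supp |∇η|`). [`Seregin2022LocalAxisym`]
-/

section Part2

open _root_.Set _root_.Filter _root_.Topology _root_.Function _root_.Metric
open scoped _root_.ContDiff
open Literature.Analysis.FluidPDE

namespace Literature.Analysis.SereginLogSwirlOrigin.EulerScaling

/-! ### The two factors -/

section Factors

/-- **A function constant on an open set has zero derivative there.** [folklore]
[cite: Seregin2022LocalAxisym, §2 proof of Thm. 1.2, Step 1 (arXiv:2201.00153 pp. 4–7) (source of the ARGUMENT this module implements; this declaration is the cell’s own lemma or plumbing, NOT a printed statement)] -/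
theorem fderiv_eq_zero_of_eqOn_isOpen {f : EuclideanSpace ℝ (Fin 3) → ℝ} {O : Set (EuclideanSpace ℝ (Fin 3))}
    (hO : IsOpen O) {c : ℝ} (hf : ∀ y ∈ O, f y = c) {x : EuclideanSpace ℝ (Fin 3)} (hx : x ∈ O) :
    fderiv ℝ f x = 0 := by
  have hev : f =ᶠ[𝓝 x] fun _ => c := by
    filter_upwards [hO.mem_nhds hx] with y hy using hf y hy
  rw [hev.fderiv_eq]
  exact fderiv_const_apply c

/-- **The radial factor `φ(x) = Θ_{ρ₁,ρ₂}(x₀² + x₁²)`** (Seregin: "`φ(r) = 1` if `0 ≤ r < 1/2`;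
`φ(r) = 0` if `r ≥ 5/6`", here with general radii `0 < ρ₁ < ρ₂`): `C^∞` (a smooth profile of the
polynomial `x₀² + x₁² = ϱ²`), valued in `[0, 1]`, `φ = 1` for `ϱ ≤ ρ₁`, `φ = 0` for `ρ₂ ≤ ϱ`, and
invariant under the rotations `R_θ` about the axis. [cite: Seregin2022LocalAxisym, §2 Step 1 (arXiv:2201.00153 p. 5), the factor φ] -/
theorem radialFactor_props {ρ₁ ρ₂ : ℝ} (h₁ : 0 < ρ₁) (h₁₂ : ρ₁ < ρ₂)
    {φ : EuclideanSpace ℝ (Fin 3) → ℝ} (hφ : ∀ x, φ x = cutoffProfile ρ₁ ρ₂ (x 0 ^ 2 + x 1 ^ 2)) :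
    ContDiff ℝ ∞ φ ∧ (∀ x, 0 ≤ φ x ∧ φ x ≤ 1) ∧ (∀ x, cylRadius x ≤ ρ₁ → φ x = 1) ∧
      (∀ x, ρ₂ ≤ cylRadius x → φ x = 0) ∧ (∀ θ x, φ (rotZ θ x) = φ x) := by
  have hfun : φ = fun x => cutoffProfile ρ₁ ρ₂ (x 0 ^ 2 + x 1 ^ 2) := funext hφ
  have hsq : ContDiff ℝ ∞ fun y : EuclideanSpace ℝ (Fin 3) => y 0 ^ 2 + y 1 ^ 2 :=
    ((contDiff_piLp_apply (𝕜 := ℝ) (p := 2) (i := (0 : Fin 3))).pow 2).add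
      ((contDiff_piLp_apply (𝕜 := ℝ) (p := 2) (i := (1 : Fin 3))).pow 2)
  refine ⟨?_, fun x => ?_, fun x hx => ?_, fun x hx => ?_, fun θ x => ?_⟩
  · rw [hfun]
    exact (cutoffProfile_contDiff ρ₁ ρ₂).comp hsq
  · rw [hφ]
    exact ⟨cutoffProfile_nonneg _ _ _, cutoffProfile_le_one _ _ _⟩
  · rw [hφ, ← cylRadius_sq]
    exact cutoffProfile_eq_one h₁.le h₁₂ (pow_le_pow_left₀ (cylRadius_nonneg x) hx 2)
  · rw [hφ, ← cylRadius_sq]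
    exact cutoffProfile_eq_zero h₁.le h₁₂ (pow_le_pow_left₀ (h₁.le.trans h₁₂.le) hx 2)
  · rw [hφ, hφ, ← cylRadius_sq, ← cylRadius_sq, cylRadius_rotZ]

/-- **The axial factor `ψ(x) = Θ_{a,b}((x₃ - c)²)`** (Seregin: "`ψ(x₃) = 1` if `0 ≤ x₃ < 1/2`;
`ψ(x₃) = 0` if `x₃ ≥ 5/6`", here centred at `c` with plateau half-width `a` and outer half-width
`b`, `0 ≤ a < b`): `C^∞`, valued in `[0, 1]`, `ψ = 1` for `|x₃ - c| ≤ a`, `ψ = 0` for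
`b ≤ |x₃ - c|`, and invariant under the rotations about the axis (they fix `x₃`). [cite: Seregin2022LocalAxisym, §2 Step 1 (arXiv:2201.00153 p. 5), the factor ψ] -/
theorem axialFactor_props {a b c : ℝ} (ha : 0 ≤ a) (hab : a < b)
    {ψ : EuclideanSpace ℝ (Fin 3) → ℝ} (hψ : ∀ x, ψ x = cutoffProfile a b ((x 2 - c) ^ 2)) :
    ContDiff ℝ ∞ ψ ∧ (∀ x, 0 ≤ ψ x ∧ ψ x ≤ 1) ∧ (∀ x, |x 2 - c| ≤ a → ψ x = 1) ∧
      (∀ x, b ≤ |x 2 - c| → ψ x = 0) ∧ (∀ θ x, ψ (rotZ θ x) = ψ x) := by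
  have hfun : ψ = fun x => cutoffProfile a b ((x 2 - c) ^ 2) := funext hψ
  have hsq : ContDiff ℝ ∞ fun y : EuclideanSpace ℝ (Fin 3) => (y 2 - c) ^ 2 :=
    ((contDiff_piLp_apply (𝕜 := ℝ) (p := 2) (i := (2 : Fin 3))).sub contDiff_const).pow 2
  refine ⟨?_, fun x => ?_, fun x hx => ?_, fun x hx => ?_, fun θ x => ?_⟩
  · rw [hfun]
    exact (cutoffProfile_contDiff a b).comp hsq
  · rw [hψ]
    exact ⟨cutoffProfile_nonneg _ _ _, cutoffProfile_le_one _ _ _⟩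
  · rw [hψ, ← sq_abs]
    exact cutoffProfile_eq_one ha hab (pow_le_pow_left₀ (abs_nonneg _) hx 2)
  · rw [hψ, ← sq_abs]
    exact cutoffProfile_eq_zero ha hab (pow_le_pow_left₀ (ha.trans hab.le) hx 2)
  · rw [hψ, hψ, rotZ_apply_two]

end Factors

/-! ### Elementary geometry of the boxes -/

section Geometry

/-- **`𝒞(r)` lies in the plateau box**: if `0 < r ≤ ρ₁`, `r ≤ h₊ - δ/2` and `r ≤ -(h₋ + δ/2)`,
then every `x ∈ 𝒞(0, r)` has `ϱ(x) ≤ ρ₁` and `h₋ + δ/2 ≤ x₃ ≤ h₊ - δ/2`. [folklore]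
[cite: Seregin2022LocalAxisym, §2 proof of Thm. 1.2, Step 1 (arXiv:2201.00153 pp. 4–7) (source of the ARGUMENT this module implements; this declaration is the cell’s own lemma or plumbing, NOT a printed statement)] -/
theorem spaceCyl_subset_box {ρ₁ hp hm δ r : ℝ} (hr₁ : r ≤ ρ₁) (hrp : r ≤ hp - δ / 2)
    (hrm : r ≤ -(hm + δ / 2)) {x : EuclideanSpace ℝ (Fin 3)}
    (hx : x ∈ SereginSverak2009.spaceCyl (0 : EuclideanSpace ℝ (Fin 3)) r) :
    cylRadius x ≤ ρ₁ ∧ hm + δ / 2 ≤ x 2 ∧ x 2 ≤ hp - δ / 2 := by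
  rw [SereginSverak2009.mem_spaceCyl, sub_zero] at hx
  obtain ⟨h1, h2⟩ := hx
  have h2' : |x 2| < r := by simpa using h2
  obtain ⟨hl, hu⟩ := abs_lt.1 h2'
  exact ⟨h1.le.trans hr₁, by linarith, by linarith⟩

/-- **Points of the gradient box are regular top-slice points**: if `0 < ρ₁` and
`ρ₁ ≤ ϱ(x) ∨ |x₃ - h₊| ≤ δ/2 ∨ |x₃ - h₋| ≤ δ/2` with `δ > 0`, then
`0 < ϱ(x) ∨ |x₃ - h₊| < δ ∨ |x₃ - h₋| < δ` (the disjunction of the core hypothesis of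
`seregin2022_logSwirl_regularAtOrigin_of_cleanRepr`). [folklore]
[cite: Seregin2022LocalAxisym, §2 proof of Thm. 1.2, Step 1 (arXiv:2201.00153 pp. 4–7) (source of the ARGUMENT this module implements; this declaration is the cell’s own lemma or plumbing, NOT a printed statement)] -/
theorem good_of_mem_gradBox {ρ₁ hp hm δ : ℝ} (h₁ : 0 < ρ₁) (hδ : 0 < δ) {x : EuclideanSpace ℝ (Fin 3)}
    (hx : ρ₁ ≤ cylRadius x ∨ |x 2 - hp| ≤ δ / 2 ∨ |x 2 - hm| ≤ δ / 2) :
    0 < cylRadius x ∨ |x 2 - hp| < δ ∨ |x 2 - hm| < δ := by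
  rcases hx with h | h | h
  · exact Or.inl (h₁.trans_le h)
  · exact Or.inr (Or.inl (h.trans_lt (by linarith)))
  · exact Or.inr (Or.inr (h.trans_lt (by linarith)))

/-- **The support box lies in `𝒞`**: `{ϱ ≤ ρ₂, h₋ - δ/2 ≤ x₃ ≤ h₊ + δ/2} ⊆ 𝒞(0, 1)` when
`ρ₂ < 1`, `-1 ≤ h₋ - δ`, `h₊ + δ ≤ 1`, `δ > 0`. [folklore]
[cite: Seregin2022LocalAxisym, §2 proof of Thm. 1.2, Step 1 (arXiv:2201.00153 pp. 4–7) (source of the ARGUMENT this module implements; this declaration is the cell’s own lemma or plumbing, NOT a printed statement)] -/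
theorem box_subset_spaceCyl {ρ₂ hp hm δ : ℝ} (h₂ : ρ₂ < 1) (hδ : 0 < δ) (hm1 : -1 ≤ hm - δ)
    (hp1 : hp + δ ≤ 1) :
    {x : EuclideanSpace ℝ (Fin 3) | cylRadius x ≤ ρ₂ ∧ hm - δ / 2 ≤ x 2 ∧ x 2 ≤ hp + δ / 2} ⊆
      SereginSverak2009.spaceCyl (0 : EuclideanSpace ℝ (Fin 3)) 1 := by
  rintro x ⟨hr, hl, hu⟩
  rw [SereginSverak2009.mem_spaceCyl, sub_zero]
  refine ⟨hr.trans_lt h₂, ?_⟩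
  have : |x 2| < 1 := abs_lt.2 ⟨by linarith, by linarith⟩
  simpa using this

/-- The support box is closed. [folklore]
[cite: Seregin2022LocalAxisym, §2 proof of Thm. 1.2, Step 1 (arXiv:2201.00153 pp. 4–7) (source of the ARGUMENT this module implements; this declaration is the cell’s own lemma or plumbing, NOT a printed statement)] -/
theorem isClosed_box (ρ₂ lo hi : ℝ) :
    IsClosed {x : EuclideanSpace ℝ (Fin 3) | cylRadius x ≤ ρ₂ ∧ lo ≤ x 2 ∧ x 2 ≤ hi} := by
  have h2 : Continuous fun x : EuclideanSpace ℝ (Fin 3) => x 2 :=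
    (EuclideanSpace.proj (2 : Fin 3)).continuous
  exact (isClosed_le continuous_cylRadius continuous_const).inter
    ((isClosed_le continuous_const h2).inter (isClosed_le h2 continuous_const))

/-- The gradient box is closed. [folklore]
[cite: Seregin2022LocalAxisym, §2 proof of Thm. 1.2, Step 1 (arXiv:2201.00153 pp. 4–7) (source of the ARGUMENT this module implements; this declaration is the cell’s own lemma or plumbing, NOT a printed statement)] -/
theorem isClosed_gradBox (ρ₁ ρ₂ lo hi hp hm δ : ℝ) :
    IsClosed {x : EuclideanSpace ℝ (Fin 3) | cylRadius x ≤ ρ₂ ∧ lo ≤ x 2 ∧ x 2 ≤ hi ∧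
      (ρ₁ ≤ cylRadius x ∨ |x 2 - hp| ≤ δ / 2 ∨ |x 2 - hm| ≤ δ / 2)} := by
  have h2 : Continuous fun x : EuclideanSpace ℝ (Fin 3) => x 2 :=
    (EuclideanSpace.proj (2 : Fin 3)).continuous
  have e : {x : EuclideanSpace ℝ (Fin 3) | cylRadius x ≤ ρ₂ ∧ lo ≤ x 2 ∧ x 2 ≤ hi ∧
      (ρ₁ ≤ cylRadius x ∨ |x 2 - hp| ≤ δ / 2 ∨ |x 2 - hm| ≤ δ / 2)} =
      {x | cylRadius x ≤ ρ₂ ∧ lo ≤ x 2 ∧ x 2 ≤ hi} ∩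
        ({x | ρ₁ ≤ cylRadius x} ∪ ({x | |x 2 - hp| ≤ δ / 2} ∪ {x | |x 2 - hm| ≤ δ / 2})) := by
    ext x
    simp only [mem_setOf_eq, mem_inter_iff, mem_union]
    tauto
  rw [e]
  refine (isClosed_box ρ₂ lo hi).inter ((isClosed_le continuous_const continuous_cylRadius).union
    ((isClosed_le ?_ continuous_const).union (isClosed_le ?_ continuous_const)))
  · exact (h2.sub continuous_const).abs
  · exact (h2.sub continuous_const).abs

/-- The support box lies in the closed ball `B̄(0, 2)` (`ϱ ≤ ρ₂ < 1`, `|x₃| ≤ 1`). [folklore]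
[cite: Seregin2022LocalAxisym, §2 proof of Thm. 1.2, Step 1 (arXiv:2201.00153 pp. 4–7) (source of the ARGUMENT this module implements; this declaration is the cell’s own lemma or plumbing, NOT a printed statement)] -/
theorem box_subset_closedBall {ρ₂ hp hm δ : ℝ} (h₂ : ρ₂ < 1) (hδ : 0 < δ) (hm1 : -1 ≤ hm - δ)
    (hp1 : hp + δ ≤ 1) :
    {x : EuclideanSpace ℝ (Fin 3) | cylRadius x ≤ ρ₂ ∧ hm - δ / 2 ≤ x 2 ∧ x 2 ≤ hp + δ / 2} ⊆
      closedBall (0 : EuclideanSpace ℝ (Fin 3)) 2 := by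
  rintro x ⟨hr, hl, hu⟩
  have hρ₂ : 0 ≤ ρ₂ := (cylRadius_nonneg x).trans hr
  have h01 : x 0 ^ 2 + x 1 ^ 2 ≤ 1 := by
    rw [← cylRadius_sq]
    have := pow_le_pow_left₀ (cylRadius_nonneg x) hr 2
    nlinarith
  have h2 : x 2 ^ 2 ≤ 1 := by
    have hl' : -1 ≤ x 2 := by linarith
    have hu' : x 2 ≤ 1 := by linarith
    nlinarith
  rw [mem_closedBall, dist_zero_right, EuclideanSpace.norm_eq, Fin.sum_univ_three]
  simp only [Real.norm_eq_abs, sq_abs]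
  rw [Real.sqrt_le_iff]
  exact ⟨by norm_num, by nlinarith⟩

/-- The support box is compact (closed and bounded). [folklore]
[cite: Seregin2022LocalAxisym, §2 proof of Thm. 1.2, Step 1 (arXiv:2201.00153 pp. 4–7) (source of the ARGUMENT this module implements; this declaration is the cell’s own lemma or plumbing, NOT a printed statement)] -/
theorem isCompact_box {ρ₂ hp hm δ : ℝ} (h₂ : ρ₂ < 1) (hδ : 0 < δ) (hm1 : -1 ≤ hm - δ)
    (hp1 : hp + δ ≤ 1) :
    IsCompact {x : EuclideanSpace ℝ (Fin 3) | cylRadius x ≤ ρ₂ ∧ hm - δ / 2 ≤ x 2 ∧ x 2 ≤ hp + δ / 2} :=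
  (isCompact_closedBall (0 : EuclideanSpace ℝ (Fin 3)) 2).of_isClosed_subset (isClosed_box _ _ _)
    (box_subset_closedBall h₂ hδ hm1 hp1)

end Geometry

/-! ### The cut-off -/

/-- **Seregin 2022, §2 Step 1: the spatial cut-off `ζ = φ(ϱ)ψ(x₃)` adapted to two regular
heights.** For radii `0 < ρ₁ < ρ₂ < 1` and heights/width `h₋, h₊, δ` with `δ > 0`,
`-1 ≤ h₋ - δ`, `h₋ + δ < 0 < h₊ - δ`, `h₊ + δ ≤ 1` (the configuration of the core of
`seregin2022_logSwirl_regularAtOrigin_of_cleanRepr` at `(0, 1)`), there is `ζ : ℝ³ → ℝ` with: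
`ζ ∈ C^∞`; `ζ` axisymmetric; compact support; `0 ≤ ζ ≤ 1`; `ζ = 1` on the closed box
`{ϱ ≤ ρ₁, h₋ + δ/2 ≤ x₃ ≤ h₊ - δ/2}`; `ζ ≠ 0` only in the open box
`{ϱ < ρ₂, h₋ - δ/2 < x₃ < h₊ + δ/2}`; `tsupport ζ ⊆ {ϱ ≤ ρ₂, h₋ - δ/2 ≤ x₃ ≤ h₊ + δ/2} ⊆ 𝒞`;
and the location of `supp ∇ζ` ("in the set `supp |∇η|`, functions `v`, `∇v`, `∇²v` are
bounded"): `tsupport (∇ζ)` lies in the support box intersected with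
`{ρ₁ ≤ ϱ} ∪ {|x₃ - h₊| ≤ δ/2} ∪ {|x₃ - h₋| ≤ δ/2}`, a compact set of points off the axis or
strictly within `δ` of one of the heights, and `∇ζ(x) ≠ 0` only at such points.
Witness: `ζ(x) = Θ_{ρ₁,ρ₂}(x₀² + x₁²) · Θ_{a,b}((x₃ - c)²)` with `c = (h₊ + h₋)/2`,
`a = (h₊ - h₋)/2 - δ/2`, `b = (h₊ - h₋)/2 + δ/2` (`Θ = cutoffProfile`). Registered sub-goal toward
`stub_sereginLogSwirlOrigin`. [cite: Seregin2022LocalAxisym, §2 Step 1 (arXiv:2201.00153 p. 5), the cut-off η = φ(r)ψ(x₃)ξ(t) and supp|∇η|] -/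
theorem exists_step1_cutoff : ∀ (ρ₁ ρ₂ hp hm δ : ℝ), 0 < ρ₁ → ρ₁ < ρ₂ → ρ₂ < 1 → 0 < δ → -1 ≤ hm - δ → hm + δ < 0 → 0 < hp - δ → hp + δ ≤ 1 → ∃ ζ : EuclideanSpace ℝ (Fin 3) → ℝ, ContDiff ℝ (⊤ : ℕ∞) ζ ∧ IsAxisymmetricScalar ζ ∧ HasCompactSupport ζ ∧ (∀ x, 0 ≤ ζ x ∧ ζ x ≤ 1) ∧ (∀ x, cylRadius x ≤ ρ₁ → hm + δ / 2 ≤ x 2 → x 2 ≤ hp - δ / 2 → ζ x = 1) ∧ (∀ x, ζ x ≠ 0 → cylRadius x < ρ₂ ∧ hm - δ / 2 < x 2 ∧ x 2 < hp + δ / 2) ∧ tsupport ζ ⊆ {x | cylRadius x ≤ ρ₂ ∧ hm - δ / 2 ≤ x 2 ∧ x 2 ≤ hp + δ / 2} ∧ tsupport ζ ⊆ SereginSverak2009.spaceCyl 0 1 ∧ tsupport (fderiv ℝ ζ) ⊆ {x | cylRadius x ≤ ρ₂ ∧ hm - δ / 2 ≤ x 2 ∧ x 2 ≤ hp + δ /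 2 ∧ (ρ₁ ≤ cylRadius x ∨ |x 2 - hp| ≤ δ / 2 ∨ |x 2 - hm| ≤ δ / 2)} ∧ (∀ x, fderiv ℝ ζ x ≠ 0 → ρ₁ ≤ cylRadius x ∨ |x 2 - hp| ≤ δ / 2 ∨ |x 2 - hm| ≤ δ / 2) := by
  intro ρ₁ ρ₂ hp hm δ h₁ h₁₂ h₂ hδ hm1 hm0 hp0 hp1
  -- the parameters of the axial factor
  set c : ℝ := (hp + hm) / 2 with hc
  set a : ℝ := (hp - hm) / 2 - δ / 2 with ha
  set b : ℝ := (hp - hm) / 2 + δ / 2 with hb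
  have ha0 : 0 ≤ a := by rw [ha]; linarith
  have hab : a < b := by rw [ha, hb]; linarith
  -- the two factors
  set φ : EuclideanSpace ℝ (Fin 3) → ℝ := fun x => cutoffProfile ρ₁ ρ₂ (x 0 ^ 2 + x 1 ^ 2) with hφ
  set ψ : EuclideanSpace ℝ (Fin 3) → ℝ := fun x => cutoffProfile a b ((x 2 - c) ^ 2) with hψ
  obtain ⟨hφC, hφ01, hφ1, hφ0, hφrot⟩ := radialFactor_props h₁ h₁₂ (φ := φ) fun x => rfl
  obtain ⟨hψC, hψ01, hψ1, hψ0, hψrot⟩ := axialFactor_props ha0 hab (ψ := ψ) (c := c) fun x => rfl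
  -- the axial plateau and support in terms of the heights
  have hψ1' : ∀ x : EuclideanSpace ℝ (Fin 3), hm + δ / 2 ≤ x 2 → x 2 ≤ hp - δ / 2 → ψ x = 1 :=
    fun x hl hu => hψ1 x (abs_le.2 ⟨by rw [ha, hc]; linarith, by rw [ha, hc]; linarith⟩)
  have hψ0l : ∀ x : EuclideanSpace ℝ (Fin 3), x 2 ≤ hm - δ / 2 → ψ x = 0 := fun x hx =>
    hψ0 x (by rw [hb, hc, abs_sub_comm]; exact le_abs.2 (Or.inl (by linarith)))
  have hψ0u : ∀ x : EuclideanSpace ℝ (Fin 3), hp + δ / 2 ≤ x 2 → ψ x = 0 := fun x hx =>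
    hψ0 x (by rw [hb, hc]; exact le_abs.2 (Or.inl (by linarith)))
  -- values: nonzero only in the open box, one on the plateau box
  have hnz : ∀ x : EuclideanSpace ℝ (Fin 3), φ x * ψ x ≠ 0 →
      cylRadius x < ρ₂ ∧ hm - δ / 2 < x 2 ∧ x 2 < hp + δ / 2 := by
    intro x hx
    refine ⟨?_, ?_, ?_⟩
    · by_contra h
      exact hx (by rw [hφ0 x (not_lt.1 h), zero_mul])
    · by_contra h
      exact hx (by rw [hψ0l x (not_lt.1 h), mul_zero])
    · by_contra h
      exact hx (by rw [hψ0u x (not_lt.1 h), mul_zero])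
  have hts : tsupport (fun x => φ x * ψ x) ⊆
      {x | cylRadius x ≤ ρ₂ ∧ hm - δ / 2 ≤ x 2 ∧ x 2 ≤ hp + δ / 2} := by
    refine closure_minimal (fun x hx => ?_) (isClosed_box _ _ _)
    obtain ⟨h1, h2, h3⟩ := hnz x (mem_support.1 hx)
    exact ⟨h1.le, h2.le, h3.le⟩
  have hts1 : tsupport (fun x => φ x * ψ x) ⊆ SereginSverak2009.spaceCyl 0 1 :=
    hts.trans (box_subset_spaceCyl h₂ hδ hm1 hp1)
  -- the gradient vanishes on the open exterior and on the open plateau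
  have hcont2 : Continuous fun x : EuclideanSpace ℝ (Fin 3) => x 2 :=
    (EuclideanSpace.proj (2 : Fin 3)).continuous
  have hD0 : ∀ x : EuclideanSpace ℝ (Fin 3), (ρ₂ < cylRadius x ∨ x 2 < hm - δ / 2 ∨ hp + δ / 2 < x 2) →
      fderiv ℝ (fun x => φ x * ψ x) x = 0 := by
    intro x hx
    have hO : IsOpen {y : EuclideanSpace ℝ (Fin 3) | ρ₂ < cylRadius y ∨ y 2 < hm - δ / 2 ∨ hp + δ / 2 < y 2} :=
      (isOpen_lt continuous_const continuous_cylRadius).union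
        ((isOpen_lt hcont2 continuous_const).union (isOpen_lt continuous_const hcont2))
    refine fderiv_eq_zero_of_eqOn_isOpen hO (c := 0) (fun y hy => ?_) hx
    by_contra h
    obtain ⟨h1, h2, h3⟩ := hnz y h
    rcases hy with hy | hy | hy <;> linarith
  have hD1 : ∀ x : EuclideanSpace ℝ (Fin 3), (cylRadius x < ρ₁ ∧ hm + δ / 2 < x 2 ∧ x 2 < hp - δ / 2) →
      fderiv ℝ (fun x => φ x * ψ x) x = 0 := by
    intro x hx
    have hO : IsOpen {y : EuclideanSpace ℝ (Fin 3) | cylRadius y < ρ₁ ∧ hm + δ / 2 < y 2 ∧ y 2 < hp - δ / 2} :=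
      (isOpen_lt continuous_cylRadius continuous_const).inter
        ((isOpen_lt continuous_const hcont2).inter (isOpen_lt hcont2 continuous_const))
    refine fderiv_eq_zero_of_eqOn_isOpen hO (c := 1) (fun y hy => ?_) hx
    obtain ⟨hy1, hy2, hy3⟩ := hy
    rw [hφ1 y hy1.le, hψ1' y hy2.le hy3.le, one_mul]
  have hgrad : ∀ x : EuclideanSpace ℝ (Fin 3), fderiv ℝ (fun x => φ x * ψ x) x ≠ 0 →
      cylRadius x ≤ ρ₂ ∧ hm - δ / 2 ≤ x 2 ∧ x 2 ≤ hp + δ / 2 ∧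
        (ρ₁ ≤ cylRadius x ∨ |x 2 - hp| ≤ δ / 2 ∨ |x 2 - hm| ≤ δ / 2) := by
    intro x hx
    have h0 : ¬ (ρ₂ < cylRadius x ∨ x 2 < hm - δ / 2 ∨ hp + δ / 2 < x 2) := fun h => hx (hD0 x h)
    have h1 : ¬ (cylRadius x < ρ₁ ∧ hm + δ / 2 < x 2 ∧ x 2 < hp - δ / 2) := fun h => hx (hD1 x h)
    simp only [not_or, not_lt, not_and] at h0 h1
    obtain ⟨h01, h02, h03⟩ := h0
    refine ⟨h01, h02, h03, ?_⟩
    by_cases hr : ρ₁ ≤ cylRadius x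
    · exact Or.inl hr
    · right
      by_cases hl : x 2 ≤ hm + δ / 2
      · exact Or.inr (abs_le.2 ⟨by linarith, by linarith⟩)
      · have hu : hp - δ / 2 ≤ x 2 := h1 (not_le.1 hr) (not_le.1 hl)
        exact Or.inl (abs_le.2 ⟨by linarith, by linarith⟩)
  -- the cut-off
  refine ⟨fun x => φ x * ψ x, hφC.mul hψC, ?_, ?_, ?_, ?_, hnz, hts, hts1, ?_, fun x hx => (hgrad x hx).2.2.2⟩
  · -- axisymmetry
    intro θ x
    show φ (rotZ θ x) * ψ (rotZ θ x) = φ x * ψ x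
    rw [hφrot, hψrot]
  · -- compact support
    exact (isCompact_box h₂ hδ hm1 hp1).of_isClosed_subset (isClosed_tsupport _) hts
  · -- values in `[0, 1]`
    intro x
    obtain ⟨h1, h2⟩ := hφ01 x
    obtain ⟨h3, h4⟩ := hψ01 x
    exact ⟨mul_nonneg h1 h3, by nlinarith⟩
  · -- plateau
    intro x hx hl hu
    show φ x * ψ x = 1
    rw [hφ1 x hx, hψ1' x hl hu, one_mul]
  · -- support of the gradient
    exact closure_minimal (fun x hx => hgrad x (mem_support.1 hx)) (isClosed_gradBox _ _ _ _ _ _ _)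

end Literature.Analysis.SereginLogSwirlOrigin.EulerScaling

end Part2

/-!
## Part 3 — port of `Summits/NavierStokesRegularity/NavierStokesRegularity/Theorems/AxisymmetricExtremalityAxisymmetricKatoGlobalStubSereginLogSwirlOriginLerayLogHardy.lean` (10 declarations kept)

# Seregin 2022, Lemma 2.2: the two-dimensional Leray (logarithmic Hardy) inequality on the unit
# cylinder — crux stmt-NavierStokesRegularity-15453 (`AxisymmetricExtremality.AxisymmetricKatoGlobal`), line registered, support for stub `stub_sereginLogSwirlOrigin`

Support file (`--supports stmt-NavierStokesRegularity-15453`; theorems only, everything proved)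
toward the registered stub `stub_sereginLogSwirlOrigin`, which is verbatim the named fact
`Literature.Analysis.FluidPDE.seregin2022_logSwirl_regularAtOrigin` (G. Seregin, *A note on local
regularity of axisymmetric solutions to the Navier–Stokes equations*, J. Math. Fluid Mech. 24
(2022), Paper 27 = arXiv:2201.00153, §2).  Step 3 of that proof absorbs the swirl terms `B₃`,
`A₀` with "a Leray type inequality in dimension two" (arXiv p. 6):

> **Lemma 2.2.** For any function `f ∈ C¹₀(𝒞)`, the following inequality is valid:
> `∫_𝒞 |f|²/(|x'|² ln²(e/|x'|)) dx ≤ 4 ∫_𝒞 |∇_{x'} f|² dx`.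
> The proof can be done with the help of integration by parts.

Here `𝒞 = {x : |x'| < 1, |x₃| < 1}` is the unit cylinder of `ℝ³`, `x' = (x₁, x₂, 0)`.  This file
proves Lemma 2.2 exactly in this form (`seregin2022_lemma22`): `f : ℝ³ → ℝ` of class `C¹` with
`tsupport f ⊆ 𝒞 = SereginSverak2009.spaceCyl 0 1`, `|x'| = cylRadius x`, the weight written as
`(cylRadius x)² · (log (exp 1 / cylRadius x))²` — the same expression as in the swirl hypothesis
(2.2) of the named fact — and `|∇_{x'} f|² = (Df[e₀])² + (Df[e₁])²`; together with

* `integrable_and_integral_sq_div_logWeight_le` — the same on `ℝ³` with the integrability of the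
  left-hand integrand (finite for `f ∈ C¹₀(𝒞)` although the weight is singular on the axis);
* `lintegral_sq_div_logWeight_le` — the `ℝ≥0∞` form on `ℝ³`, for every `f ∈ C¹(ℝ³)` that merely
  vanishes where `|x'| ≥ 1` (no support condition in `x₃`; the currency of the tree's energy
  estimates);
* `ray_lintegral_le`, `ray_logHardy` — the inequality along each horizontal ray
  `ρ ↦ (ρ cos θ, ρ sin θ, z)`, i.e. the printed integration by parts: the tree's
  `Literature.Analysis.Calculus.hardy_log_core` at `s = 1`
  (`∫₀¹ h²/(ρ(1 - ln ρ)²) ≤ 2h(1)² + 4∫₀¹ ρ h'²`, `1 - ln ρ = ln(e/ρ)`, `h(1) = 0`) and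
  `(∂_ρ f)² = (cos θ ∂₀f + sin θ ∂₁f)² ≤ (∂₀f)² + (∂₁f)²`;
* `lintegral_eq_lintegral_polar`, `lintegral_eq_lintegral_cylindrical` — Tonelli in polar
  coordinates on `EuclideanSpace ℝ (Fin 2)` and in cylindrical coordinates on
  `EuclideanSpace ℝ (Fin 3)` for lower Lebesgue integrals (no integrability proviso), assembled
  from Mathlib's `lintegral_comp_polarCoord_symm` and the tree's volume-preserving
  identifications `measurePreserving_toLp_fin_two` (`PlanarPolarIntegral`) and `cylSplit`
  (`CylindricalIntegration`).

Proof: `∫ = ∫ dz ∫ dθ ∫ ρ dρ` (Tonelli), the ray inequality for every `(θ, z)`, and back; the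
constant `4` is the printed (sharp) one.  Mathlib has no Hardy/Leray inequality; the tree's 1D
log-Hardy inequalities are `hardy_log_core` (used here) and `logHardy` (`LeiZhang2017LogHardy`).

## References

* G. Seregin, J. Math. Fluid Mech. 24 (2022), Paper No. 27 = arXiv:2201.00153, §2, Lemma 2.2
  (arXiv p. 6) and its use in Step 3. [`Seregin2022LocalAxisym`]
* J. Leray, J. Math. Pures Appl. 12 (1933), 1–82 (`∫ |u|²/(|x|² ln²|x|) ≤ 4 ∫ |∇u|²` in `ℝ²`).

Not carried from this source module (not needed by the declarations re-homed here; their consumers are Summits-side): `seregin2022_lemma22`.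
-/

section Part3

open _root_.Set _root_.MeasureTheory _root_.Filter _root_.Topology _root_.Function _root_.Metric
open scoped _root_.ENNReal _root_.NNReal
open Literature.Analysis.FluidPDE Literature.Analysis.Calculus

namespace Literature.Analysis.SereginLogSwirlOrigin.EulerScaling

/-! ### Polar and cylindrical coordinates for lower Lebesgue integrals -/

/-- The polar map `(ρ, θ) ↦ (ρ cos θ, ρ sin θ)` into `EuclideanSpace ℝ (Fin 2)` is continuous.
[folklore]
[cite: Seregin2022LocalAxisym, Lemma 2.2 (arXiv:2201.00153 pp. 4–7) (source of the ARGUMENT this module implements; this declaration is the cell’s own lemma or plumbing, NOT a printed statement)] -/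
theorem continuous_polarPt :
    Continuous fun p : ℝ × ℝ => (WithLp.toLp 2 ![p.1 * Real.cos p.2, p.1 * Real.sin p.2] : EuclideanSpace ℝ (Fin 2)) := by
  refine (PiLp.continuous_toLp 2 _).comp (continuous_pi fun i => ?_)
  fin_cases i
  · exact continuous_fst.mul (Real.continuous_cos.comp continuous_snd)
  · exact continuous_fst.mul (Real.continuous_sin.comp continuous_snd)

/-- **Tonelli in polar coordinates on `EuclideanSpace ℝ (Fin 2)`** (lower Lebesgue integrals, no
integrability proviso): `∫⁻ F = ∫⁻_{θ ∈ (-π, π)} ∫⁻_{ρ > 0} ρ F(ρ cos θ, ρ sin θ)`. [folklore]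
[cite: Seregin2022LocalAxisym, Lemma 2.2 (arXiv:2201.00153 pp. 4–7) (source of the ARGUMENT this module implements; this declaration is the cell’s own lemma or plumbing, NOT a printed statement)] -/
theorem lintegral_eq_lintegral_polar {F : EuclideanSpace ℝ (Fin 2) → ℝ≥0∞} (hF : Measurable F) :
    ∫⁻ w, F w = ∫⁻ θ in Ioo (-Real.pi) Real.pi, ∫⁻ ρ in Ioi (0 : ℝ),
      ENNReal.ofReal ρ * F (WithLp.toLp 2 ![ρ * Real.cos θ, ρ * Real.sin θ]) := by
  have h1 : ∫⁻ w, F w = ∫⁻ q : ℝ × ℝ, F (WithLp.toLp 2 ![q.1, q.2]) :=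
    (measurePreserving_toLp_fin_two.lintegral_comp_emb measurableEmbedding_toLp_fin_two F).symm
  have h2 := lintegral_comp_polarCoord_symm (fun q : ℝ × ℝ => F (WithLp.toLp 2 ![q.1, q.2]))
  rw [h1, ← h2, volume_restrict_polarCoord_target]
  simp only [polarCoord_symm_apply, smul_eq_mul]
  have hm : Measurable fun p : ℝ × ℝ =>
      ENNReal.ofReal p.1 * F (WithLp.toLp 2 ![p.1 * Real.cos p.2, p.1 * Real.sin p.2]) :=
    (ENNReal.measurable_ofReal.comp measurable_fst).mul (hF.comp continuous_polarPt.measurable)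
  rw [lintegral_prod_symm _ hm.aemeasurable]

/-- **Tonelli in cylindrical coordinates on `EuclideanSpace ℝ (Fin 3)`** (lower Lebesgue
integrals): `∫⁻ G = ∫⁻_z ∫⁻_{θ ∈ (-π, π)} ∫⁻_{ρ > 0} ρ G(ρ cos θ, ρ sin θ, z)`. [folklore]
[cite: Seregin2022LocalAxisym, Lemma 2.2 (arXiv:2201.00153 pp. 4–7) (source of the ARGUMENT this module implements; this declaration is the cell’s own lemma or plumbing, NOT a printed statement)] -/
theorem lintegral_eq_lintegral_cylindrical {G : EuclideanSpace ℝ (Fin 3) → ℝ≥0∞} (hG : Measurable G) :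
    ∫⁻ x, G x = ∫⁻ z : ℝ, ∫⁻ θ in Ioo (-Real.pi) Real.pi, ∫⁻ ρ in Ioi (0 : ℝ),
      ENNReal.ofReal ρ * G (WithLp.toLp 2 ![ρ * Real.cos θ, ρ * Real.sin θ, z]) := by
  have h1 : ∫⁻ x, G x = ∫⁻ p : ℝ × EuclideanSpace ℝ (Fin 2), G (cylSplit.symm p) :=
    (measurePreserving_cylSplit_symm.lintegral_comp_emb cylSplit.symm.measurableEmbedding G).symm
  have hGm : Measurable fun p : ℝ × EuclideanSpace ℝ (Fin 2) => G (cylSplit.symm p) := hG.comp cylSplit.symm.measurable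
  rw [h1, Measure.volume_eq_prod, lintegral_prod _ hGm.aemeasurable]
  refine lintegral_congr fun z => ?_
  rw [lintegral_eq_lintegral_polar (F := fun w => G (cylSplit.symm (z, w)))
    (hGm.comp measurable_prodMk_left)]
  simp only [cylSplit_symm_apply, Matrix.cons_val_zero, Matrix.cons_val_one]

/-! ### The ray inequality -/

/-- **The radial integration by parts** (the tree's `hardy_log_core` at `s = 1`; `1 - ln ρ =
ln(e/ρ)`): for `h ∈ C¹(ℝ)` with `h 1 = 0`, `∫₀¹ h²/(ρ (1 - ln ρ)²) dρ ≤ 4 ∫₀¹ ρ h'² dρ`. [cite: Seregin2022LocalAxisym, Lemma 2.2 (proof: "integration by parts")] -/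
theorem ray_logHardy {h h' : ℝ → ℝ} (hh : ∀ x, HasDerivAt h (h' x) x) (hh' : Continuous h')
    (h1 : h 1 = 0) :
    ∫ ρ in Ioo (0 : ℝ) 1, h ρ ^ 2 / (ρ * (1 - Real.log ρ) ^ 2) ≤
      4 * ∫ ρ in Ioo (0 : ℝ) 1, ρ * h' ρ ^ 2 := by
  have := hardy_log_core one_pos (f := h) (f' := h') (fun x _ => hh x) hh'.continuousOn
  simpa [div_one, h1] using this

/-- The cylindrical radius of the point `(ρ cos θ, ρ sin θ, z)` is `|ρ|`. [folklore]
[cite: Seregin2022LocalAxisym, Lemma 2.2 (arXiv:2201.00153 pp. 4–7) (source of the ARGUMENT this module implements; this declaration is the cell’s own lemma or plumbing, NOT a printed statement)] -/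
theorem cylRadius_cylPt (ρ θ z : ℝ) :
    cylRadius (WithLp.toLp 2 ![ρ * Real.cos θ, ρ * Real.sin θ, z] : EuclideanSpace ℝ (Fin 3)) = |ρ| := by
  rw [cylRadius]
  have e : (ρ * Real.cos θ) ^ 2 + (ρ * Real.sin θ) ^ 2 = ρ ^ 2 := by
    linear_combination ρ ^ 2 * Real.sin_sq_add_cos_sq θ
  simp only [Matrix.cons_val_zero, Matrix.cons_val_one]
  rw [e, Real.sqrt_sq_eq_abs]

/-- **The ray form of Lemma 2.2 in `ℝ≥0∞`.** For `f ∈ C¹(ℝ³)` vanishing where `|x'| ≥ 1` and a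
ray `ρ ↦ (ρ cos θ, ρ sin θ, z)`:
`∫_{ρ>0} ρ · f²/(|x'|² ln²(e/|x'|)) ≤ 4 ∫_{ρ>0} ρ · ((∂₀f)² + (∂₁f)²)` along the ray (the radial
integration by parts `ray_logHardy` plus `(∂_ρ f)² ≤ (∂₀f)² + (∂₁f)²`).
[cite: Seregin2022LocalAxisym, Lemma 2.2 (arXiv:2201.00153 p. 6)] -/
theorem ray_lintegral_le {f : EuclideanSpace ℝ (Fin 3) → ℝ} (hf : ContDiff ℝ 1 f)
    (hf0 : ∀ x, 1 ≤ cylRadius x → f x = 0) (θ z : ℝ) :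
    ∫⁻ ρ in Ioi (0 : ℝ), ENNReal.ofReal ρ * ENNReal.ofReal
        (f (WithLp.toLp 2 ![ρ * Real.cos θ, ρ * Real.sin θ, z]) ^ 2 /
          (cylRadius (WithLp.toLp 2 ![ρ * Real.cos θ, ρ * Real.sin θ, z] : EuclideanSpace ℝ (Fin 3)) ^ 2 *
            Real.log (Real.exp 1 /
              cylRadius (WithLp.toLp 2 ![ρ * Real.cos θ, ρ * Real.sin θ, z] : EuclideanSpace ℝ (Fin 3))) ^ 2)) ≤
      4 * ∫⁻ ρ in Ioi (0 : ℝ), ENNReal.ofReal ρ * ENNReal.ofReal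
        (fderiv ℝ f (WithLp.toLp 2 ![ρ * Real.cos θ, ρ * Real.sin θ, z])
            (EuclideanSpace.single 0 1) ^ 2 +
          fderiv ℝ f (WithLp.toLp 2 ![ρ * Real.cos θ, ρ * Real.sin θ, z])
            (EuclideanSpace.single 1 1) ^ 2) := by
  -- the ray as an affine map `ρ ↦ ρ • v + c`
  set v : EuclideanSpace ℝ (Fin 3) := WithLp.toLp 2 ![Real.cos θ, Real.sin θ, 0] with hv
  set c : EuclideanSpace ℝ (Fin 3) := WithLp.toLp 2 ![0, 0, z] with hc
  set γ : ℝ → EuclideanSpace ℝ (Fin 3) := fun ρ => WithLp.toLp 2 ![ρ * Real.cos θ, ρ * Real.sin θ, z] with hγ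
  have hγ_eq : ∀ ρ : ℝ, γ ρ = ρ • v + c := by
    intro ρ
    ext i
    fin_cases i <;> simp [hγ, hv, hc]
  have hγd : ∀ ρ : ℝ, HasDerivAt γ v ρ := by
    intro ρ
    have e : γ = fun ρ => ρ • v + c := funext hγ_eq
    rw [e]
    simpa using ((hasDerivAt_id ρ).smul_const v).add_const c
  have hγc : Continuous γ := continuous_iff_continuousAt.2 fun ρ => (hγd ρ).continuousAt
  -- the profile `h = f ∘ γ` and its derivative `h' = Df(γ)[v]`
  set h : ℝ → ℝ := fun ρ => f (γ ρ) with hh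
  set h' : ℝ → ℝ := fun ρ => fderiv ℝ f (γ ρ) v with hh'
  have hd : ∀ ρ, HasDerivAt h (h' ρ) ρ := fun ρ =>
    ((hf.differentiable one_ne_zero) _).hasFDerivAt.comp_hasDerivAt ρ (hγd ρ)
  have hDf : Continuous (fderiv ℝ f) := hf.continuous_fderiv one_ne_zero
  have hc' : Continuous h' := (hDf.comp hγc).clm_apply continuous_const
  have hhc : Continuous h := hf.continuous.comp hγc
  have hrad : ∀ ρ : ℝ, cylRadius (γ ρ) = |ρ| := fun ρ => cylRadius_cylPt ρ θ z
  have h1 : h 1 = 0 := hf0 _ (by rw [hrad 1, abs_one])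
  -- `(∂_ρ f)² ≤ (∂₀ f)² + (∂₁ f)²`
  set R : ℝ → ℝ := fun ρ => fderiv ℝ f (γ ρ) (EuclideanSpace.single 0 1) ^ 2 +
    fderiv ℝ f (γ ρ) (EuclideanSpace.single 1 1) ^ 2 with hR
  have hv_dec : v = Real.cos θ • EuclideanSpace.single (0 : Fin 3) (1 : ℝ) +
      Real.sin θ • EuclideanSpace.single (1 : Fin 3) (1 : ℝ) := by
    ext i
    fin_cases i <;> simp [hv]
  have hD8 : ∀ ρ, h' ρ ^ 2 ≤ R ρ := by
    intro ρ
    simp only [hh', hR]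
    rw [hv_dec, map_add, map_smul, map_smul, smul_eq_mul, smul_eq_mul]
    set a := fderiv ℝ f (γ ρ) (EuclideanSpace.single 0 1)
    set b := fderiv ℝ f (γ ρ) (EuclideanSpace.single 1 1)
    have key : a ^ 2 + b ^ 2 - (Real.cos θ * a + Real.sin θ * b) ^ 2 =
        (Real.cos θ * b - Real.sin θ * a) ^ 2 := by
      linear_combination (-(a ^ 2 + b ^ 2)) * Real.sin_sq_add_cos_sq θ
    nlinarith [sq_nonneg (Real.cos θ * b - Real.sin θ * a)]
  -- the two one-dimensional integrands and their integrability on `(0, 1)`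
  set L : ℝ → ℝ := fun ρ => h ρ ^ 2 / (ρ * (1 - Real.log ρ) ^ 2) with hL
  set Q : ℝ → ℝ := fun ρ => ρ * h' ρ ^ 2 with hQ
  have hLi : IntegrableOn L (Ioo 0 1) := by
    have := integrableOn_sq_div_mul_log_sq one_pos (hhc.continuousOn (s := Icc 0 1))
    simp only [div_one] at this
    exact this.mono_set Ioo_subset_Ioc_self
  have hQi : IntegrableOn Q (Ioo 0 1) :=
    ((continuous_id.mul (hc'.pow 2)).integrableOn_Icc (a := 0) (b := 1)).mono_set
      Ioo_subset_Icc_self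
  have hL_nn : 0 ≤ᵐ[volume.restrict (Ioo (0 : ℝ) 1)] L :=
    (ae_restrict_iff' measurableSet_Ioo).2 (Eventually.of_forall fun ρ hρ => by
      simp only [hL, Pi.zero_apply]
      have := hρ.1
      positivity)
  have hQ_nn : 0 ≤ᵐ[volume.restrict (Ioo (0 : ℝ) 1)] Q :=
    (ae_restrict_iff' measurableSet_Ioo).2 (Eventually.of_forall fun ρ hρ => by
      simp only [hQ, Pi.zero_apply]
      exact mul_nonneg hρ.1.le (sq_nonneg _))
  have hardy : ∫ ρ in Ioo (0 : ℝ) 1, L ρ ≤ 4 * ∫ ρ in Ioo (0 : ℝ) 1, Q ρ := ray_logHardy hd hc' h1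
  -- the left-hand side lives on `(0, 1)` and equals `∫₀¹ L`
  have hLHS_pt : ∀ ρ ∈ Ioi (0 : ℝ), ENNReal.ofReal ρ * ENNReal.ofReal
      (f (γ ρ) ^ 2 / (cylRadius (γ ρ) ^ 2 * Real.log (Real.exp 1 / cylRadius (γ ρ)) ^ 2)) =
      (Ioo (0 : ℝ) 1).indicator (fun ρ => ENNReal.ofReal (L ρ)) ρ := by
    intro ρ hρ
    have hρ0 : 0 < ρ := hρ
    rw [hrad ρ, abs_of_pos hρ0]
    by_cases hρ1 : ρ < 1
    · rw [indicator_of_mem (show ρ ∈ Ioo (0 : ℝ) 1 from ⟨hρ0, hρ1⟩),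
        ← ENNReal.ofReal_mul hρ0.le]
      congr 1
      have hlog : Real.log (Real.exp 1 / ρ) = 1 - Real.log ρ := by
        rw [Real.log_div (Real.exp_pos 1).ne' hρ0.ne', Real.log_exp]
      simp only [hL, hh, hlog]
      field_simp
    · rw [indicator_of_notMem (fun hm : ρ ∈ Ioo (0 : ℝ) 1 => hρ1 hm.2)]
      have : f (γ ρ) = 0 := hf0 _ (by rw [hrad ρ, abs_of_pos hρ0]; exact not_lt.1 hρ1)
      simp [this]
  have hLHS : ∫⁻ ρ in Ioi (0 : ℝ), ENNReal.ofReal ρ * ENNReal.ofReal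
      (f (γ ρ) ^ 2 / (cylRadius (γ ρ) ^ 2 * Real.log (Real.exp 1 / cylRadius (γ ρ)) ^ 2)) =
      ENNReal.ofReal (∫ ρ in Ioo (0 : ℝ) 1, L ρ) := by
    rw [setLIntegral_congr_fun measurableSet_Ioi hLHS_pt, lintegral_indicator measurableSet_Ioo,
      Measure.restrict_restrict measurableSet_Ioo, inter_eq_left.2 Ioo_subset_Ioi_self,
      ofReal_integral_eq_lintegral_ofReal hLi hL_nn]
  -- the right-hand side dominates `4 ∫₀¹ Q`
  have hRHS : ENNReal.ofReal (4 * ∫ ρ in Ioo (0 : ℝ) 1, Q ρ) ≤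
      4 * ∫⁻ ρ in Ioi (0 : ℝ), ENNReal.ofReal ρ * ENNReal.ofReal (R ρ) := by
    rw [ENNReal.ofReal_mul (by norm_num : (0 : ℝ) ≤ 4), ENNReal.ofReal_ofNat,
      ofReal_integral_eq_lintegral_ofReal hQi hQ_nn]
    refine mul_le_mul_right ((setLIntegral_mono' measurableSet_Ioo fun ρ hρ => ?_).trans
      (lintegral_mono_set Ioo_subset_Ioi_self)) 4
    rw [← ENNReal.ofReal_mul hρ.1.le]
    exact ENNReal.ofReal_le_ofReal (mul_le_mul_of_nonneg_left (hD8 ρ) hρ.1.le)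
  -- assemble
  change ∫⁻ ρ in Ioi (0 : ℝ), ENNReal.ofReal ρ * ENNReal.ofReal
      (f (γ ρ) ^ 2 / (cylRadius (γ ρ) ^ 2 * Real.log (Real.exp 1 / cylRadius (γ ρ)) ^ 2)) ≤
    4 * ∫⁻ ρ in Ioi (0 : ℝ), ENNReal.ofReal ρ * ENNReal.ofReal (R ρ)
  rw [hLHS]
  exact (ENNReal.ofReal_le_ofReal hardy).trans hRHS

/-! ### Lemma 2.2 on `ℝ³` and on the cylinder `𝒞` -/

/-- **Seregin 2022, Lemma 2.2, `ℝ≥0∞` form on `ℝ³`.** For `f ∈ C¹(ℝ³)` vanishing where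
`|x'| ≥ 1` (no assumption in `x₃`),
`∫ f²/(|x'|² ln²(e/|x'|)) dx ≤ 4 ∫ ((∂₀f)² + (∂₁f)²) dx = 4 ∫ |∇_{x'} f|² dx`
as lower Lebesgue integrals (cylindrical Tonelli + the ray inequality).
[cite: Seregin2022LocalAxisym, Lemma 2.2 (arXiv:2201.00153 p. 6)] -/
theorem lintegral_sq_div_logWeight_le {f : EuclideanSpace ℝ (Fin 3) → ℝ} (hf : ContDiff ℝ 1 f)
    (hf0 : ∀ x, 1 ≤ cylRadius x → f x = 0) :
    ∫⁻ x, ENNReal.ofReal (f x ^ 2 / (cylRadius x ^ 2 * Real.log (Real.exp 1 / cylRadius x) ^ 2)) ≤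
      4 * ∫⁻ x, ENNReal.ofReal (fderiv ℝ f x (EuclideanSpace.single 0 1) ^ 2 +
        fderiv ℝ f x (EuclideanSpace.single 1 1) ^ 2) := by
  have hWm : Measurable fun x : EuclideanSpace ℝ (Fin 3) =>
      ENNReal.ofReal (f x ^ 2 / (cylRadius x ^ 2 * Real.log (Real.exp 1 / cylRadius x) ^ 2)) := by
    refine ENNReal.measurable_ofReal.comp ?_
    exact (hf.continuous.measurable.pow_const 2).div
      ((continuous_cylRadius.measurable.pow_const 2).mul
        ((Real.measurable_log.comp (measurable_const.div continuous_cylRadius.measurable)).pow_const 2))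
  have hDf : Continuous (fderiv ℝ f) := hf.continuous_fderiv one_ne_zero
  have hRm : Measurable fun x : EuclideanSpace ℝ (Fin 3) => ENNReal.ofReal (fderiv ℝ f x (EuclideanSpace.single 0 1) ^ 2 +
      fderiv ℝ f x (EuclideanSpace.single 1 1) ^ 2) :=
    ENNReal.measurable_ofReal.comp (((hDf.clm_apply continuous_const).pow 2).add
      ((hDf.clm_apply continuous_const).pow 2)).measurable
  rw [lintegral_eq_lintegral_cylindrical hWm, lintegral_eq_lintegral_cylindrical hRm,
    ← lintegral_const_mul' _ _ ENNReal.ofNat_ne_top]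
  refine lintegral_mono fun z => ?_
  rw [← lintegral_const_mul' _ _ ENNReal.ofNat_ne_top]
  refine lintegral_mono fun θ => ?_
  exact ray_lintegral_le hf hf0 θ z

/-- A `C¹` function with `tsupport f ⊆ 𝒞` vanishes where `|x'| ≥ 1`. [folklore]
[cite: Seregin2022LocalAxisym, Lemma 2.2 (arXiv:2201.00153 pp. 4–7) (source of the ARGUMENT this module implements; this declaration is the cell’s own lemma or plumbing, NOT a printed statement)] -/
theorem eq_zero_of_one_le_cylRadius {f : EuclideanSpace ℝ (Fin 3) → ℝ}
    (hsupp : tsupport f ⊆ SereginSverak2009.spaceCyl 0 1) (x : EuclideanSpace ℝ (Fin 3)) (hx : 1 ≤ cylRadius x) :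
    f x = 0 := by
  by_contra hne
  have hx' : x ∈ SereginSverak2009.spaceCyl 0 1 := hsupp (subset_tsupport f (mem_support.2 hne))
  rw [SereginSverak2009.mem_spaceCyl, sub_zero] at hx'
  linarith [hx'.1]

/-- `𝒞 = 𝒞(0, 1)` is bounded: it lies in the closed ball of radius `2`. [folklore]
[cite: Seregin2022LocalAxisym, Lemma 2.2 (arXiv:2201.00153 pp. 4–7) (source of the ARGUMENT this module implements; this declaration is the cell’s own lemma or plumbing, NOT a printed statement)] -/
theorem spaceCyl_subset_closedBall :
    SereginSverak2009.spaceCyl (0 : EuclideanSpace ℝ (Fin 3)) 1 ⊆ closedBall (0 : EuclideanSpace ℝ (Fin 3)) 2 := by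
  intro x hx
  rw [SereginSverak2009.mem_spaceCyl, sub_zero] at hx
  obtain ⟨h1, h2⟩ := hx
  have h2' : |x 2| < 1 := by simpa using h2
  have hr2 : x 0 ^ 2 + x 1 ^ 2 < 1 := by
    rw [← cylRadius_sq]
    nlinarith [cylRadius_nonneg x]
  have hz2 : x 2 ^ 2 < 1 := by
    have := abs_lt.1 h2'
    nlinarith
  rw [mem_closedBall, dist_zero_right, EuclideanSpace.norm_eq, Fin.sum_univ_three]
  simp only [Real.norm_eq_abs, sq_abs]
  rw [Real.sqrt_le_iff]
  constructor
  · norm_num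
  · nlinarith

/-- **Seregin 2022, Lemma 2.2 (the two-dimensional Leray inequality), on `ℝ³`.** For
`f ∈ C¹₀(𝒞)` — `f ∈ C¹(ℝ³)` with `tsupport f ⊆ 𝒞 = {|x'| < 1, |x₃| < 1}` — the function
`f²/(|x'|² ln²(e/|x'|))` is integrable and
`∫ f²/(|x'|² ln²(e/|x'|)) dx ≤ 4 ∫ ((∂₀f)² + (∂₁f)²) dx = 4 ∫ |∇_{x'} f|² dx`.
[cite: Seregin2022LocalAxisym, Lemma 2.2 (arXiv:2201.00153 p. 6)] -/
theorem integrable_and_integral_sq_div_logWeight_le {f : EuclideanSpace ℝ (Fin 3) → ℝ} (hf : ContDiff ℝ 1 f)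
    (hsupp : tsupport f ⊆ SereginSverak2009.spaceCyl 0 1) :
    Integrable (fun x => f x ^ 2 / (cylRadius x ^ 2 * Real.log (Real.exp 1 / cylRadius x) ^ 2)) ∧
    ∫ x, f x ^ 2 / (cylRadius x ^ 2 * Real.log (Real.exp 1 / cylRadius x) ^ 2) ≤
      4 * ∫ x, (fderiv ℝ f x (EuclideanSpace.single 0 1) ^ 2 +
        fderiv ℝ f x (EuclideanSpace.single 1 1) ^ 2) := by
  set W : EuclideanSpace ℝ (Fin 3) → ℝ := fun x => f x ^ 2 / (cylRadius x ^ 2 * Real.log (Real.exp 1 / cylRadius x) ^ 2)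
    with hW
  set R : EuclideanSpace ℝ (Fin 3) → ℝ := fun x => fderiv ℝ f x (EuclideanSpace.single 0 1) ^ 2 +
    fderiv ℝ f x (EuclideanSpace.single 1 1) ^ 2 with hR
  have hf0 : ∀ x, 1 ≤ cylRadius x → f x = 0 := eq_zero_of_one_le_cylRadius hsupp
  have hcs : HasCompactSupport f :=
    IsCompact.of_isClosed_subset (isCompact_closedBall (0 : EuclideanSpace ℝ (Fin 3)) 2) (isClosed_tsupport f)
      (hsupp.trans spaceCyl_subset_closedBall)
  -- measurability / integrability bookkeeping
  have hW_nn : ∀ x, 0 ≤ W x := fun x => by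
    simp only [hW]
    positivity
  have hW_meas : Measurable W :=
    (hf.continuous.measurable.pow_const 2).div
      ((continuous_cylRadius.measurable.pow_const 2).mul
        ((Real.measurable_log.comp (measurable_const.div continuous_cylRadius.measurable)).pow_const 2))
  have hDf : Continuous (fderiv ℝ f) := hf.continuous_fderiv one_ne_zero
  have hR_cont : Continuous R :=
    ((hDf.clm_apply continuous_const).pow 2).add ((hDf.clm_apply continuous_const).pow 2)
  have hR_cs : HasCompactSupport R := by
    refine HasCompactSupport.intro hcs fun x hx => ?_
    have : fderiv ℝ f x = 0 := fderiv_of_notMem_tsupport ℝ hx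
    simp [hR, this]
  have hR_int : Integrable R := hR_cont.integrable_of_hasCompactSupport hR_cs
  have hR_nn : ∀ x, 0 ≤ R x := fun x => by
    simp only [hR]
    positivity
  -- the key inequality in `ℝ≥0∞`
  have hkey : ∫⁻ x, ENNReal.ofReal (W x) ≤ 4 * ∫⁻ x, ENNReal.ofReal (R x) :=
    lintegral_sq_div_logWeight_le hf hf0
  have hRlt : ∫⁻ x, ENNReal.ofReal (R x) < ∞ := by
    rw [← ofReal_integral_eq_lintegral_ofReal hR_int (Eventually.of_forall hR_nn)]
    exact ENNReal.ofReal_lt_top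
  have h4Rlt : 4 * ∫⁻ x, ENNReal.ofReal (R x) < ∞ := ENNReal.mul_lt_top (by simp) hRlt
  have hWlt : ∫⁻ x, ENNReal.ofReal (W x) < ∞ := hkey.trans_lt h4Rlt
  have hW_int : Integrable W :=
    ⟨hW_meas.aestronglyMeasurable,
      (hasFiniteIntegral_iff_ofReal (Eventually.of_forall hW_nn)).2 hWlt⟩
  refine ⟨hW_int, ?_⟩
  rw [integral_eq_lintegral_of_nonneg_ae (Eventually.of_forall hW_nn) hW_meas.aestronglyMeasurable,
    integral_eq_lintegral_of_nonneg_ae (Eventually.of_forall hR_nn)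
      hR_cont.measurable.aestronglyMeasurable]
  have := ENNReal.toReal_mono h4Rlt.ne hkey
  rwa [ENNReal.toReal_mul, ENNReal.toReal_ofNat] at this

end Literature.Analysis.SereginLogSwirlOrigin.EulerScaling

end Part3

/-!
## Part 4 — port of `Summits/NavierStokesRegularity/NavierStokesRegularity/Theorems/AxisymmetricExtremalityAxisymmetricKatoGlobalStubSereginLogSwirlOriginStep13Tools.lean` (3 declarations kept)

# Three small tools of Seregin 2022, §2 (Steps 1 and 3): the smallness radius, the pointwise
# use of (2.2), and the singularity-free slab above a singularity-free slice —
# crux stmt-NavierStokesRegularity-15453 (`AxisymmetricExtremality.AxisymmetricKatoGlobal`), line registered, support for stub `stub_sereginLogSwirlOrigin`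

Support file (`--supports stmt-NavierStokesRegularity-15453`; theorems only, everything proved)
toward the registered stub `stub_sereginLogSwirlOrigin` = the named fact
`Literature.Analysis.FluidPDE.seregin2022_logSwirl_regularAtOrigin` (G. Seregin, J. Math. Fluid
Mech. 24 (2022), Paper 27 = arXiv:2201.00153, §2). Three elementary inputs of that proof:

* `exists_radius_logSmall` (**Step 3**, arXiv p. 7: "Here, it is assumed that a number
  `r₁ ∈ ]0,1/4[` so small as `cC₁/ln(e/r₁) + cC₁²/ln⁴(e/|r₁|) < 2`."): for all real `c`, `C₁`
  there is `r₁ ∈ ]0, 1/4[` with `cC₁/ln(e/r) + cC₁²/ln⁴(e/r) < 2` for every `0 < r ≤ r₁`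
  (explicit witness `r₁ = min (1/8) (exp (-(|cC₁| + |cC₁²|)))`, since `ln(e/r) = 1 - ln r`).
* `abs_swirlVelocity_le_of_swirl_le`, `abs_swirlVelocity_div_cylRadius_le_of_swirl_le`,
  `abs_angVelQuot_le_of_swirl_le` (**Step 3**, the pointwise use of (2.2)
  `|σ| = r|v_θ| ≤ C₁/ln³(e/r)` in the estimates of `B₃` and `A₀`): off the axis,
  `|v_θ| ≤ C₁/(r ln³(e/r))` and `|v_θ/r| ≤ C₁/(r² ln³(e/r))`; here `v_θ = swirlVelocity`,
  `σ = swirl = r v_θ` (`swirl_eq_cylRadius_mul_swirlVelocity`), and `v_θ/r` is either the honest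
  quotient `swirlVelocity u x / cylRadius x` or the smooth Hou–Li variable `angVelQuot u`
  (`= swirl u / r²` for axisymmetric `u ∈ C²`, `IsAxisymmetric.cylRadius_sq_mul_angVelQuot`).
* `exists_slab_subset_of_slice_subset`, `exists_slab_disjoint_of_slice_disjoint'`,
  `exists_slab_disjoint_of_slice_disjoint` (registered form, `X = ℝ³`),
  `exists_slab_forall_isRegularPoint` (**Step 1**, arXiv p. 5: "one can find `t₀ ∈ ]-δ², 0[`
  such that there is no singular point in the set `𝒞̄(r₀) × [t₀, t₀ + δ₀²]`"): the tube lemma —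
  if a set `S ⊆ ℝ × X` is relatively closed in an open `O` (`closure S ∩ O ⊆ S`, e.g. a singular
  set, `closure_singularSet_inter_subset`), `K ⊆ X` is compact, and the slice `{t₀} × K` lies in
  `O` and misses `S` (such slices exist by `exists_forall_not_mem_slice_of_isParabolicNull`), then
  a whole slab `[t₀ - δ₀², t₀ + δ₀²] × K` (a fortiori `[t₀, t₀ + δ₀²] × K`) lies in `O` and misses
  `S` (`generalized_tube_lemma` applied to the open set `O ∖ closure S`).

## References

* G. Seregin, J. Math. Fluid Mech. 24 (2022), Paper No. 27 = arXiv:2201.00153, §2 Steps 1, 3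
  (arXiv pp. 5–7). [`Seregin2022LocalAxisym`]

Not carried from this source module (not needed by the declarations re-homed here; their consumers are Summits-side): `abs_swirlVelocity_div_cylRadius_le_of_swirl_le`, `exists_slab_subset_of_slice_subset`, `exists_slab_disjoint_of_slice_disjoint'`, `exists_slab_disjoint_of_slice_disjoint`, `exists_slab_forall_isRegularPoint`.
-/

section Part4

open _root_.Set _root_.Filter _root_.Topology _root_.Function _root_.Metric
open Literature.Analysis.FluidPDE

namespace Literature.Analysis.SereginLogSwirlOrigin.EulerScaling

/-! ### Step 3: the smallness radius `r₁` -/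

/-- **Seregin 2022, §2 Step 3, the choice of `r₁`** ("it is assumed that a number `r₁ ∈ ]0,1/4[`
so small as `cC₁/ln(e/r₁) + cC₁²/ln⁴(e/|r₁|) < 2`"): since `ln(e/r) = 1 - ln r → +∞` as
`r → 0⁺`, for all real `c, C₁` some `r₁ ∈ ]0, 1/4[` makes `cC₁/ln(e/r) + cC₁²/ln⁴(e/r) < 2` for
every `0 < r ≤ r₁`; explicitly `r₁ = min (1/8) (exp (-(|cC₁| + |cC₁²|)))`, for which
`ln(e/r) ≥ 1 + |cC₁| + |cC₁²|`. [cite: Seregin2022LocalAxisym, §2 Step 3 (arXiv:2201.00153 p. 7)] -/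
theorem exists_radius_logSmall : ∀ (c C₁ : ℝ), ∃ r₁ ∈ Set.Ioo (0:ℝ) (1/4), ∀ r ∈ Set.Ioc 0 r₁, c * C₁ / Real.log (Real.exp 1 / r) + c * C₁ ^ 2 / Real.log (Real.exp 1 / r) ^ 4 < 2 := by
  intro c C₁
  set A : ℝ := |c * C₁| + |c * C₁ ^ 2| with hA
  have hA0 : 0 ≤ A := by positivity
  refine ⟨min (1 / 8) (Real.exp (-A)), ⟨by positivity, (min_le_left _ _).trans_lt (by norm_num)⟩,
    ?_⟩
  rintro r ⟨hr0, hr1⟩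
  have hlogr : Real.log r ≤ -A := by
    have h := Real.log_le_log hr0 (hr1.trans (min_le_right _ _))
    rwa [Real.log_exp] at h
  have hL : Real.log (Real.exp 1 / r) = 1 - Real.log r := by
    rw [Real.log_div (Real.exp_pos 1).ne' hr0.ne', Real.log_exp]
  set L := Real.log (Real.exp 1 / r) with hLdef
  have hL1 : 1 + A ≤ L := by rw [hL]; linarith
  have hL0 : 0 < L := by linarith
  have hLle : L ≤ L ^ 4 := by
    calc L = L * 1 ^ 3 := by ring
      _ ≤ L * L ^ 3 := by gcongr; linarith
      _ = L ^ 4 := by ring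
  have h1 : c * C₁ / L ≤ |c * C₁| / L := by gcongr; exact le_abs_self _
  have h2 : c * C₁ ^ 2 / L ^ 4 ≤ |c * C₁ ^ 2| / L :=
    calc c * C₁ ^ 2 / L ^ 4 ≤ |c * C₁ ^ 2| / L ^ 4 := by gcongr; exact le_abs_self _
      _ ≤ |c * C₁ ^ 2| / L := div_le_div_of_nonneg_left (abs_nonneg _) hL0 hLle
  have h3 : (|c * C₁| + |c * C₁ ^ 2|) / L < 2 := by
    rw [div_lt_iff₀ hL0]
    linarith
  calc c * C₁ / L + c * C₁ ^ 2 / L ^ 4 ≤ |c * C₁| / L + |c * C₁ ^ 2| / L := add_le_add h1 h2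
    _ = (|c * C₁| + |c * C₁ ^ 2|) / L := (add_div _ _ _).symm
    _ < 2 := h3

/-! ### Step 3: the pointwise use of (2.2) -/

/-- **Seregin 2022, §2 Step 3, (2.2) on `v_θ`**: off the axis, `|σ| = r|v_θ| ≤ C₁/ln³(e/r)`
gives `|v_θ| ≤ C₁/(r ln³(e/r))` (`σ = swirl u`, `v_θ = swirlVelocity u`, `r = cylRadius x`; used
in the bound of `B₃ = -2∫ (v_θ/r)(η³Φ)(η³Γ)`). [cite: Seregin2022LocalAxisym, §2 Step 3, estimate of B₃ via (2.2) (arXiv:2201.00153 p. 6)] -/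
theorem abs_swirlVelocity_le_of_swirl_le : ∀ (u : EuclideanSpace ℝ (Fin 3) → EuclideanSpace ℝ (Fin 3)) (x : EuclideanSpace ℝ (Fin 3)) (C₁ : ℝ), 0 < cylRadius x → |swirl u x| ≤ C₁ / Real.log (Real.exp 1 / cylRadius x) ^ 3 → |swirlVelocity u x| ≤ C₁ / (cylRadius x * Real.log (Real.exp 1 / cylRadius x) ^ 3) := by
  intro u x C₁ hr hσ
  have hsv : swirlVelocity u x = swirl u x / cylRadius x := by
    rw [swirl_eq_cylRadius_mul_swirlVelocity u hr.ne', mul_div_cancel_left₀ _ hr.ne']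
  rw [hsv, abs_div, abs_of_pos hr, mul_comm, ← div_div]
  exact div_le_div_of_nonneg_right hσ hr.le

/-- **Seregin 2022, §2 Step 3, (2.2) on `v_θ/r` (smooth Hou–Li variable)**: for an axisymmetric
`u ∈ C²`, `angVelQuot u = σ/r²` off the axis (`IsAxisymmetric.cylRadius_sq_mul_angVelQuot`), so
`|σ| ≤ C₁/ln³(e/r)` gives `|angVelQuot u x| ≤ C₁/(r² ln³(e/r))`. [cite: Seregin2022LocalAxisym, §2 Step 3, estimate of A₀ via (2.2) (arXiv:2201.00153 p. 6)] -/
theorem abs_angVelQuot_le_of_swirl_le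
    {u : EuclideanSpace ℝ (Fin 3) → EuclideanSpace ℝ (Fin 3)} (hax : IsAxisymmetric u)
    (hu : ContDiff ℝ 2 u) {x : EuclideanSpace ℝ (Fin 3)} {C₁ : ℝ} (hr : 0 < cylRadius x)
    (hσ : |swirl u x| ≤ C₁ / Real.log (Real.exp 1 / cylRadius x) ^ 3) :
    |angVelQuot u x| ≤ C₁ / (cylRadius x ^ 2 * Real.log (Real.exp 1 / cylRadius x) ^ 3) := by
  have hr2 : 0 < cylRadius x ^ 2 := pow_pos hr 2
  have hq : angVelQuot u x = swirl u x / cylRadius x ^ 2 := by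
    rw [← hax.cylRadius_sq_mul_angVelQuot hu x, mul_div_cancel_left₀ _ hr2.ne']
  rw [hq, abs_div, abs_of_pos hr2, mul_comm, ← div_div]
  exact div_le_div_of_nonneg_right hσ hr2.le

/-! ### Step 1: a singularity-free slab above a singularity-free slice -/

end Literature.Analysis.SereginLogSwirlOrigin.EulerScaling

end Part4

/-!
## Part 5 — port of `Summits/NavierStokesRegularity/NavierStokesRegularity/Theorems/AxisymmetricExtremalityAxisymmetricKatoGlobalStubSereginLogSwirlOriginStep3SwirlSource.lean` (2 declarations kept)

# Seregin 2022, §2 Step 3: the bound of `B₃ = −2∫(v_θ/r)(η³Φ)(η³Γ)` by the swirl decay (2.2) and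
# the log-Hardy inequality (Lemma 2.2), with explicit constants —
# crux stmt-NavierStokesRegularity-15453 (`AxisymmetricExtremality.AxisymmetricKatoGlobal`), line registered, support for stub `stub_sereginLogSwirlOrigin`

Support file (`--supports stmt-NavierStokesRegularity-15453`; theorems only, everything proved)
toward the registered stub `stub_sereginLogSwirlOrigin` = the named fact
`Literature.Analysis.FluidPDE.seregin2022_logSwirl_regularAtOrigin` (G. Seregin, J. Math. Fluid
Mech. 24 (2022), Paper 27 = arXiv:2201.00153, §2). Step 3, arXiv p. 6:
"`B₃ = −2∫_{S₁}(v_θ/r)(η³Φ)(η³Γ) + (1/r₁)C(v,η) ≤ (cC₁/ln(e/r₁))(∫|η³Γ|²/(r²ln²(e/r)))^{1/2}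
(∫|η³Φ|²/(r²ln²(e/r)))^{1/2} + (1/r₁)C(v,η)` … Applying Lemma 2.2, we find
`B₃ ≤ (cC₁/ln(e/r₁))‖∇_{x'}(η³Γ)‖‖∇_{x'}(η³Φ)‖ + (1/r₁)C(v,η)`" (`S₁ = {r < r₁}`, using (2.2)
`|σ| = r|v_θ| ≤ cC₁/ln³(e/r)`).

* `log_exp_div_eq` — `ln(e/r) = 1 − ln r`;
* `abs_integral_angVelQuot_mul_mul_le` (registered sub-goal) — **the `B₃` bound**: for an
  axisymmetric `u ∈ C²` with `|σ| ≤ C₁/ln³(e/r)` on `0 < r < r₁ < 1`, `f, g ∈ C¹` supported in the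
  cylinder `𝒞 = spaceCyl 0 1`, and `|(v_θ/r)fg| ≤ M` on `{r ≥ r₁}` (`v_θ/r = angVelQuot u`; the
  paper's `(1/r₁)C(v,η)`):
  `|∫(v_θ/r) f g| ≤ (2C₁/ln(e/r₁))(∫|∇_{x'}f|² + ∫|∇_{x'}g|²) + M·|B(0,2)|`.
  Proof: a.e. (off the axis) near the axis `|v_θ/r| ≤ C₁/(r²ln³(e/r))`
  (`abs_angVelQuot_le_of_swirl_le`) and `ln(e/r) ≥ ln(e/r₁) > 1`, so
  `|(v_θ/r)fg| ≤ (C₁/ln(e/r₁))·(|f|/(r ln(e/r)))(|g|/(r ln(e/r))) ≤ (C₁/(2ln(e/r₁)))(F + G)`,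
  `F = f²/(r²ln²(e/r))`; away from it the pointwise bound on `𝒞 ⊆ B(0,2)`; integrate and apply
  Lemma 2.2 (`integrable_and_integral_sq_div_logWeight_le`: `∫F ≤ 4∫|∇_{x'}f|²`).

Used with `f = η³Γ`, `g = η³Φ` in the absorption (`…Step3Absorb`).

## Mathlib / tree search

Tree: `integrable_and_integral_sq_div_logWeight_le`, `spaceCyl_subset_closedBall`
(`…LerayLogHardy`), `abs_angVelQuot_le_of_swirl_le` (`…Step13Tools`), `contDiff_angVelQuot`,
`volume_setOf_cylRadius_eq_zero` (`SqIntegralBalance`). Mathlib: `integral_mono_ae`,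
`abs_integral_le_integral_abs`, `integral_indicator_one`, `two_mul_le_add_sq`,
`Continuous.integrable_of_hasCompactSupport`. `lean search 'angVelQuot_mul_mul|integral_B3'`:
no matches (2026-08-17).

## References

* G. Seregin, J. Math. Fluid Mech. 24 (2022), Paper No. 27 = arXiv:2201.00153, §2 Step 3
  (arXiv p. 6, the estimate of `B₃`; Lemma 2.2). [`Seregin2022LocalAxisym`]
-/

section Part5

open _root_.MeasureTheory _root_.Set _root_.Filter _root_.Topology _root_.Function _root_.Metric
open scoped _root_.ENNReal _root_.ContDiff
open Literature.Analysis.FluidPDE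

namespace Literature.Analysis.SereginLogSwirlOrigin.EulerScaling

section B3

variable {u : EuclideanSpace ℝ (Fin 3) → EuclideanSpace ℝ (Fin 3)} {f g : EuclideanSpace ℝ (Fin 3) → ℝ}

/-- `ln(e/r) = 1 − ln r` for `r > 0`, hence `ln(e/r₁) ≤ ln(e/r)` for `0 < r ≤ r₁` and
`1 < ln(e/r₁)` for `r₁ < 1`. [folklore]
[cite: Seregin2022LocalAxisym, §2 proof of Thm. 1.2, Step 3 (arXiv:2201.00153 pp. 4–7) (source of the ARGUMENT this module implements; this declaration is the cell’s own lemma or plumbing, NOT a printed statement)] -/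
theorem log_exp_div_eq (r : ℝ) (hr : 0 < r) : Real.log (Real.exp 1 / r) = 1 - Real.log r := by
  rw [Real.log_div (Real.exp_pos 1).ne' hr.ne', Real.log_exp]

/-- **Seregin 2022, §2 Step 3, the bound of `B₃ = −2∫(v_θ/r)(η³Φ)(η³Γ)`** via (2.2) and
Lemma 2.2 (arXiv p. 6: "`B₃ ≤ (cC₁/ln(e/r₁)) (∫|η³Γ|²/(r²ln²(e/r)))^{1/2}(∫|η³Φ|²/(r²ln²(e/r)))^{1/2}
+ (1/r₁)C(v,η) ≤ (cC₁/ln(e/r₁))‖∇_{x'}(η³Γ)‖‖∇_{x'}(η³Φ)‖ + (1/r₁)C(v,η)`"), fixed time, with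
explicit constants. For an axisymmetric `u ∈ C²` whose swirl obeys `|σ| ≤ C₁/ln³(e/r)` on
`0 < r < r₁` (`r₁ < 1`), `f, g ∈ C¹` supported in the cylinder `𝒞 = spaceCyl 0 1`, and a bound
`|(v_θ/r) f g| ≤ M` on `{r ≥ r₁}` (`v_θ/r = angVelQuot u`):
`|∫ (v_θ/r) f g| ≤ (2C₁/ln(e/r₁)) (∫|∇_{x'}f|² + ∫|∇_{x'}g|²) + M·|B(0,2)|`
(near the axis `|v_θ/r| ≤ C₁/(r²ln³(e/r)) ≤ (C₁/ln(e/r₁))·1/(r²ln²(e/r))`, `ab ≤ (a²+b²)/2`, and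
`seregin2022_lemma22`; away from it the pointwise bound on `𝒞 ⊆ B(0,2)`).
[cite: Seregin2022LocalAxisym, §2 Step 3, estimate of B₃ (arXiv:2201.00153 p. 6)] -/
theorem abs_integral_angVelQuot_mul_mul_le : ∀ (u : EuclideanSpace ℝ (Fin 3) → EuclideanSpace ℝ (Fin 3)) (f g : EuclideanSpace ℝ (Fin 3) → ℝ) (C₁ r₁ M : ℝ), IsAxisymmetric u → ContDiff ℝ 2 u → ContDiff ℝ 1 f → ContDiff ℝ 1 g → tsupport f ⊆ SereginSverak2009.spaceCyl 0 1 → tsupport g ⊆ SereginSverak2009.spaceCyl 0 1 → 0 ≤ C₁ → 0 < r₁ → r₁ < 1 → 0 ≤ M → (∀ x, 0 < cylRadius x → cylRadius x < r₁ → |swirl u x| ≤ C₁ / Real.log (Real.exp 1 / cylRadius x) ^ 3) → (∀ x, r₁ ≤ cylRadius x → |angVelQuot u x * f x * g x| ≤ M) → |∫ x, angVelQuot u x * f x * g x| ≤ 2 * C₁ / Real.log (Real.exp 1 / r₁) * ((∫ x, (fderiv ℝ f x (EuclideanSpace.single 0 1) ^ 2 + fderiv ℝ f x (EuclideanSpace.single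 1 1) ^ 2)) + ∫ x, (fderiv ℝ g x (EuclideanSpace.single 0 1) ^ 2 + fderiv ℝ g x (EuclideanSpace.single 1 1) ^ 2)) + M * volume.real (closedBall (0 : EuclideanSpace ℝ (Fin 3)) 2) := by
  intro u f g C₁ r₁ M hax hu hf hg hfs hgs hC₁ hr₁ hr₁1 hM hσ hfar
  set L₁ : ℝ := Real.log (Real.exp 1 / r₁) with hL₁
  have hL₁1 : 1 < L₁ := by
    rw [hL₁, log_exp_div_eq r₁ hr₁]
    linarith [Real.log_neg hr₁ hr₁1]
  have hL₁0 : 0 < L₁ := by linarith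
  -- the weighted squares and Lemma 2.2
  set F : EuclideanSpace ℝ (Fin 3) → ℝ := fun x =>
    f x ^ 2 / (cylRadius x ^ 2 * Real.log (Real.exp 1 / cylRadius x) ^ 2) with hF
  set G : EuclideanSpace ℝ (Fin 3) → ℝ := fun x =>
    g x ^ 2 / (cylRadius x ^ 2 * Real.log (Real.exp 1 / cylRadius x) ^ 2) with hG
  obtain ⟨hFi, hFle⟩ := integrable_and_integral_sq_div_logWeight_le hf hfs
  obtain ⟨hGi, hGle⟩ := integrable_and_integral_sq_div_logWeight_le hg hgs
  have hF0 : ∀ x, 0 ≤ F x := fun x => by positivity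
  have hG0 : ∀ x, 0 ≤ G x := fun x => by positivity
  -- supports
  have hcs : HasCompactSupport f :=
    IsCompact.of_isClosed_subset (isCompact_closedBall (0 : EuclideanSpace ℝ (Fin 3)) 2)
      (isClosed_tsupport f) (hfs.trans spaceCyl_subset_closedBall)
  have hfzero : ∀ x, x ∉ closedBall (0 : EuclideanSpace ℝ (Fin 3)) 2 → f x = 0 := fun x hx =>
    image_eq_zero_of_notMem_tsupport fun h => hx (spaceCyl_subset_closedBall (hfs h))
  -- the integrand is continuous with compact support
  set w : EuclideanSpace ℝ (Fin 3) → ℝ := fun x => angVelQuot u x * f x * g x with hw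
  have hΦc : Continuous (angVelQuot u) := (contDiff_angVelQuot (n := 0) (by exact_mod_cast hu)).continuous
  have hwc : Continuous w := (hΦc.mul hf.continuous).mul hg.continuous
  have hwcs : HasCompactSupport w := (hcs.mul_left).mul_right
  have hwi : Integrable w := hwc.integrable_of_hasCompactSupport hwcs
  -- the indicator of the ball
  set χ : EuclideanSpace ℝ (Fin 3) → ℝ := (closedBall (0 : EuclideanSpace ℝ (Fin 3)) 2).indicator 1 with hχ
  have hχi : Integrable χ := by
    rw [hχ]
    exact (integrable_indicator_iff measurableSet_closedBall).2
      ((integrableOn_const_iff).2 (Or.inr (isCompact_closedBall _ _).measure_lt_top))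
  have hχ0 : ∀ x, 0 ≤ χ x := fun x => by
    rw [hχ]; exact indicator_nonneg (fun _ _ => zero_le_one) x
  -- the pointwise a.e. bound
  have hae : ∀ᵐ x ∂(volume : Measure (EuclideanSpace ℝ (Fin 3))), cylRadius x ≠ 0 := by
    rw [ae_iff]; simp only [ne_eq, not_not]; exact volume_setOf_cylRadius_eq_zero
  have hbound : ∀ᵐ x ∂(volume : Measure (EuclideanSpace ℝ (Fin 3))),
      |w x| ≤ C₁ / (2 * L₁) * (F x + G x) + M * χ x := by
    filter_upwards [hae] with x hx0
    have hr : 0 < cylRadius x := lt_of_le_of_ne (cylRadius_nonneg x) (Ne.symm hx0)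
    by_cases hnear : cylRadius x < r₁
    · -- near the axis
      set r := cylRadius x with hrdef
      set L := Real.log (Real.exp 1 / r) with hLdef
      have hLL : L₁ ≤ L := by
        rw [hLdef, hL₁, log_exp_div_eq r hr, log_exp_div_eq r₁ hr₁]
        linarith [Real.log_le_log hr hnear.le]
      have hL0 : 0 < L := by linarith
      have hq := abs_angVelQuot_le_of_swirl_le hax hu hr (hσ x hr hnear)
      -- `|Φ f g| ≤ C₁ |f||g| /(r² L³) ≤ (C₁/(2L₁)) (F + G)`
      have h1 : |w x| ≤ C₁ / (r ^ 2 * L ^ 3) * (|f x| * |g x|) := by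
        rw [hw]; simp only
        rw [abs_mul, abs_mul, mul_assoc]
        exact mul_le_mul_of_nonneg_right hq (by positivity)
      have hFx : F x = (f x / (r * L)) ^ 2 := by rw [hF]; simp only; rw [← hrdef, ← hLdef]; ring
      have hGx : G x = (g x / (r * L)) ^ 2 := by rw [hG]; simp only; rw [← hrdef, ← hLdef]; ring
      have h2 : C₁ / (r ^ 2 * L ^ 3) * (|f x| * |g x|) =
          (C₁ / L) * ((|f x| / (r * L)) * (|g x| / (r * L))) := by
        field_simp
      have h3 : (|f x| / (r * L)) * (|g x| / (r * L)) ≤ (F x + G x) / 2 := by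
        rw [hFx, hGx]
        have := two_mul_le_add_sq (|f x| / (r * L)) (|g x| / (r * L))
        rw [div_pow, div_pow, sq_abs, sq_abs, ← div_pow, ← div_pow] at this
        linarith
      have h4 : C₁ / L ≤ C₁ / L₁ := div_le_div_of_nonneg_left hC₁ hL₁0 hLL
      calc |w x| ≤ C₁ / (r ^ 2 * L ^ 3) * (|f x| * |g x|) := h1
        _ = (C₁ / L) * ((|f x| / (r * L)) * (|g x| / (r * L))) := h2
        _ ≤ (C₁ / L₁) * ((F x + G x) / 2) :=
            mul_le_mul h4 h3 (by positivity) (by positivity)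
        _ = C₁ / (2 * L₁) * (F x + G x) := by field_simp
        _ ≤ C₁ / (2 * L₁) * (F x + G x) + M * χ x := le_add_of_nonneg_right (mul_nonneg hM (hχ0 x))
    · -- away from the axis
      push Not at hnear
      have hFG : 0 ≤ C₁ / (2 * L₁) * (F x + G x) := by
        have := hF0 x; have := hG0 x; positivity
      by_cases hxB : x ∈ closedBall (0 : EuclideanSpace ℝ (Fin 3)) 2
      · have hχx : χ x = 1 := by rw [hχ]; exact indicator_of_mem hxB _
        rw [hχx, mul_one]
        linarith [hfar x hnear]
      · have : w x = 0 := by rw [hw]; simp [hfzero x hxB]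
        rw [this, abs_zero]
        exact add_nonneg hFG (mul_nonneg hM (hχ0 x))
  -- integrate
  have hFGi : Integrable (fun x => F x + G x) := hFi.add hGi
  have h1i : Integrable (fun x => C₁ / (2 * L₁) * (F x + G x)) := hFGi.const_mul _
  have h2i : Integrable (fun x => M * χ x) := hχi.const_mul M
  have hRi : Integrable (fun x => C₁ / (2 * L₁) * (F x + G x) + M * χ x) := h1i.add h2i
  have hint : ∫ x, |w x| ≤ C₁ / (2 * L₁) * ((∫ x, F x) + ∫ x, G x) + M * volume.real (closedBall (0 : EuclideanSpace ℝ (Fin 3)) 2) := by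
    have h := integral_mono_ae hwi.abs hRi hbound
    rw [integral_add h1i h2i, MeasureTheory.integral_const_mul,
      MeasureTheory.integral_const_mul, integral_add hFi hGi] at h
    have hχint : ∫ x, χ x = volume.real (closedBall (0 : EuclideanSpace ℝ (Fin 3)) 2) := by
      rw [hχ]; exact integral_indicator_one measurableSet_closedBall
    rw [hχint] at h
    exact h
  have habs : |∫ x, w x| ≤ ∫ x, |w x| := abs_integral_le_integral_abs
  have hFG4 : (∫ x, F x) + ∫ x, G x ≤
      4 * ((∫ x, (fderiv ℝ f x (EuclideanSpace.single 0 1) ^ 2 + fderiv ℝ f x (EuclideanSpace.single 1 1) ^ 2)) +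
        ∫ x, (fderiv ℝ g x (EuclideanSpace.single 0 1) ^ 2 + fderiv ℝ g x (EuclideanSpace.single 1 1) ^ 2)) := by
    linarith [hFle, hGle]
  have hcoef : 0 ≤ C₁ / (2 * L₁) := by positivity
  calc |∫ x, w x| ≤ ∫ x, |w x| := habs
    _ ≤ C₁ / (2 * L₁) * ((∫ x, F x) + ∫ x, G x) + M * volume.real (closedBall (0 : EuclideanSpace ℝ (Fin 3)) 2) := hint
    _ ≤ C₁ / (2 * L₁) * (4 * ((∫ x, (fderiv ℝ f x (EuclideanSpace.single 0 1) ^ 2 +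
          fderiv ℝ f x (EuclideanSpace.single 1 1) ^ 2)) +
        ∫ x, (fderiv ℝ g x (EuclideanSpace.single 0 1) ^ 2 + fderiv ℝ g x (EuclideanSpace.single 1 1) ^ 2))) +
        M * volume.real (closedBall (0 : EuclideanSpace ℝ (Fin 3)) 2) := by
        gcongr
    _ = _ := by ring

end B3

end Literature.Analysis.SereginLogSwirlOrigin.EulerScaling

end Part5

/-!
## Part 6 — port of `Summits/NavierStokesRegularity/NavierStokesRegularity/Theorems/AxisymmetricExtremalityAxisymmetricKatoGlobalStubSereginLogSwirlOriginCFZBounds.lean` (8 declarations kept)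

# Global `L²` bounds `‖∇(u_r/r)‖₂ ≤ ‖ω_θ/r‖₂`, `‖∇²(u_r/r)‖₂ ≤ ‖∂₃(ω_θ/r)‖₂` for compactly supported
# axisymmetric divergence-free fields (Chen–Fang–Zhang 2017, Lemma 2.3; Miao–Zheng 2013,
# Prop. 2.5; Lei–Zhang 2017, Lemma 2.1) — crux stmt-NavierStokesRegularity-15453
# (`AxisymmetricExtremality.AxisymmetricKatoGlobal`), line registered, support for stub
# `stub_sereginLogSwirlOrigin`

Support file (`--supports stmt-NavierStokesRegularity-15453`; theorems only, everything proved)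
toward the registered stub `stub_sereginLogSwirlOrigin` = the named fact
`Literature.Analysis.FluidPDE.seregin2022_logSwirl_regularAtOrigin` (G. Seregin, J. Math. Fluid
Mech. 24 (2022), Paper 27 = arXiv:2201.00153, §2). Step 2 there is Lemma 2.1, the localised
div–curl estimates `‖∇(η³v_r/r)‖₂ ≤ c‖η³Γ‖₂ + C(v,η)`, `‖∇̄²(η³v_r/r)‖₂ ≤ c‖η³Γ,₃‖₂ + C(v,η)`
(`Γ = ω_θ/r`), whose global core is quoted from Chen–Fang–Zhang 2017 (Lemma 2.3; also Miao–Zheng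
2013, Prop. 2.5, Hou–Lei–Li 2008, Lei–Zhang 2017, Lemma 2.1): for the function
`W = −(1/r) e_r · Δ⁻¹((ζω_θ),₃ e_r)`, i.e. `W = u_r/r` of the axisymmetric swirl-free
divergence-free field `u` with vorticity `ζω_θ e_θ`,
"`‖∇W‖_{2,ℝ³} ≤ c‖ζΓ‖_{2,ℝ³}`, `‖∇̄²W‖_{2,ℝ³} ≤ c‖(ζΓ),₃‖_{2,ℝ³}`" (arXiv p. 5).

This file proves these two GLOBAL bounds, with the absolute constant `c = 1` and the full
Cartesian Hessian, for every axisymmetric divergence-free vector field `u : ℝ³ → ℝ³` of class `C⁴`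
(first bound) / `C⁵` (second bound) with compact support, in the tree's smooth Hou–Li variables
`radVelQuot u = u_r/r`, `angVortQuot u = ω_θ/r` (`AxisymHouLiVariables`; no swirl-freeness is
needed — the swirl component enters neither `u_r/r` nor `ω_θ`):

* `integral_gradSq_radVelQuot_le_of_hasCompactSupport` — `∫ Σᵢ (∂ᵢ(u_r/r))² ≤ ∫ (ω_θ/r)²`;
* `eLpNorm_fderiv_radVelQuot_le_eLpNorm_angVortQuot` (registered sub-goal) — for every direction
  `a`, `‖a‖ ≤ 1`: `‖∂ₐ(u_r/r)‖_{L²(ℝ³)} ≤ ‖ω_θ/r‖_{L²(ℝ³)}`;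
* `integral_hessianSq_radVelQuot_le_of_hasCompactSupport` — `∫ Σᵢⱼ (∂ⱼ∂ᵢ(u_r/r))² ≤ ∫ (∂₃(ω_θ/r))²`;
* `eLpNorm_fderiv_fderiv_radVelQuot_le_eLpNorm_fderiv_angVortQuot` (registered sub-goal) — for
  all directions `a, b` of norm `≤ 1`: `‖∂_b∂ₐ(u_r/r)‖_{L²(ℝ³)} ≤ ‖∂₃(ω_θ/r)‖_{L²(ℝ³)}`.

Proof route (the `L²`/Plancherel content of the printed Calderón–Zygmund step is the
Hessian–Laplacian identity; no Biot–Savart law is needed): the tree proves Lei–Zhang's Lemma 2.1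
from the 5D-Laplacian identity `Δ(u_r/r) + (2/r)∂ᵣ(u_r/r) = ∂₃(ω_θ/r)`
(`IsAxisymmetric.laplacian_radVelQuot_add`) by two integrations by parts, as
`IsAxisymmetric.integral_gradSq_radVelQuot_le` (`∫|∇ρ|² ≤ ∫Γ²`) and
`IsAxisymmetric.integral_laplacian_radVelQuot_sq_le'` (`∫(Δρ)² ≤ ∫(∂₃Γ)²`), each under a dozen
explicit `L²` provisos on `ρ = u_r/r`, `Γ` and their derivatives, and
`integral_sum_sq_fderiv_fderiv_eq_integral_laplacian_sq_of_memLp` gives `∫|∇²ρ|² = ∫(Δρ)²`. Here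
the provisos are discharged for compactly supported fields: the smooth quotients `radQuot S`,
`radDerivQuot S` of a compactly supported axisymmetric scalar `S` (vanishing on the axis, for
`radQuot`) are compactly supported (off `{x₀ = 0}` they are `S/r²`, `∂₀S/x₀`, and a continuous
function vanishing on `U ∖ {x₀ = 0}`, `U` open, vanishes on `U`), hence so are `u_r/r`, `ω_θ/r`
and their derivatives, and continuous compactly supported functions are in `L²`; the directional
forms use the pointwise Cauchy–Schwarz bounds `(∂ₐρ)² ≤ ‖a‖²Σᵢ(∂ᵢρ)²` (`sq_fderiv_apply_le`),
`(∂_b∂ₐρ)² ≤ ‖a‖²‖b‖² Σᵢⱼ(∂ⱼ∂ᵢρ)²` (`sq_fderiv_fderiv_apply_le_normSq_mul_sum`).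

What remains of Lemma 2.1 after this file and the Hmidi–Rousset identity
(`hmidiRousset_identity`): the localisation bookkeeping for `ζv̄` (`ζ = η³`), which is compactly
supported but not divergence-free (`div(ζv̄) = v̄·∇ζ`); for it the identity above acquires the
source `(1/r)∂ᵣ(div u)` (`Δρ + 2q_ρ = ∂₃Γ + radDerivQuot (div u)`), whose contribution is the
printed `C(v,η)`.

## Mathlib / tree search

Tree inputs: `IsAxisymmetric.integral_gradSq_radVelQuot_le`,
`IsAxisymmetric.integral_laplacian_radVelQuot_sq_le'` (`HouLeiLiEstimate`, `AxisymGradientField`),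
`integral_sum_sq_fderiv_fderiv_eq_integral_laplacian_sq_of_memLp`, `sq_fderiv_apply_le`,
`fderiv_fderiv_apply_comm_vec_scalar`, `continuous/hasCompactSupport_fderiv_fderiv_apply`
(`HessianLaplacian`), `radQuot_eq_div`, `mul_radDerivQuot_eq_fderiv_zero` (`AxisymRadialQuotient`),
`hasCompactSupport_curl` (`VorticityCalculus`), `IsAxisymmetricScalar.fderiv_apply_single_two`.
Mathlib: `Continuous.memLp_of_hasCompactSupport`, `HasCompactSupport.mono'`,
`HasCompactSupport.fderiv_apply`, `fderiv_of_notMem_tsupport`, `MemLp.eLpNorm_eq_integral_rpow_norm`.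
`lean search 'hasCompactSupport_radQuot|hasCompactSupport_radVelQuot|eLpNorm_fderiv_radVelQuot|ChenFangZhang|MiaoZheng'`:
no matches (2026-08-17); the `H^∞` provisos (all Sobolev norms finite) are discharged in
`HouLiVariablesMemLp` (`IsAxisymmetric.abs_radVelQuot_le_of_sobolev`), not the compact-support ones.

## References

* G. Seregin, J. Math. Fluid Mech. 24 (2022), Paper No. 27 = arXiv:2201.00153, §2, Lemma 2.1
  (arXiv p. 5: "As to the function `W`, the global estimates have been already established in
  [ChenFangZhang2017]"). [`Seregin2022LocalAxisym`]
* H. Chen, D. Fang, T. Zhang, Discrete Contin. Dyn. Syst. 37 (2017) 1923–1939, Lemma 2.3;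
  C. Miao, X. Zheng, Comm. Math. Phys. 321 (2013) 33–67, Prop. 2.5. [`ChenFangZhang2017`]
* Z. Lei, Q. S. Zhang, Pacific J. Math. 289 (2017) 169–187 = arXiv:1505.02628, Lemma 2.1.
  [`LeiZhang2017`]

Not carried from this source module (not needed by the declarations re-homed here; their consumers are Summits-side): `hasCompactSupport_angVortQuot`, `eLpNorm_two_le_of_integral_sq_le'`, `sq_fderiv_fderiv_apply_le_normSq_mul_sum`, `integral_gradSq_radVelQuot_le_of_hasCompactSupport`, `eLpNorm_fderiv_radVelQuot_le_eLpNorm_angVortQuot`, `integral_hessianSq_radVelQuot_le_of_hasCompactSupport`, `eLpNorm_fderiv_fderiv_radVelQuot_le_eLpNorm_fderiv_angVortQuot`.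
-/

section Part6

open _root_.MeasureTheory _root_.Set _root_.Filter _root_.Topology _root_.Function
open scoped _root_.ENNReal _root_.ContDiff Laplacian
open Literature.Analysis.FluidPDE

namespace Literature.Analysis.SereginLogSwirlOrigin.EulerScaling

/-! ### Compact support of the smooth radial quotients -/

section Support

variable {S : EuclideanSpace ℝ (Fin 3) → ℝ}

/-- **Local density off the hyperplane `{x₀ = 0}`.** A continuous `g` which vanishes at the
points `z` of an open set `U` with `z₀ ≠ 0` vanishes on all of `U` (approach `y ∈ U` along
`t ↦ y + t e₀`, `t ≠ 0`). [folklore]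
[cite: Seregin2022LocalAxisym, §2 proof of Thm. 1.2; LeiZhang2017 (the `u_r/r`–`ω_θ/r` elliptic bounds) (source of the ARGUMENT this module implements; this declaration is the cell’s own lemma or plumbing, NOT a printed statement)] -/
theorem eq_zero_of_forall_apply_zero_ne {g : EuclideanSpace ℝ (Fin 3) → ℝ} (hg : Continuous g)
    {U : Set (EuclideanSpace ℝ (Fin 3))} (hU : IsOpen U)
    (h : ∀ z ∈ U, z 0 ≠ 0 → g z = 0) {y : EuclideanSpace ℝ (Fin 3)} (hy : y ∈ U) : g y = 0 := by
  by_cases hy0 : y 0 ≠ 0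
  · exact h y hy hy0
  push Not at hy0
  have htend : Tendsto (fun t : ℝ => y + t • (EuclideanSpace.single 0 1 : EuclideanSpace ℝ (Fin 3)))
      (𝓝[≠] 0) (𝓝 y) := by
    have hc : Continuous fun t : ℝ =>
        y + t • (EuclideanSpace.single 0 1 : EuclideanSpace ℝ (Fin 3)) := by fun_prop
    have := hc.tendsto 0
    rw [zero_smul, add_zero] at this
    exact this.mono_left nhdsWithin_le_nhds
  have hU' : ∀ᶠ t : ℝ in 𝓝[≠] 0,
      y + t • (EuclideanSpace.single 0 1 : EuclideanSpace ℝ (Fin 3)) ∈ U :=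
    htend (hU.mem_nhds hy)
  have hev : (fun t : ℝ => g (y + t • (EuclideanSpace.single 0 1 : EuclideanSpace ℝ (Fin 3))))
      =ᶠ[𝓝[≠] 0] fun _ => (0 : ℝ) := by
    filter_upwards [hU', self_mem_nhdsWithin] with t ht ht0
    refine h _ ht ?_
    simpa [hy0] using ht0
  exact tendsto_nhds_unique_of_eventuallyEq ((hg.tendsto y).comp htend) tendsto_const_nhds hev

/-- **`(∂ᵣS)/r` vanishes off the support of `S`**: for an axisymmetric scalar `S ∈ C²` and
`y ∉ tsupport S`, `radDerivQuot S y = 0` (off `{x₀ = 0}` it is `∂₀S/x₀`, `∂₀S = 0` off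
`tsupport S`, and density). [folklore]
[cite: Seregin2022LocalAxisym, §2 proof of Thm. 1.2; LeiZhang2017 (the `u_r/r`–`ω_θ/r` elliptic bounds) (source of the ARGUMENT this module implements; this declaration is the cell’s own lemma or plumbing, NOT a printed statement)] -/
theorem radDerivQuot_eq_zero_of_notMem_tsupport (hS : ContDiff ℝ 2 S) (hax : IsAxisymmetricScalar S)
    {y : EuclideanSpace ℝ (Fin 3)} (hy : y ∉ tsupport S) : radDerivQuot S y = 0 := by
  refine eq_zero_of_forall_apply_zero_ne (continuous_radDerivQuot hS)
    (isClosed_tsupport S).isOpen_compl (fun z hz hz0 => ?_) hy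
  have h := mul_radDerivQuot_eq_fderiv_zero hS hax z
  rw [fderiv_of_notMem_tsupport ℝ hz] at h
  simpa [hz0] using h

/-- **The radial derivative quotient of a compactly supported axisymmetric scalar `S ∈ C²` is
compactly supported** (`support ⊆ tsupport S`). [folklore]
[cite: Seregin2022LocalAxisym, §2 proof of Thm. 1.2; LeiZhang2017 (the `u_r/r`–`ω_θ/r` elliptic bounds) (source of the ARGUMENT this module implements; this declaration is the cell’s own lemma or plumbing, NOT a printed statement)] -/
theorem hasCompactSupport_radDerivQuot (hS : ContDiff ℝ 2 S) (hax : IsAxisymmetricScalar S)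
    (hc : HasCompactSupport S) : HasCompactSupport (radDerivQuot S) :=
  hc.mono' fun _ hy => by_contra fun h => hy (radDerivQuot_eq_zero_of_notMem_tsupport hS hax h)

/-- **`S/r²` vanishes off the support of `S`**: for an axisymmetric scalar `S ∈ C²` vanishing on
the axis and `y ∉ tsupport S`, `radQuot S y = 0` (off `{x₀ = 0}` it is `S/r²`, and density).
[folklore]
[cite: Seregin2022LocalAxisym, §2 proof of Thm. 1.2; LeiZhang2017 (the `u_r/r`–`ω_θ/r` elliptic bounds) (source of the ARGUMENT this module implements; this declaration is the cell’s own lemma or plumbing, NOT a printed statement)] -/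
theorem radQuot_eq_zero_of_notMem_tsupport (hS : ContDiff ℝ 2 S) (hax : IsAxisymmetricScalar S)
    (h0 : ∀ y, cylRadius y = 0 → S y = 0) {y : EuclideanSpace ℝ (Fin 3)} (hy : y ∉ tsupport S) :
    radQuot S y = 0 := by
  refine eq_zero_of_forall_apply_zero_ne (continuous_radQuot hS)
    (isClosed_tsupport S).isOpen_compl (fun z hz hz0 => ?_) hy
  have hr : cylRadius z ≠ 0 := fun h => hz0 ((cylRadius_eq_zero_iff z).1 h).1
  rw [radQuot_eq_div hS hax h0 hr, image_eq_zero_of_notMem_tsupport hz, zero_div]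

/-- **The radial quotient of a compactly supported axisymmetric scalar `S ∈ C²` vanishing on the
axis is compactly supported** (`support ⊆ tsupport S`). [folklore]
[cite: Seregin2022LocalAxisym, §2 proof of Thm. 1.2; LeiZhang2017 (the `u_r/r`–`ω_θ/r` elliptic bounds) (source of the ARGUMENT this module implements; this declaration is the cell’s own lemma or plumbing, NOT a printed statement)] -/
theorem hasCompactSupport_radQuot (hS : ContDiff ℝ 2 S) (hax : IsAxisymmetricScalar S)
    (h0 : ∀ y, cylRadius y = 0 → S y = 0) (hc : HasCompactSupport S) :
    HasCompactSupport (radQuot S) :=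
  hc.mono' fun _ hy => by_contra fun h => hy (radQuot_eq_zero_of_notMem_tsupport hS hax h0 h)

variable {u : EuclideanSpace ℝ (Fin 3) → EuclideanSpace ℝ (Fin 3)}

/-- **`u_r/r` of a compactly supported axisymmetric `u ∈ C²` is compactly supported.** [folklore]
[cite: Seregin2022LocalAxisym, §2 proof of Thm. 1.2; LeiZhang2017 (the `u_r/r`–`ω_θ/r` elliptic bounds) (source of the ARGUMENT this module implements; this declaration is the cell’s own lemma or plumbing, NOT a printed statement)] -/
theorem hasCompactSupport_radVelQuot (hu : ContDiff ℝ 2 u) (hax : IsAxisymmetric u)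
    (hc : HasCompactSupport u) : HasCompactSupport (radVelQuot u) := by
  have hcS : HasCompactSupport fun x : EuclideanSpace ℝ (Fin 3) => x 0 * u x 0 + x 1 * u x 1 := by
    refine hc.mono fun x hx => ?_
    rw [mem_support] at hx ⊢
    contrapose! hx
    simp [hx]
  unfold radVelQuot
  exact hasCompactSupport_radQuot (contDiff_horizontal_inner hu)
    hax.isAxisymmetricScalar_horizontal_inner
    (fun y hy => by
      obtain ⟨hy0, hy1⟩ := (cylRadius_eq_zero_iff y).1 hy
      simp [hy0, hy1]) hcS

end Support

/-! ### `L²` bookkeeping -/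

section LTwo

variable {f g : EuclideanSpace ℝ (Fin 3) → ℝ}

/-- `∂ₐf ∈ L²` for a compactly supported `f ∈ C¹`. [folklore]
[cite: Seregin2022LocalAxisym, §2 proof of Thm. 1.2; LeiZhang2017 (the `u_r/r`–`ω_θ/r` elliptic bounds) (source of the ARGUMENT this module implements; this declaration is the cell’s own lemma or plumbing, NOT a printed statement)] -/
theorem memLp_fderiv_apply_of_hasCompactSupport (hf : ContDiff ℝ 1 f) (hc : HasCompactSupport f)
    (a : EuclideanSpace ℝ (Fin 3)) : MemLp (fun x => fderiv ℝ f x a) 2 volume :=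
  ((hf.continuous_fderiv one_ne_zero).clm_apply continuous_const).memLp_of_hasCompactSupport
    (hc.fderiv_apply ℝ a)

/-- `∂_b∂ₐf ∈ L²` for a compactly supported `f ∈ C²`. [folklore]
[cite: Seregin2022LocalAxisym, §2 proof of Thm. 1.2; LeiZhang2017 (the `u_r/r`–`ω_θ/r` elliptic bounds) (source of the ARGUMENT this module implements; this declaration is the cell’s own lemma or plumbing, NOT a printed statement)] -/
theorem memLp_fderiv_fderiv_apply_of_hasCompactSupport (hf : ContDiff ℝ 2 f)
    (hc : HasCompactSupport f) (a b : EuclideanSpace ℝ (Fin 3)) :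
    MemLp (fun x => fderiv ℝ (fun y => fderiv ℝ f y a) x b) 2 volume :=
  (continuous_fderiv_fderiv_apply hf a b).memLp_of_hasCompactSupport
    (hasCompactSupport_fderiv_fderiv_apply hc a b)

end LTwo

/-! ### The global bounds for compactly supported fields -/

section Global

variable {u : EuclideanSpace ℝ (Fin 3) → EuclideanSpace ℝ (Fin 3)}

end Global

end Literature.Analysis.SereginLogSwirlOrigin.EulerScaling

end Part6

/-!
## Part 7 — port of `Summits/NavierStokesRegularity/NavierStokesRegularity/Theorems/AxisymmetricExtremalityAxisymmetricKatoGlobalStubSereginLogSwirlOriginStep3CutoffCalculus.lean` (11 declarations kept)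

# Cut-off calculus for Seregin 2022, §2 Step 3: integration by parts against a compactly
# supported weight, `∫ ζ²G ΔG`, `∫ ζ²G DG[b]`, and the product rule for `(∂ᵣ·)/r` —
# crux stmt-NavierStokesRegularity-15453 (`AxisymmetricExtremality.AxisymmetricKatoGlobal`), line registered, support for stub `stub_sereginLogSwirlOrigin`

Support file (`--supports stmt-NavierStokesRegularity-15453`; theorems only, everything proved)
toward the registered stub `stub_sereginLogSwirlOrigin` = the named fact
`Literature.Analysis.FluidPDE.seregin2022_logSwirl_regularAtOrigin` (G. Seregin, J. Math. Fluid
Mech. 24 (2022), Paper 27 = arXiv:2201.00153, §2). Step 3 there ("Local estimates of solutions",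
arXiv p. 6) multiplies the equations of `Φ = ω_r/r` and `Γ = ω_θ/r`,
`∂ₜG + (v − 2x'/|x'|²)·∇G − ΔG + (source) = 0`, by `Gη⁶` and integrates by parts over `𝒞`; the
cut-off `η` is compactly supported, the solution is NOT assumed to decay, so every integration by
parts is against a compactly supported factor. This file supplies that calculus on `ℝ³`, for
`ζ = η³ ∈ C¹` (resp. `C²`) with compact support and `G ∈ C²` arbitrary (no integrability):

* `integral_mul_fderiv_eq_neg_of_hasCompactSupport` — `∫ φ ∂ᵥψ = −∫ ∂ᵥφ ψ` (`φ ∈ C¹_c`, `ψ ∈ C¹`);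
  `integral_fderiv_apply_eq_zero_of_hasCompactSupport` — `∫ ∂ᵥφ = 0`;
  `integral_fderiv_apply_eq_zero_of_isDivFree` — `∫ Dφ[u] = 0` for a divergence-free `u ∈ C¹`;
* `integral_sq_mul_mul_fderiv_fderiv`, `integral_sq_mul_mul_laplacian` —
  **`∫ ζ²G ΔG = ∫ G²|∇ζ|² − ∫ |∇(ζG)|²`** (the viscous term: `−ΔG · Gη⁶` gives the dissipation
  `∫(η³|∇G|)²`-type term in the `η³G` form used by Step 4, `|η³G|²_{2,Q}`, plus the cut-off term);
* `integral_sq_mul_mul_fderiv_apply` (registered sub-goal) — **`∫ ζ²G DG[b] = −∫ ζG² Dζ[b]`** for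
  a divergence-free drift `b` (the transport term `(v·∇G) Gη⁶` gives only a cut-off term);
* `radDerivQuot_mul` (registered sub-goal) — **`q_{ζG} = ζ q_G + G q_ζ`** for axisymmetric
  `ζ, G ∈ C²`, `q_F = radDerivQuot F = (∂ᵣF)/r` (the drift `−(2x'/|x'|²)·∇G = −2q_G`; with it the
  axis term of `ζ²G q_G` is that of `(ζG) q_{ζG}`, which has a sign,
  `IsAxisymmetricScalar.integral_mul_radDerivQuot_nonpos`).

The energy identities themselves are in the sibling file `…Step3Gamma`.

## Mathlib / tree search

Mathlib: `integral_mul_fderiv_eq_neg_fderiv_mul_of_integrable` (by parts with integrable data),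
`Continuous.integrable_of_hasCompactSupport`, `HasCompactSupport.fderiv_apply / mul_right / mono`,
`fderiv_fun_mul`. Tree: `fderiv_apply_eq_sum_three` (`AxisymOmegaEnergy`),
`divergence_eq_sum_three`, `fderiv_apply_coord_vec3`, `contDiff_apply_coord_vec3`
(`AxisymHouLiVariables`), `laplacian_eq_sum_fderiv_fderiv` (`WholeSpaceIBP`),
`contDiff_fderiv_apply_const_succ`, `eq_of_eq_off_ker` (`AxisymmetricLiftR5`),
`mul_radDerivQuot_eq_fderiv_zero`, `continuous_radDerivQuot` (`AxisymRadialQuotient`),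
`IsAxisymmetricScalar.mul` (`HouLeiLiEstimate`). The tree's transport/Laplacian lemmas
(`integral_mul_fderiv_apply_eq_zero_of_isDivFree`, `integral_mul_laplacian_eq_neg`,
`AxisymTransportIBP`) assume globally bounded drifts and `L²` data; here compact support of the
weight replaces both. `lean search 'integral_sq_mul_mul|radDerivQuot_mul|of_hasCompactSupport.*fderiv_apply_eq'`:
no matches (2026-08-17).

## References

* G. Seregin, J. Math. Fluid Mech. 24 (2022), Paper No. 27 = arXiv:2201.00153, §2 Step 3
  (arXiv p. 6: "Let us multiply the first equation by `Φη⁶` and the second equation by `Γη⁶`.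
  After integration by parts, we find …"). [`Seregin2022LocalAxisym`]

Not carried from this source module (not needed by the declarations re-homed here; their consumers are Summits-side): `integral_fderiv_apply_eq_zero_of_hasCompactSupport`.
-/

section Part7

open _root_.MeasureTheory _root_.Set _root_.Filter _root_.Topology _root_.Function
open scoped _root_.ENNReal _root_.ContDiff Laplacian
open Literature.Analysis.FluidPDE

namespace Literature.Analysis.SereginLogSwirlOrigin.EulerScaling

/-! ### Integration by parts against a compactly supported factor -/

section Calculus

variable {φ ψ : EuclideanSpace ℝ (Fin 3) → ℝ} {u : EuclideanSpace ℝ (Fin 3) → EuclideanSpace ℝ (Fin 3)}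

/-- Product rule, applied form: `D(φψ)(x) v = φ(x) Dψ(x) v + ψ(x) Dφ(x) v`. [folklore]
[cite: Seregin2022LocalAxisym, §2 proof of Thm. 1.2, Step 3 (arXiv:2201.00153 pp. 4–7) (source of the ARGUMENT this module implements; this declaration is the cell’s own lemma or plumbing, NOT a printed statement)] -/
theorem fderiv_mul_apply_of_differentiableAt {x : EuclideanSpace ℝ (Fin 3)}
    (hφ : DifferentiableAt ℝ φ x) (hψ : DifferentiableAt ℝ ψ x) (v : EuclideanSpace ℝ (Fin 3)) :
    fderiv ℝ (fun y => φ y * ψ y) x v = φ x * fderiv ℝ ψ x v + ψ x * fderiv ℝ φ x v := by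
  rw [fderiv_fun_mul hφ hψ]
  simp only [_root_.add_apply, _root_.FunLike.coe_smul, Pi.smul_apply, smul_eq_mul]

/-- A function vanishing wherever the compactly supported `f` vanishes is compactly supported.
[folklore]
[cite: Seregin2022LocalAxisym, §2 proof of Thm. 1.2, Step 3 (arXiv:2201.00153 pp. 4–7) (source of the ARGUMENT this module implements; this declaration is the cell’s own lemma or plumbing, NOT a printed statement)] -/
theorem hasCompactSupport_of_eq_zero {f g : EuclideanSpace ℝ (Fin 3) → ℝ} (hf : HasCompactSupport f)
    (h : ∀ x, f x = 0 → g x = 0) : HasCompactSupport g :=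
  hf.mono fun x hx hfx => hx (h x hfx)

/-- `x ↦ Dφ(x) v` is continuous for `φ ∈ C¹`. [folklore]
[cite: Seregin2022LocalAxisym, §2 proof of Thm. 1.2, Step 3 (arXiv:2201.00153 pp. 4–7) (source of the ARGUMENT this module implements; this declaration is the cell’s own lemma or plumbing, NOT a printed statement)] -/
theorem continuous_fderiv_apply_of_contDiff (hφ : ContDiff ℝ 1 φ) (v : EuclideanSpace ℝ (Fin 3)) :
    Continuous fun x => fderiv ℝ φ x v :=
  (hφ.continuous_fderiv one_ne_zero).clm_apply continuous_const

/-- **Integration by parts with a compactly supported factor**: `∫ φ ∂ᵥψ = −∫ ∂ᵥφ ψ` for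
`φ ∈ C¹` with compact support and `ψ ∈ C¹` (no decay of `ψ` needed). [folklore]
[cite: Seregin2022LocalAxisym, §2 proof of Thm. 1.2, Step 3 (arXiv:2201.00153 pp. 4–7) (source of the ARGUMENT this module implements; this declaration is the cell’s own lemma or plumbing, NOT a printed statement)] -/
theorem integral_mul_fderiv_eq_neg_of_hasCompactSupport (hφ : ContDiff ℝ 1 φ)
    (hφc : HasCompactSupport φ) (hψ : ContDiff ℝ 1 ψ) (v : EuclideanSpace ℝ (Fin 3)) :
    ∫ x, φ x * fderiv ℝ ψ x v = -∫ x, fderiv ℝ φ x v * ψ x := by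
  have hφd : Differentiable ℝ φ := hφ.differentiable one_ne_zero
  have hψd : Differentiable ℝ ψ := hψ.differentiable one_ne_zero
  refine integral_mul_fderiv_eq_neg_fderiv_mul_of_integrable ?_ ?_ ?_ (fun x _ => hφd x)
    (fun x _ => hψd x)
  · exact ((continuous_fderiv_apply_of_contDiff hφ v).mul hψ.continuous).integrable_of_hasCompactSupport
      (hφc.fderiv_apply ℝ v).mul_right
  · exact (hφ.continuous.mul (continuous_fderiv_apply_of_contDiff hψ v)).integrable_of_hasCompactSupport
      hφc.mul_right
  · exact (hφ.continuous.mul hψ.continuous).integrable_of_hasCompactSupport hφc.mul_right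

/-- **The divergence theorem without boundary**: `∫ Dφ[u] = 0` for `φ ∈ C¹` with compact support
and a divergence-free `u ∈ C¹` (`Dφ[u] = div (φ u) − φ div u`). [folklore]
[cite: Seregin2022LocalAxisym, §2 proof of Thm. 1.2, Step 3 (arXiv:2201.00153 pp. 4–7) (source of the ARGUMENT this module implements; this declaration is the cell’s own lemma or plumbing, NOT a printed statement)] -/
theorem integral_fderiv_apply_eq_zero_of_isDivFree (hφ : ContDiff ℝ 1 φ) (hφc : HasCompactSupport φ)
    (hu : ContDiff ℝ 1 u) (hdiv : VectorCalculus.IsDivFree u) :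
    ∫ x, fderiv ℝ φ x (u x) = 0 := by
  have hφd : Differentiable ℝ φ := hφ.differentiable one_ne_zero
  have hud : Differentiable ℝ u := hu.differentiable one_ne_zero
  have hui : ∀ i : Fin 3, ContDiff ℝ 1 fun x => u x i := fun i => contDiff_apply_coord_vec3 hu i
  have huid : ∀ i : Fin 3, Differentiable ℝ fun x => u x i := fun i =>
    (hui i).differentiable one_ne_zero
  -- `∫ uᵢ ∂ᵢφ = -∫ ∂ᵢuᵢ φ`
  have hI : ∀ i : Fin 3, ∫ x, u x i * fderiv ℝ φ x (EuclideanSpace.single i 1) =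
      -∫ x, fderiv ℝ u x (EuclideanSpace.single i 1) i * φ x := by
    intro i
    have h := integral_mul_fderiv_eq_neg_of_hasCompactSupport hφ hφc (hui i)
      (EuclideanSpace.single i 1)
    -- `h : ∫ φ ∂ᵢuᵢ = -∫ ∂ᵢφ uᵢ`
    have e1 : ∫ x, u x i * fderiv ℝ φ x (EuclideanSpace.single i 1) =
        ∫ x, fderiv ℝ φ x (EuclideanSpace.single i 1) * u x i :=
      integral_congr_ae (Eventually.of_forall fun x => mul_comm _ _)
    have e2 : ∫ x, fderiv ℝ u x (EuclideanSpace.single i 1) i * φ x =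
        ∫ x, φ x * fderiv ℝ (fun y => u y i) x (EuclideanSpace.single i 1) :=
      integral_congr_ae (Eventually.of_forall fun x => by
        simp only [fderiv_apply_coord_vec3 (hud x) i]; ring)
    rw [e1, e2, h]
    ring
  -- integrability of the three pieces
  have hint : ∀ i : Fin 3, Integrable (fun x => u x i * fderiv ℝ φ x (EuclideanSpace.single i 1)) :=
    fun i => ((hui i).continuous.mul (continuous_fderiv_apply_of_contDiff hφ _)).integrable_of_hasCompactSupport
      (hφc.fderiv_apply ℝ _).mul_left
  have hint' : ∀ i : Fin 3, Integrable
      (fun x => fderiv ℝ u x (EuclideanSpace.single i 1) i * φ x) := fun i => by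
    have hc : Continuous fun x => fderiv ℝ u x (EuclideanSpace.single i 1) i := by
      have := continuous_fderiv_apply_of_contDiff (hui i) (EuclideanSpace.single i 1)
      refine this.congr fun x => ?_
      exact fderiv_apply_coord_vec3 (hud x) i _
    exact (hc.mul hφ.continuous).integrable_of_hasCompactSupport hφc.mul_left
  have hint01 : Integrable (fun x => u x 0 * fderiv ℝ φ x (EuclideanSpace.single 0 1) +
      u x 1 * fderiv ℝ φ x (EuclideanSpace.single 1 1)) := (hint 0).add (hint 1)
  have hsplit : ∫ x, fderiv ℝ φ x (u x) =
      (∫ x, u x 0 * fderiv ℝ φ x (EuclideanSpace.single 0 1)) +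
      (∫ x, u x 1 * fderiv ℝ φ x (EuclideanSpace.single 1 1)) +
      (∫ x, u x 2 * fderiv ℝ φ x (EuclideanSpace.single 2 1)) := by
    rw [← integral_add (hint 0) (hint 1), ← integral_add hint01 (hint 2)]
    refine integral_congr_ae (Eventually.of_forall fun x => ?_)
    beta_reduce
    rw [fderiv_apply_eq_sum_three φ x (u x)]
  have hint01' : Integrable (fun x => fderiv ℝ u x (EuclideanSpace.single 0 1) 0 * φ x +
      fderiv ℝ u x (EuclideanSpace.single 1 1) 1 * φ x) := (hint' 0).add (hint' 1)
  have hdivint : (∫ x, fderiv ℝ u x (EuclideanSpace.single 0 1) 0 * φ x) +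
      (∫ x, fderiv ℝ u x (EuclideanSpace.single 1 1) 1 * φ x) +
      (∫ x, fderiv ℝ u x (EuclideanSpace.single 2 1) 2 * φ x) = 0 := by
    rw [← integral_add (hint' 0) (hint' 1), ← integral_add hint01' (hint' 2)]
    refine integral_eq_zero_of_ae (Eventually.of_forall fun x => ?_)
    beta_reduce
    simp only [Pi.zero_apply]
    have h := divergence_eq_sum_three u x
    rw [hdiv x] at h
    calc fderiv ℝ u x (EuclideanSpace.single 0 1) 0 * φ x +
          fderiv ℝ u x (EuclideanSpace.single 1 1) 1 * φ x +
          fderiv ℝ u x (EuclideanSpace.single 2 1) 2 * φ x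
        = (fderiv ℝ u x (EuclideanSpace.single 0 1) 0 + fderiv ℝ u x (EuclideanSpace.single 1 1) 1 +
            fderiv ℝ u x (EuclideanSpace.single 2 1) 2) * φ x := by ring
      _ = 0 := by rw [← h, zero_mul]
  rw [hsplit, hI 0, hI 1, hI 2]
  linarith

end Calculus

/-! ### The cut-off calculus: `∫ ζ²G ΔG` and `∫ ζ²G DG[b]` -/

section Cutoff

variable {ζ G : EuclideanSpace ℝ (Fin 3) → ℝ} {b : EuclideanSpace ℝ (Fin 3) → EuclideanSpace ℝ (Fin 3)}

/-- `D(ζ²G) v = ζ² DG v + 2ζG Dζ v`. [folklore]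
[cite: Seregin2022LocalAxisym, §2 proof of Thm. 1.2, Step 3 (arXiv:2201.00153 pp. 4–7) (source of the ARGUMENT this module implements; this declaration is the cell’s own lemma or plumbing, NOT a printed statement)] -/
theorem fderiv_sq_mul_apply {x : EuclideanSpace ℝ (Fin 3)} (hζ : DifferentiableAt ℝ ζ x)
    (hG : DifferentiableAt ℝ G x) (v : EuclideanSpace ℝ (Fin 3)) :
    fderiv ℝ (fun y => ζ y ^ 2 * G y) x v =
      ζ x ^ 2 * fderiv ℝ G x v + 2 * ζ x * G x * fderiv ℝ ζ x v := by
  have h : (fun y => ζ y ^ 2 * G y) = fun y => ζ y * (ζ y * G y) := by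
    funext y; ring
  rw [h, fderiv_mul_apply_of_differentiableAt hζ (hζ.fun_mul hG),
    fderiv_mul_apply_of_differentiableAt hζ hG]
  ring

/-- A continuous function times the compactly supported continuous weight `ζ² G` is integrable.
[folklore]
[cite: Seregin2022LocalAxisym, §2 proof of Thm. 1.2, Step 3 (arXiv:2201.00153 pp. 4–7) (source of the ARGUMENT this module implements; this declaration is the cell’s own lemma or plumbing, NOT a printed statement)] -/
theorem integrable_sq_mul_mul (hζ : Continuous ζ) (hζc : HasCompactSupport ζ) (hG : Continuous G)
    {f : EuclideanSpace ℝ (Fin 3) → ℝ} (hf : Continuous f) :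
    Integrable (fun x => ζ x ^ 2 * G x * f x) := by
  refine (((hζ.pow 2).mul hG).mul hf).integrable_of_hasCompactSupport ?_
  exact hasCompactSupport_of_eq_zero hζc fun x hx => by simp [hx]

/-- **One direction of `∫ ζ²G ΔG`**: `∫ ζ²G ∂ₑ∂ₑG = ∫ G²(∂ₑζ)² − ∫ (∂ₑ(ζG))²` for `ζ ∈ C¹`
compactly supported and `G ∈ C²` (by parts once, then complete the square). [folklore]
[cite: Seregin2022LocalAxisym, §2 proof of Thm. 1.2, Step 3 (arXiv:2201.00153 pp. 4–7) (source of the ARGUMENT this module implements; this declaration is the cell’s own lemma or plumbing, NOT a printed statement)] -/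
theorem integral_sq_mul_mul_fderiv_fderiv (hζ : ContDiff ℝ 1 ζ) (hζc : HasCompactSupport ζ)
    (hG : ContDiff ℝ 2 G) (e : EuclideanSpace ℝ (Fin 3)) :
    ∫ x, ζ x ^ 2 * G x * fderiv ℝ (fun y => fderiv ℝ G y e) x e =
      (∫ x, G x ^ 2 * fderiv ℝ ζ x e ^ 2) - ∫ x, fderiv ℝ (fun y => ζ y * G y) x e ^ 2 := by
  have hG1 : ContDiff ℝ 1 G := hG.of_le (by norm_num)
  have hζd : Differentiable ℝ ζ := hζ.differentiable one_ne_zero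
  have hGd : Differentiable ℝ G := hG1.differentiable one_ne_zero
  have hGe : ContDiff ℝ 1 fun y => fderiv ℝ G y e :=
    contDiff_fderiv_apply_const_succ (n := 1) (by exact_mod_cast hG) e
  have hφ : ContDiff ℝ 1 fun y => ζ y ^ 2 * G y := (hζ.pow 2).mul hG1
  have hφc : HasCompactSupport fun y => ζ y ^ 2 * G y :=
    hasCompactSupport_of_eq_zero hζc fun x hx => by simp [hx]
  have h := integral_mul_fderiv_eq_neg_of_hasCompactSupport hφ hφc hGe e
  rw [h]
  -- the two sides agree pointwise after the product rule
  have hi1 : Integrable (fun x => G x ^ 2 * fderiv ℝ ζ x e ^ 2) :=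
    ((hG.continuous.pow 2).mul ((continuous_fderiv_apply_of_contDiff hζ e).pow 2)).integrable_of_hasCompactSupport
      (hasCompactSupport_of_eq_zero (hζc.fderiv_apply ℝ e) fun x hx => by simp [hx])
  have hζGc : HasCompactSupport fun y => ζ y * G y := hζc.mul_right
  have hi2 : Integrable (fun x => fderiv ℝ (fun y => ζ y * G y) x e ^ 2) :=
    ((continuous_fderiv_apply_of_contDiff (hζ.mul hG1) e).pow 2).integrable_of_hasCompactSupport
      (hasCompactSupport_of_eq_zero (hζGc.fderiv_apply ℝ e) fun x hx => by simp [hx])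
  rw [← integral_sub hi1 hi2, ← integral_neg]
  refine integral_congr_ae (Eventually.of_forall fun x => ?_)
  beta_reduce
  rw [fderiv_sq_mul_apply (hζd x) (hGd x), fderiv_mul_apply_of_differentiableAt (hζd x) (hGd x)]
  ring

/-- **`∫ ζ²G ΔG = ∫ G²|∇ζ|² − ∫ |∇(ζG)|²`** for `ζ ∈ C¹` compactly supported and `G ∈ C²`.
[folklore]
[cite: Seregin2022LocalAxisym, §2 proof of Thm. 1.2, Step 3 (arXiv:2201.00153 pp. 4–7) (source of the ARGUMENT this module implements; this declaration is the cell’s own lemma or plumbing, NOT a printed statement)] -/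
theorem integral_sq_mul_mul_laplacian (hζ : ContDiff ℝ 1 ζ) (hζc : HasCompactSupport ζ)
    (hG : ContDiff ℝ 2 G) :
    ∫ x, ζ x ^ 2 * G x * (Δ G) x =
      (∫ x, G x ^ 2 * (fderiv ℝ ζ x (EuclideanSpace.single 0 1) ^ 2 +
        fderiv ℝ ζ x (EuclideanSpace.single 1 1) ^ 2 + fderiv ℝ ζ x (EuclideanSpace.single 2 1) ^ 2)) -
      ∫ x, (fderiv ℝ (fun y => ζ y * G y) x (EuclideanSpace.single 0 1) ^ 2 +
        fderiv ℝ (fun y => ζ y * G y) x (EuclideanSpace.single 1 1) ^ 2 +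
        fderiv ℝ (fun y => ζ y * G y) x (EuclideanSpace.single 2 1) ^ 2) := by
  have hG1 : ContDiff ℝ 1 G := hG.of_le (by norm_num)
  have hI := fun i : Fin 3 =>
    integral_sq_mul_mul_fderiv_fderiv hζ hζc hG (EuclideanSpace.single i 1)
  -- integrability of the pieces
  have iJ : ∀ i : Fin 3, Integrable (fun x => ζ x ^ 2 * G x *
      fderiv ℝ (fun y => fderiv ℝ G y (EuclideanSpace.single i 1)) x (EuclideanSpace.single i 1)) :=
    fun i => integrable_sq_mul_mul hζ.continuous hζc hG.continuous
      (continuous_fderiv_apply_of_contDiff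
        (contDiff_fderiv_apply_const_succ (n := 1) (by exact_mod_cast hG) _) _)
  have iA : ∀ i : Fin 3, Integrable (fun x => G x ^ 2 * fderiv ℝ ζ x (EuclideanSpace.single i 1) ^ 2) :=
    fun i => ((hG.continuous.pow 2).mul ((continuous_fderiv_apply_of_contDiff hζ _).pow 2)).integrable_of_hasCompactSupport
      (hasCompactSupport_of_eq_zero (hζc.fderiv_apply ℝ (EuclideanSpace.single i 1))
        fun x hx => by simp [hx])
  have hζGc : HasCompactSupport fun y => ζ y * G y := hζc.mul_right
  have iB : ∀ i : Fin 3, Integrable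
      (fun x => fderiv ℝ (fun y => ζ y * G y) x (EuclideanSpace.single i 1) ^ 2) := fun i =>
    ((continuous_fderiv_apply_of_contDiff (hζ.mul hG1) _).pow 2).integrable_of_hasCompactSupport
      (hasCompactSupport_of_eq_zero (hζGc.fderiv_apply ℝ (EuclideanSpace.single i 1))
        fun x hx => by simp [hx])
  have hlap : ∀ x, ζ x ^ 2 * G x * (Δ G) x =
      ζ x ^ 2 * G x * fderiv ℝ (fun y => fderiv ℝ G y (EuclideanSpace.single 0 1)) x (EuclideanSpace.single 0 1) +
      ζ x ^ 2 * G x * fderiv ℝ (fun y => fderiv ℝ G y (EuclideanSpace.single 1 1)) x (EuclideanSpace.single 1 1) +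
      ζ x ^ 2 * G x * fderiv ℝ (fun y => fderiv ℝ G y (EuclideanSpace.single 2 1)) x (EuclideanSpace.single 2 1) := by
    intro x
    rw [laplacian_eq_sum_fderiv_fderiv (EuclideanSpace.basisFun (Fin 3) ℝ) hG x]
    simp only [EuclideanSpace.basisFun_apply, Fin.sum_univ_three]
    ring
  have iJ01 : Integrable (fun x =>
      ζ x ^ 2 * G x * fderiv ℝ (fun y => fderiv ℝ G y (EuclideanSpace.single 0 1)) x (EuclideanSpace.single 0 1) +
      ζ x ^ 2 * G x * fderiv ℝ (fun y => fderiv ℝ G y (EuclideanSpace.single 1 1)) x (EuclideanSpace.single 1 1)) :=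
    (iJ 0).add (iJ 1)
  have iA01 : Integrable (fun x => G x ^ 2 * fderiv ℝ ζ x (EuclideanSpace.single 0 1) ^ 2 +
      G x ^ 2 * fderiv ℝ ζ x (EuclideanSpace.single 1 1) ^ 2) := (iA 0).add (iA 1)
  have iB01 : Integrable (fun x => fderiv ℝ (fun y => ζ y * G y) x (EuclideanSpace.single 0 1) ^ 2 +
      fderiv ℝ (fun y => ζ y * G y) x (EuclideanSpace.single 1 1) ^ 2) := (iB 0).add (iB 1)
  have eA : ∫ x, G x ^ 2 * (fderiv ℝ ζ x (EuclideanSpace.single 0 1) ^ 2 +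
      fderiv ℝ ζ x (EuclideanSpace.single 1 1) ^ 2 + fderiv ℝ ζ x (EuclideanSpace.single 2 1) ^ 2) =
      (∫ x, G x ^ 2 * fderiv ℝ ζ x (EuclideanSpace.single 0 1) ^ 2) +
      (∫ x, G x ^ 2 * fderiv ℝ ζ x (EuclideanSpace.single 1 1) ^ 2) +
      (∫ x, G x ^ 2 * fderiv ℝ ζ x (EuclideanSpace.single 2 1) ^ 2) := by
    rw [← integral_add (iA 0) (iA 1), ← integral_add iA01 (iA 2)]
    refine integral_congr_ae (Eventually.of_forall fun x => ?_)
    beta_reduce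
    ring
  have eB : ∫ x, (fderiv ℝ (fun y => ζ y * G y) x (EuclideanSpace.single 0 1) ^ 2 +
      fderiv ℝ (fun y => ζ y * G y) x (EuclideanSpace.single 1 1) ^ 2 +
      fderiv ℝ (fun y => ζ y * G y) x (EuclideanSpace.single 2 1) ^ 2) =
      (∫ x, fderiv ℝ (fun y => ζ y * G y) x (EuclideanSpace.single 0 1) ^ 2) +
      (∫ x, fderiv ℝ (fun y => ζ y * G y) x (EuclideanSpace.single 1 1) ^ 2) +
      (∫ x, fderiv ℝ (fun y => ζ y * G y) x (EuclideanSpace.single 2 1) ^ 2) := by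
    rw [← integral_add (iB 0) (iB 1), ← integral_add iB01 (iB 2)]
  rw [integral_congr_ae (Eventually.of_forall hlap), integral_add iJ01 (iJ 2),
    integral_add (iJ 0) (iJ 1), hI 0, hI 1, hI 2, eA, eB]
  ring

/-- **The localised transport term**: `∫ ζ²G DG[b] = −∫ ζG² Dζ[b]` for `ζ ∈ C¹` compactly
supported, `G ∈ C¹` and a divergence-free `b ∈ C¹` (`∫ D((ζG)²)[b] = 0`). [folklore]
[cite: Seregin2022LocalAxisym, §2 proof of Thm. 1.2, Step 3 (arXiv:2201.00153 pp. 4–7) (source of the ARGUMENT this module implements; this declaration is the cell’s own lemma or plumbing, NOT a printed statement)] -/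
theorem integral_sq_mul_mul_fderiv_apply : ∀ (ζ G : EuclideanSpace ℝ (Fin 3) → ℝ) (b : EuclideanSpace ℝ (Fin 3) → EuclideanSpace ℝ (Fin 3)), ContDiff ℝ 1 ζ → HasCompactSupport ζ → ContDiff ℝ 1 G → ContDiff ℝ 1 b → VectorCalculus.IsDivFree b → ∫ x, ζ x ^ 2 * G x * fderiv ℝ G x (b x) = -∫ x, ζ x * G x ^ 2 * fderiv ℝ ζ x (b x) := by
  intro ζ G b hζ hζc hG hb hdiv
  have hζd : Differentiable ℝ ζ := hζ.differentiable one_ne_zero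
  have hGd : Differentiable ℝ G := hG.differentiable one_ne_zero
  have hF : ContDiff ℝ 1 fun y => (ζ y * G y) * (ζ y * G y) := (hζ.mul hG).mul (hζ.mul hG)
  have hFc : HasCompactSupport fun y => (ζ y * G y) * (ζ y * G y) :=
    (hζc.mul_right).mul_right
  have h0 := integral_fderiv_apply_eq_zero_of_isDivFree hF hFc hb hdiv
  have hpt : ∀ x, fderiv ℝ (fun y => (ζ y * G y) * (ζ y * G y)) x (b x) =
      2 * (ζ x ^ 2 * G x * fderiv ℝ G x (b x)) + 2 * (ζ x * G x ^ 2 * fderiv ℝ ζ x (b x)) := by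
    intro x
    rw [fderiv_mul_apply_of_differentiableAt ((hζd x).fun_mul (hGd x)) ((hζd x).fun_mul (hGd x)),
      fderiv_mul_apply_of_differentiableAt (hζd x) (hGd x)]
    ring
  have hDb : Continuous fun x => fderiv ℝ G x (b x) :=
    (hG.continuous_fderiv one_ne_zero).clm_apply hb.continuous
  have hDζb : Continuous fun x => fderiv ℝ ζ x (b x) :=
    (hζ.continuous_fderiv one_ne_zero).clm_apply hb.continuous
  have i1 : Integrable (fun x => ζ x ^ 2 * G x * fderiv ℝ G x (b x)) :=
    integrable_sq_mul_mul hζ.continuous hζc hG.continuous hDb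
  have i2 : Integrable (fun x => ζ x * G x ^ 2 * fderiv ℝ ζ x (b x)) :=
    ((hζ.continuous.mul (hG.continuous.pow 2)).mul hDζb).integrable_of_hasCompactSupport
      (hζc.mul_right).mul_right
  rw [integral_congr_ae (Eventually.of_forall hpt), integral_add (i1.const_mul 2) (i2.const_mul 2),
    integral_const_mul, integral_const_mul] at h0
  linarith

end Cutoff

/-! ### The product rule for `(∂ᵣ·)/r` -/

section RadDeriv

variable {ζ G : EuclideanSpace ℝ (Fin 3) → ℝ}

/-- **Product rule for the radial derivative quotient**: `q_{ζG} = ζ q_G + G q_ζ` everywhere, for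
axisymmetric scalars `ζ, G ∈ C²` (`q_F = radDerivQuot F = (∂ᵣF)/r`; off `{x₀ = 0}` both sides are
`∂₀(ζG)/x₀`, and both are continuous). [folklore]
[cite: Seregin2022LocalAxisym, §2 proof of Thm. 1.2, Step 3 (arXiv:2201.00153 pp. 4–7) (source of the ARGUMENT this module implements; this declaration is the cell’s own lemma or plumbing, NOT a printed statement)] -/
theorem radDerivQuot_mul : ∀ (ζ G : EuclideanSpace ℝ (Fin 3) → ℝ), ContDiff ℝ 2 ζ → ContDiff ℝ 2 G → IsAxisymmetricScalar ζ → IsAxisymmetricScalar G → ∀ x : EuclideanSpace ℝ (Fin 3), radDerivQuot (fun y => ζ y * G y) x = ζ x * radDerivQuot G x + G x * radDerivQuot ζ x := by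
  intro ζ G hζ hG hζax hGax x
  have hP : ContDiff ℝ 2 fun y => ζ y * G y := hζ.mul hG
  have hPax : IsAxisymmetricScalar fun y => ζ y * G y := hζax.mul hGax
  have hζd : Differentiable ℝ ζ := hζ.differentiable two_ne_zero
  have hGd : Differentiable ℝ G := hG.differentiable two_ne_zero
  have hc1 : Continuous (radDerivQuot fun y => ζ y * G y) := continuous_radDerivQuot hP
  have hc2 : Continuous fun y => ζ y * radDerivQuot G y + G y * radDerivQuot ζ y :=
    (hζ.continuous.mul (continuous_radDerivQuot hG)).add (hG.continuous.mul (continuous_radDerivQuot hζ))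
  refine eq_of_eq_off_ker (EuclideanSpace.proj (0 : Fin 3)) ⟨EuclideanSpace.single 0 1, by simp⟩
    hc1 hc2 (fun z hz => ?_) x
  have hz0 : z 0 ≠ 0 := by simpa using hz
  have h1 := mul_radDerivQuot_eq_fderiv_zero hP hPax z
  have h2 := mul_radDerivQuot_eq_fderiv_zero hG hGax z
  have h3 := mul_radDerivQuot_eq_fderiv_zero hζ hζax z
  rw [fderiv_mul_apply_of_differentiableAt (hζd z) (hGd z), ← h2, ← h3] at h1
  apply mul_left_cancel₀ hz0
  rw [h1]
  ring

end RadDeriv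

end Literature.Analysis.SereginLogSwirlOrigin.EulerScaling

end Part7

/-!
## Part 8 — port of `Summits/NavierStokesRegularity/NavierStokesRegularity/Theorems/AxisymmetricExtremalityAxisymmetricKatoGlobalStubSereginLogSwirlOriginStep3Gamma.lean` (2 declarations kept)

# Seregin 2022, §2 Step 3: the localised (`η⁶`-weighted) energy inequalities of `Γ = ω_θ/r` and
# `Φ = ω_r/r` at a fixed time, with the axis terms — crux stmt-NavierStokesRegularity-15453
# (`AxisymmetricExtremality.AxisymmetricKatoGlobal`), line registered, support for stub `stub_sereginLogSwirlOrigin`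

Support file (`--supports stmt-NavierStokesRegularity-15453`; theorems only, everything proved)
toward the registered stub `stub_sereginLogSwirlOrigin` = the named fact
`Literature.Analysis.FluidPDE.seregin2022_logSwirl_regularAtOrigin` (G. Seregin, J. Math. Fluid
Mech. 24 (2022), Paper 27 = arXiv:2201.00153, §2). Step 3 ("Local estimates of solutions",
arXiv p. 6): the functions `Φ = ω_r/r = −v_{θ,3}/r` and `Γ = ω_θ/r` satisfy
`∂ₜΦ + (v − 2x'/|x'|²)·∇Φ − ΔΦ + ω·∇(v_r/r) = 0`, `∂ₜΓ + (v − 2x'/|x'|²)·∇Γ − ΔΓ + 2(v_θ/r)Φ = 0`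
(tree: `IsClassicalNSSolutionOn.radVelQuot_curl_eq`, `.angVortQuot_eq`, whole space, with the
smooth quotient `2 radDerivQuot G = (2x'/|x'|²)·∇G`); "multiply the first equation by `Φη⁶` and
the second by `Γη⁶`. After integration by parts, we find
`½∂ₜ∫(Φη³)² + ∫(η³|∇Φ|)² + π∫(η³Φ)²|_{x'=0}dx₃ = A₁ + A₂ + A₃`,
`½∂ₜ∫(Γη³)² + ∫(η³|∇Γ|)² + π∫(η³Γ)²|_{x'=0}dx₃ = B₁ + B₂ + B₃`" with `A₁, B₁` the
`∂ₜη⁶ + Δη⁶` terms, `A₂, B₂` the `(v − 2x'/|x'|²)·∇η⁶` terms, `B₃ = −2∫(v_θ/r)Φη⁶Γ` and `A₃` the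
`ω·∇(v_r/r)` term.

This file proves the honest fixed-time form of these two identities for a CLASSICAL axisymmetric
solution on a time set `S` (no decay at infinity: the cut-off `ζ = η³ ∈ C²_c` is compactly
supported and axisymmetric), in the `η³G`-form consumed by Step 4 (`|η³Φ|²_{2,Q} + |η³Γ|²_{2,Q}`):

* `integral_cutoff_energy_eq` — for ANY `G ∈ C²` with `G' + DG[b] = ν(ΔG + 2q_G) + R`
  (`q_G = radDerivQuot G`), `b ∈ C¹` divergence free:
  `∫ ζ²G G' + ν∫|∇(ζG)|² = 2ν∫ζ²G q_G + ∫ζG² Dζ[b] + ν∫G²|∇ζ|² + ∫ζ²G R`;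
* `integral_cutoff_energy_le` — if `ζ, G` are axisymmetric and `ν ≥ 0`: the axis term
  `2ν∫ζ²G q_G = 2ν∫(ζG)q_{ζG} − 2ν∫ζG²q_ζ` has `∫(ζG)q_{ζG} = −π∫(ζG)(0,0,z)²dz ≤ 0`
  (`IsAxisymmetricScalar.integral_mul_radDerivQuot_nonpos`; this is the paper's
  `+π∫(η³G)²|_{x'=0}dx₃` on the left, with the GOOD sign for BOTH `Φ` and `Γ`), whence
  `∫ ζ²G G' + ν∫|∇(ζG)|² ≤ ∫ζG² Dζ[b] + ν∫G²|∇ζ|² − 2ν∫ζG² q_ζ + ∫ζ²G R`;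
* `angVortQuot_cutoff_energy_le` (registered sub-goal) — **the `Γ`-inequality**: along a
  classical solution, `G = Γ = angVortQuot (v t)`, `G' = angVortQuot (∂ₜv t)`,
  `R = −2 (v_θ/r) Φ`, `v_θ/r = angVelQuot (v t)`, `Φ = radVelQuot (curl (v t))`:
  `∫ζ²ΓΓ' + ν∫|∇(ζΓ)|² ≤ ∫ζΓ²Dζ[v] + ν∫Γ²|∇ζ|² − 2ν∫ζΓ²q_ζ − 2∫ζ²Γ(v_θ/r)Φ` (`B₁+B₂`, `B₃`);
* `radVelQuot_curl_cutoff_energy_le` (registered sub-goal) — **the `Φ`-inequality**: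
  `G = Φ = radVelQuot (curl (v t))`, `R = D(v_r/r)[ω]`:
  `∫ζ²ΦΦ' + ν∫|∇(ζΦ)|² ≤ ∫ζΦ²Dζ[v] + ν∫Φ²|∇ζ|² − 2ν∫ζΦ²q_ζ + ∫ζ²Φ D(v_r/r)[ω]` (`A₁+A₂`, `A₃`).

Here `∫ζ²GG' = ½ d/dt∫(ζG)² − ∫ζ(∂ₜζ)G²` once `ζ` depends on time (sequel file); the three cut-off
terms are supported on `supp ∇ζ` and are the paper's `A₁ + A₂`, `B₁ + B₂` (up to its factors);
the sources `B₃`, `A₃` are estimated in Step 3 with Lemma 2.2 (`seregin2022_lemma22`) and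
Lemma 2.1. The cut-off calculus (`∫ζ²GΔG = ∫G²|∇ζ|² − ∫|∇(ζG)|²`, `∫ζ²G DG[b] = −∫ζG²Dζ[b]`,
`q_{ζG} = ζq_G + Gq_ζ`) is the sibling file `…Step3CutoffCalculus`.

## Mathlib / tree search

Tree: `IsClassicalNSSolutionOn.angVortQuot_eq` (`AxisymQuotientEquationsOmega`),
`IsClassicalNSSolutionOn.radVelQuot_curl_eq` (`AxisymQuotientEquationsJ`),
`IsAxisymmetricScalar.integral_mul_radDerivQuot_nonpos` (`HouLeiLiEstimate`),
`integral_energy_eq_of_drift_laplacian`, `IsClassicalNSSolutionOn.angVortQuot_energy_le`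
(`AxisymOmegaEnergy`, the GLOBAL identity under `L²` hypotheses and bounded drift — not usable on
a slab), `IsClassicalNSSolutionOn.integral_sqBallCutoff_mul_swirl_le` (`AxisymSwirlCutoffEnergy`,
the analogous ball-cut-off scheme for the swirl `rv_θ`), `hasCompactSupport_radDerivQuot`
(`…CFZBounds`), `integral_sq_mul_mul_laplacian`, `integral_sq_mul_mul_fderiv_apply`,
`radDerivQuot_mul` (`…Step3CutoffCalculus`), `contDiff_angVortQuot / angVelQuot / radVelQuot`,
`IsAxisymmetric.isAxisymmetricScalar_angVortQuot / radVelQuot`, `IsAxisymmetric.curl`.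
`lean search 'cutoff_energy|angVortQuot_cutoff|radVelQuot_curl_cutoff'`: no matches (2026-08-17).

## References

* G. Seregin, J. Math. Fluid Mech. 24 (2022), Paper No. 27 = arXiv:2201.00153, §2 Step 3
  (arXiv p. 6, the two displayed identities with `A₁, A₂, A₃`, `B₁, B₂, B₃`).
  [`Seregin2022LocalAxisym`]
* Z. Lei, Q. S. Zhang, Pacific J. Math. 289 (2017) = arXiv:1505.02628, §3 (the global versions,
  axis boundary terms). [`LeiZhang2017`]

Not carried from this source module (not needed by the declarations re-homed here; their consumers are Summits-side): `angVortQuot_cutoff_energy_le`, `radVelQuot_curl_cutoff_energy_le`.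
-/

section Part8

open _root_.MeasureTheory _root_.Set _root_.Filter _root_.Topology _root_.Function
open scoped _root_.ENNReal _root_.ContDiff Laplacian
open Literature.Analysis.FluidPDE

namespace Literature.Analysis.SereginLogSwirlOrigin.EulerScaling

/-! ### The localised energy identity and inequality for a drift–Laplace equation with axis term -/

section Energy

variable {G G' R ζ : EuclideanSpace ℝ (Fin 3) → ℝ} {b : EuclideanSpace ℝ (Fin 3) → EuclideanSpace ℝ (Fin 3)}
  {ν : ℝ}

/-- **Localised energy identity** (the computation of Seregin 2022, §2 Step 3, "multiply the
equation by `Γη⁶` and integrate by parts", for a general scalar). Let `G ∈ C²(ℝ³)` satisfy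
pointwise `G' + DG[b] = ν (ΔG + 2 q_G) + R` (`q_G = radDerivQuot G = (∂ᵣG)/r`, so
`2q_G = (2x'/|x'|²)·∇G`), with `b ∈ C¹` divergence free and `R` continuous, and let `ζ ∈ C¹` have
compact support (`ζ = η³`). Then, with no integrability assumption on `G`,
`∫ ζ²G G' + ν ∫ |∇(ζG)|² = 2ν ∫ ζ²G q_G + ∫ ζG² Dζ[b] + ν ∫ G²|∇ζ|² + ∫ ζ²G R`.
[cite: Seregin2022LocalAxisym, §2 Step 3 (arXiv:2201.00153 p. 6, the identities for Φη⁶ and Γη⁶)] -/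
theorem integral_cutoff_energy_eq (hG : ContDiff ℝ 2 G) (hζ : ContDiff ℝ 1 ζ)
    (hζc : HasCompactSupport ζ) (hR : Continuous R) (hb : ContDiff ℝ 1 b)
    (hdiv : VectorCalculus.IsDivFree b)
    (heq : ∀ x, G' x + fderiv ℝ G x (b x) = ν * ((Δ G) x + 2 * radDerivQuot G x) + R x) :
    (∫ x, ζ x ^ 2 * G x * G' x) +
      ν * ∫ x, (fderiv ℝ (fun y => ζ y * G y) x (EuclideanSpace.single 0 1) ^ 2 +
        fderiv ℝ (fun y => ζ y * G y) x (EuclideanSpace.single 1 1) ^ 2 +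
        fderiv ℝ (fun y => ζ y * G y) x (EuclideanSpace.single 2 1) ^ 2) =
      2 * ν * (∫ x, ζ x ^ 2 * G x * radDerivQuot G x) +
      (∫ x, ζ x * G x ^ 2 * fderiv ℝ ζ x (b x)) +
      ν * (∫ x, G x ^ 2 * (fderiv ℝ ζ x (EuclideanSpace.single 0 1) ^ 2 +
        fderiv ℝ ζ x (EuclideanSpace.single 1 1) ^ 2 + fderiv ℝ ζ x (EuclideanSpace.single 2 1) ^ 2)) +
      ∫ x, ζ x ^ 2 * G x * R x := by
  have hG1 : ContDiff ℝ 1 G := hG.of_le (by norm_num)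
  have hT := integral_sq_mul_mul_fderiv_apply ζ G b hζ hζc hG1 hb hdiv
  have hL := integral_sq_mul_mul_laplacian hζ hζc hG
  -- integrability of the four pieces
  have iT : Integrable (fun x => ζ x ^ 2 * G x * fderiv ℝ G x (b x)) :=
    integrable_sq_mul_mul hζ.continuous hζc hG.continuous
      ((hG.continuous_fderiv two_ne_zero).clm_apply hb.continuous)
  have iL : Integrable (fun x => ζ x ^ 2 * G x * (Δ G) x) :=
    integrable_sq_mul_mul hζ.continuous hζc hG.continuous (continuous_laplacian hG)
  have iQ : Integrable (fun x => ζ x ^ 2 * G x * radDerivQuot G x) :=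
    integrable_sq_mul_mul hζ.continuous hζc hG.continuous (continuous_radDerivQuot hG)
  have iR : Integrable (fun x => ζ x ^ 2 * G x * R x) :=
    integrable_sq_mul_mul hζ.continuous hζc hG.continuous hR
  have hpt : ∀ x, ζ x ^ 2 * G x * G' x =
      -(ζ x ^ 2 * G x * fderiv ℝ G x (b x)) + ν * (ζ x ^ 2 * G x * (Δ G) x) +
        2 * ν * (ζ x ^ 2 * G x * radDerivQuot G x) + ζ x ^ 2 * G x * R x := by
    intro x
    have h := heq x
    have : G' x = -fderiv ℝ G x (b x) + ν * ((Δ G) x + 2 * radDerivQuot G x) + R x := by linarith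
    rw [this]
    ring
  have iTn : Integrable (fun x => -(ζ x ^ 2 * G x * fderiv ℝ G x (b x))) := iT.neg
  have iLν : Integrable (fun x => ν * (ζ x ^ 2 * G x * (Δ G) x)) := iL.const_mul ν
  have iQν : Integrable (fun x => 2 * ν * (ζ x ^ 2 * G x * radDerivQuot G x)) :=
    iQ.const_mul (2 * ν)
  have i12 : Integrable (fun x => -(ζ x ^ 2 * G x * fderiv ℝ G x (b x)) +
      ν * (ζ x ^ 2 * G x * (Δ G) x)) := iTn.add iLν
  have i123 : Integrable (fun x => -(ζ x ^ 2 * G x * fderiv ℝ G x (b x)) +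
      ν * (ζ x ^ 2 * G x * (Δ G) x) + 2 * ν * (ζ x ^ 2 * G x * radDerivQuot G x)) :=
    i12.add iQν
  have hint : ∫ x, ζ x ^ 2 * G x * G' x =
      -(∫ x, ζ x ^ 2 * G x * fderiv ℝ G x (b x)) + ν * (∫ x, ζ x ^ 2 * G x * (Δ G) x) +
        2 * ν * (∫ x, ζ x ^ 2 * G x * radDerivQuot G x) + ∫ x, ζ x ^ 2 * G x * R x := by
    rw [integral_congr_ae (Eventually.of_forall hpt), integral_add i123 iR, integral_add i12 iQν,
      integral_add iTn iLν, integral_neg, integral_const_mul, integral_const_mul]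
  rw [hint, hT, hL]
  ring

/-- **Localised energy inequality with the axis term dropped** (Seregin 2022, §2 Step 3: the
boundary terms `π∫(η³Φ)²|_{x'=0}dx₃`, `π∫(η³Γ)²|_{x'=0}dx₃` have the good sign and are
discarded). Under the hypotheses of `integral_cutoff_energy_eq`, if moreover `ζ, G ∈ C²` are
axisymmetric and `ν ≥ 0`, then `2ν∫ζ²G q_G = 2ν∫(ζG) q_{ζG} − 2ν∫ζG² q_ζ` with
`∫ (ζG) q_{ζG} = −π ∫ (ζG)(0,0,z)² dz ≤ 0` (`IsAxisymmetricScalar.integral_mul_radDerivQuot_nonpos`),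
whence
`∫ ζ²G G' + ν ∫ |∇(ζG)|² ≤ ∫ ζG² Dζ[b] + ν ∫ G²|∇ζ|² − 2ν ∫ ζG² q_ζ + ∫ ζ²G R`:
all terms on the right are supported on `supp ∇ζ` except the source `∫ ζ²G R`.
[cite: Seregin2022LocalAxisym, §2 Step 3 (arXiv:2201.00153 p. 6, the identities for Φη⁶ and Γη⁶)] -/
theorem integral_cutoff_energy_le (hG : ContDiff ℝ 2 G) (hGax : IsAxisymmetricScalar G)
    (hζ : ContDiff ℝ 2 ζ) (hζax : IsAxisymmetricScalar ζ) (hζc : HasCompactSupport ζ)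
    (hν : 0 ≤ ν) (hR : Continuous R) (hb : ContDiff ℝ 1 b) (hdiv : VectorCalculus.IsDivFree b)
    (heq : ∀ x, G' x + fderiv ℝ G x (b x) = ν * ((Δ G) x + 2 * radDerivQuot G x) + R x) :
    (∫ x, ζ x ^ 2 * G x * G' x) +
      ν * ∫ x, (fderiv ℝ (fun y => ζ y * G y) x (EuclideanSpace.single 0 1) ^ 2 +
        fderiv ℝ (fun y => ζ y * G y) x (EuclideanSpace.single 1 1) ^ 2 +
        fderiv ℝ (fun y => ζ y * G y) x (EuclideanSpace.single 2 1) ^ 2) ≤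
      (∫ x, ζ x * G x ^ 2 * fderiv ℝ ζ x (b x)) +
      ν * (∫ x, G x ^ 2 * (fderiv ℝ ζ x (EuclideanSpace.single 0 1) ^ 2 +
        fderiv ℝ ζ x (EuclideanSpace.single 1 1) ^ 2 + fderiv ℝ ζ x (EuclideanSpace.single 2 1) ^ 2)) -
      2 * ν * (∫ x, ζ x * G x ^ 2 * radDerivQuot ζ x) +
      ∫ x, ζ x ^ 2 * G x * R x := by
  have hζ1 : ContDiff ℝ 1 ζ := hζ.of_le (by norm_num)
  have hid := integral_cutoff_energy_eq hG hζ1 hζc hR hb hdiv heq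
  -- the axis term: `∫ ζ²G q_G = ∫ H q_H - ∫ ζG² q_ζ`, `H = ζG`, and `∫ H q_H ≤ 0`
  have hP : ContDiff ℝ 2 fun y => ζ y * G y := hζ.mul hG
  have hPax : IsAxisymmetricScalar fun y => ζ y * G y := hζax.mul hGax
  have hPc : HasCompactSupport fun y => ζ y * G y := hζc.mul_right
  have hH : MemLp (fun y => ζ y * G y) 2 volume := hP.continuous.memLp_of_hasCompactSupport hPc
  have hq : MemLp (radDerivQuot fun y => ζ y * G y) 2 volume :=
    (continuous_radDerivQuot hP).memLp_of_hasCompactSupport (hasCompactSupport_radDerivQuot hP hPax hPc)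
  have hax := hPax.integral_mul_radDerivQuot_nonpos hP hH hq
  have iQ : Integrable (fun x => ζ x ^ 2 * G x * radDerivQuot G x) :=
    integrable_sq_mul_mul hζ.continuous hζc hG.continuous (continuous_radDerivQuot hG)
  have iZ : Integrable (fun x => ζ x * G x ^ 2 * radDerivQuot ζ x) :=
    ((hζ.continuous.mul (hG.continuous.pow 2)).mul (continuous_radDerivQuot hζ)).integrable_of_hasCompactSupport
      (hζc.mul_right).mul_right
  have hsplit : ∫ x, (ζ x * G x) * radDerivQuot (fun y => ζ y * G y) x =
      (∫ x, ζ x ^ 2 * G x * radDerivQuot G x) + ∫ x, ζ x * G x ^ 2 * radDerivQuot ζ x := by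
    rw [← integral_add iQ iZ]
    refine integral_congr_ae (Eventually.of_forall fun x => ?_)
    beta_reduce
    rw [radDerivQuot_mul ζ G hζ hG hζax hGax x]
    ring
  have hsign : 2 * ν * ((∫ x, ζ x ^ 2 * G x * radDerivQuot G x) +
      ∫ x, ζ x * G x ^ 2 * radDerivQuot ζ x) ≤ 0 := by
    rw [← hsplit]
    exact mul_nonpos_of_nonneg_of_nonpos (by positivity) hax
  nlinarith [hid, hsign]

end Energy

/-! ### Seregin's `Γ = ω_θ/r` and `Φ = ω_r/r` along a classical axisymmetric solution -/

section NavierStokes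

variable {S : Set ℝ} {ν : ℝ} {v : ℝ → EuclideanSpace ℝ (Fin 3) → EuclideanSpace ℝ (Fin 3)}
  {q : ℝ → EuclideanSpace ℝ (Fin 3) → ℝ} {ζ : EuclideanSpace ℝ (Fin 3) → ℝ}

end NavierStokes

end Literature.Analysis.SereginLogSwirlOrigin.EulerScaling

end Part8

/-!
## Part 9 — port of `Summits/NavierStokesRegularity/NavierStokesRegularity/Theorems/AxisymmetricExtremalityAxisymmetricKatoGlobalStubSereginLogSwirlOriginCutoffDivCurl.lean` (9 declarations kept)

# Seregin 2022, §2 Step 4: the first cut-off `div`–`curl` (elliptic) bound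
# `‖∇(ζv̄)‖₂ ≤ c‖ζω_θ‖₂ + c‖|∇ζ||v̄|‖₂` — crux stmt-NavierStokesRegularity-15453 (`AxisymmetricExtremality.AxisymmetricKatoGlobal`), line registered, support for stub `stub_sereginLogSwirlOrigin`

Support file (`--supports stmt-NavierStokesRegularity-15453`; theorems only, everything proved)
toward the registered stub `stub_sereginLogSwirlOrigin` = the named fact
`Literature.Analysis.FluidPDE.seregin2022_logSwirl_regularAtOrigin` (G. Seregin, J. Math. Fluid
Mech. 24 (2022), Paper 27 = arXiv:2201.00153, §2). Step 4 of that proof ("Final Conclusion",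
arXiv p. 7) controls the poloidal part `v̄ = v_r e_r + v₃ e₃` of the axisymmetric solution through

> "the elliptic theory implies two classical bounds:
> `‖∇(η³v̄)‖_{2,𝒞} ≤ c‖ω_θη³‖_{2,𝒞} + c‖|∇η³||v̄|‖_{2,𝒞}` and
> `‖∇²(η³v̄)‖_{2,𝒞} ≤ c‖|∇η³||∇v̄|‖_{2,𝒞} + c‖|∇²η³||v̄|‖_{2,𝒞} + c‖curl (ω_θη³e_θ)‖_{2,𝒞}`",

resting on `div v̄ = 0`, `curl v̄ = ω_θ e_θ` in `𝒞` and, with `ζ = η³` (Lemma 2.1, arXiv p. 5),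
`div (ζv̄) = v̄·∇ζ`, `curl (ζv̄) = ζω_θe_θ + ∇ζ × v̄` in `ℝ³`. This file proves the FIRST bound,
for a general `C²` cut-off `ζ` with compact support and a general field `w` which is `C²` and
divergence free on an open set `U ⊇ tsupport ζ` only (at a fixed time the solution is smooth on
the cylinder, not on `ℝ³`), with explicit constants and the Frobenius norm `|·|_F` of `D(ζw)`:

* `norm_curlCLM_smulRight_le_mul` — the sharp rank-one bound `‖curlCLM (ℓ ⊗ a)‖ ≤ ‖ℓ‖‖a‖`
  (`∇ζ × w`), and `contDiff_cutoff_smul` — `ζw ∈ Cⁿ(ℝ³)` from `w ∈ Cⁿ(U)`;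
* `norm_curl_sq_add_divergence_sq_smul_le` — pointwise
  `‖curl (ζw)‖² + (div (ζw))² ≤ 2ζ²‖curl w‖² + 3‖Dζ‖²‖w‖²`;
* `lintegral_frobeniusNormSq_fderiv_smul_le` (registered sub-goal; hypothesis form `…_le'`) —
  **`∫ |D(ζw)|²_F ≤ 2∫ ζ²‖curl w‖² + 3∫ ‖Dζ‖²‖w‖²`** in `[0, ∞]`, by the `div`–`curl` identity
  `∫ |DW|²_F = ∫ ‖curl W‖² + ∫ (div W)²` for the `C²_c` field `W = ζw` (accepted
  `integral_frobeniusNormSq_fderiv_eq_of_hasCompactSupport`, `AxisymPoloidalCutoff`);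
* `lintegral_frobeniusNormSq_fderiv_smul_poloidal_le` — the axisymmetric specialisation with the
  tree's smooth poloidal field `b = u − (u_θ/r) J` (`angVelQuot`, `rotGen`; `= v̄`) of an
  axisymmetric `u ∈ C⁴(ℝ³)`, divergence free on `U`: `‖curl b‖² = r²Γ² = ω_θ²`
  (`Wei2016.norm_curl_sub_angVelQuot_smul_rotGen_sq`, `Γ = angVortQuot u = ω_θ/r`), whence
  `∫ |D(ζb)|²_F ≤ 2∫ ζ² r²Γ² + 3∫ ‖Dζ‖²‖b‖²` — the printed bound with `c = √3`.

The second bound is the sibling file `…CutoffDivCurlSecondOrder.lean`.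

## Mathlib / tree search

Tree: `integral_frobeniusNormSq_fderiv_eq_of_hasCompactSupport` and the off-axis poloidal
cut-off bound `integral_frobeniusNormSq_fderiv_smul_poloidalPart_le` (`AxisymPoloidalCutoff`;
needs `tsupport ψ` OFF the axis, so not applicable to Seregin's `η`, whose support meets the axis),
`lintegral_frobeniusNormSq_fderiv_le_lintegral_sq_norm_curl` (div-free on all of `ℝ³`, `L²`),
`curl_smul`, `norm_curlCLM_smulRight_le` (constant `‖curlCLM‖`), `curlCLM_smulRight_innerSL`,
`norm_cross`, `divergence_smul_apply`, `measurable_curl`, `Wei2016.*_sub_angVelQuot_smul_rotGen*`.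
`lean search 'frobeniusNormSq_fderiv_smul_le|norm_curlCLM_smulRight_le_mul'`: no matches
(2026-08-17).

## References

* G. Seregin, J. Math. Fluid Mech. 24 (2022), Paper No. 27 = arXiv:2201.00153, §2 Step 4 (arXiv
  p. 7, the two "classical bounds") and Lemma 2.1 (arXiv p. 5, `div`/`curl` of `ζv̄`).
  [`Seregin2022LocalAxisym`]

Not carried from this source module (not needed by the declarations re-homed here; their consumers are Summits-side): `lintegral_frobeniusNormSq_fderiv_smul_le`.
-/

section Part9

open _root_.Set _root_.MeasureTheory _root_.Filter _root_.Topology _root_.Function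
open scoped _root_.ENNReal RealInnerProductSpace
open Literature.Analysis.FluidPDE

namespace Literature.Analysis.SereginLogSwirlOrigin.EulerScaling

/-! ### Pointwise algebra -/

/-- **Sharp rank-one bound for the curl**: `‖curlCLM (ℓ ⊗ a)‖ ≤ ‖ℓ‖ ‖a‖` — the curl of the
rank-one Jacobian `h ↦ ℓ(h) a` is the cross product `ℓ♯ × a` (accepted
`curlCLM_smulRight_innerSL`, `norm_cross`). [folklore]
[cite: Seregin2022LocalAxisym, §2 proof of Thm. 1.2, Step 4 (arXiv:2201.00153 pp. 4–7) (source of the ARGUMENT this module implements; this declaration is the cell’s own lemma or plumbing, NOT a printed statement)] -/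
theorem norm_curlCLM_smulRight_le_mul (ℓ : EuclideanSpace ℝ (Fin 3) →L[ℝ] ℝ)
    (a : EuclideanSpace ℝ (Fin 3)) : ‖curlCLM (ℓ.smulRight a)‖ ≤ ‖ℓ‖ * ‖a‖ := by
  set g : EuclideanSpace ℝ (Fin 3) :=
    (InnerProductSpace.toDual ℝ (EuclideanSpace ℝ (Fin 3))).symm ℓ with hg
  have hℓ : ℓ = innerSL ℝ g := by
    ext x
    rw [innerSL_apply_apply, hg, InnerProductSpace.toDual_symm_apply]
  rw [hℓ, curlCLM_smulRight_innerSL, norm_cross, innerSL_apply_norm]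
  have h0 : 0 ≤ ‖g‖ * ‖a‖ := by positivity
  exact mul_le_of_le_one_right h0 (Real.sin_le_one _)

/-! ### The cut-off field `W = ζ w` -/

section Cutoff

variable {ζ : EuclideanSpace ℝ (Fin 3) → ℝ}
  {w : EuclideanSpace ℝ (Fin 3) → EuclideanSpace ℝ (Fin 3)} {U : Set (EuclideanSpace ℝ (Fin 3))}

/-- A function vanishing off a closed set `K` has vanishing derivative off `K` (the complement is
open). [folklore]
[cite: Seregin2022LocalAxisym, §2 proof of Thm. 1.2, Step 4 (arXiv:2201.00153 pp. 4–7) (source of the ARGUMENT this module implements; this declaration is the cell’s own lemma or plumbing, NOT a printed statement)] -/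
theorem fderiv_eq_zero_of_forall_notMem {F : Type*} [NormedAddCommGroup F] [NormedSpace ℝ F]
    {K : Set (EuclideanSpace ℝ (Fin 3))} (hK : IsClosed K) {g : EuclideanSpace ℝ (Fin 3) → F}
    (hg : ∀ y ∉ K, g y = 0) {x : EuclideanSpace ℝ (Fin 3)} (hx : x ∉ K) : fderiv ℝ g x = 0 := by
  have h : g =ᶠ[𝓝 x] fun _ => (0 : F) := by
    filter_upwards [hK.isOpen_compl.mem_nhds hx] with y hy using hg y hy
  rw [h.fderiv_eq, fderiv_const_apply]

/-- A continuous real function vanishing off a compact set is integrable. [folklore]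
[cite: Seregin2022LocalAxisym, §2 proof of Thm. 1.2, Step 4 (arXiv:2201.00153 pp. 4–7) (source of the ARGUMENT this module implements; this declaration is the cell’s own lemma or plumbing, NOT a printed statement)] -/
theorem integrable_of_continuous_of_forall_notMem {f : EuclideanSpace ℝ (Fin 3) → ℝ}
    {K : Set (EuclideanSpace ℝ (Fin 3))} (hK : IsCompact K) (hf : Continuous f)
    (h0 : ∀ x ∉ K, f x = 0) : Integrable f :=
  hf.integrable_of_hasCompactSupport (HasCompactSupport.intro hK h0)

/-- `ζ w = 0` off `tsupport ζ`. [folklore]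
[cite: Seregin2022LocalAxisym, §2 proof of Thm. 1.2, Step 4 (arXiv:2201.00153 pp. 4–7) (source of the ARGUMENT this module implements; this declaration is the cell’s own lemma or plumbing, NOT a printed statement)] -/
theorem smul_eq_zero_of_notMem {y : EuclideanSpace ℝ (Fin 3)} (hy : y ∉ tsupport ζ) :
    ζ y • w y = 0 := by
  rw [image_eq_zero_of_notMem_tsupport hy, zero_smul]

/-- `y ∉ tsupport ζ ⇒ y ∉ tsupport (ζ w)`. [folklore]
[cite: Seregin2022LocalAxisym, §2 proof of Thm. 1.2, Step 4 (arXiv:2201.00153 pp. 4–7) (source of the ARGUMENT this module implements; this declaration is the cell’s own lemma or plumbing, NOT a printed statement)] -/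
theorem notMem_tsupport_smul {y : EuclideanSpace ℝ (Fin 3)} (hy : y ∉ tsupport ζ) :
    y ∉ tsupport fun x => ζ x • w x := fun h => hy (tsupport_smul_subset_left _ _ h)

/-- **`ζ w` is `Cⁿ` on all of `ℝ³`** when `ζ ∈ Cⁿ` and `w` is `Cⁿ` on an open set `U ⊇ tsupport ζ`
(no regularity of `w` off `U` is needed). [folklore]
[cite: Seregin2022LocalAxisym, §2 proof of Thm. 1.2, Step 4 (arXiv:2201.00153 pp. 4–7) (source of the ARGUMENT this module implements; this declaration is the cell’s own lemma or plumbing, NOT a printed statement)] -/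
theorem contDiff_cutoff_smul {n : ℕ∞} (hζ : ContDiff ℝ n ζ) (hU : IsOpen U)
    (hζU : tsupport ζ ⊆ U) (hw : ContDiffOn ℝ n w U) : ContDiff ℝ n fun y => ζ y • w y := by
  rw [contDiff_iff_contDiffAt]
  intro y
  by_cases hy : y ∈ tsupport ζ
  · exact hζ.contDiffAt.smul (hw.contDiffAt (hU.mem_nhds (hζU hy)))
  · refine (contDiffAt_const (c := (0 : EuclideanSpace ℝ (Fin 3)))).congr_of_eventuallyEq ?_
    filter_upwards [(isClosed_tsupport ζ).isOpen_compl.mem_nhds hy] with x hx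
    exact smul_eq_zero_of_notMem hx

/-! ### First order: `|curl (ζw)|² + (div (ζw))² ≤ 2 ζ²|curl w|² + 3 ‖Dζ‖²|w|²` and its integral -/

/-- **Pointwise first-order bound.** If `w` is differentiable and divergence free on a set
`U ⊇ tsupport ζ` and `ζ ∈ C¹`, then everywhere
`‖curl (ζw)‖² + (div (ζw))² ≤ 2 ζ² ‖curl w‖² + 3 ‖Dζ‖² ‖w‖²`
(`div (ζw) = Dζ·w`, `curl (ζw) = ζ curl w + ∇ζ × w`; Seregin: "`div (ζv̄) = v̄·∇ζ`,
`curl (ζv̄) = ζω_θe_θ + ∇ζ × v̄`"). [cite: Seregin2022LocalAxisym, §2 Lemma 2.1 proof and Step 4 (arXiv:2201.00153 pp. 5, 7)] -/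
theorem norm_curl_sq_add_divergence_sq_smul_le (hζ : ContDiff ℝ 1 ζ) (hζU : tsupport ζ ⊆ U)
    (hw : ∀ y ∈ U, DifferentiableAt ℝ w y) (hdiv : ∀ y ∈ U, VectorCalculus.divergence w y = 0)
    (y : EuclideanSpace ℝ (Fin 3)) :
    ‖curl (fun x => ζ x • w x) y‖ ^ 2 + VectorCalculus.divergence (fun x => ζ x • w x) y ^ 2 ≤
      2 * (ζ y ^ 2 * ‖curl w y‖ ^ 2) + 3 * (‖fderiv ℝ ζ y‖ ^ 2 * ‖w y‖ ^ 2) := by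
  by_cases hy : y ∈ tsupport ζ
  · have hyU : y ∈ U := hζU hy
    have hζd : DifferentiableAt ℝ ζ y := (hζ.differentiable one_ne_zero) y
    have hwd : DifferentiableAt ℝ w y := hw y hyU
    have hc : ‖curl (fun x => ζ x • w x) y‖ ≤ |ζ y| * ‖curl w y‖ + ‖fderiv ℝ ζ y‖ * ‖w y‖ := by
      rw [curl_smul hζd hwd]
      refine (norm_add_le _ _).trans (add_le_add ?_ (norm_curlCLM_smulRight_le_mul _ _))
      rw [norm_smul, Real.norm_eq_abs]
    have hd : |VectorCalculus.divergence (fun x => ζ x • w x) y| ≤ ‖fderiv ℝ ζ y‖ * ‖w y‖ := by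
      rw [divergence_smul_apply hζd hwd, hdiv y hyU, mul_zero, zero_add, real_inner_comm,
        gradient, InnerProductSpace.toDual_symm_apply, ← Real.norm_eq_abs]
      exact (fderiv ℝ ζ y).le_opNorm (w y)
    set a : ℝ := |ζ y| * ‖curl w y‖ with ha
    set b : ℝ := ‖fderiv ℝ ζ y‖ * ‖w y‖ with hb
    have ha0 : 0 ≤ a := by positivity
    have hb0 : 0 ≤ b := by positivity
    have h1 : ‖curl (fun x => ζ x • w x) y‖ ^ 2 ≤ (a + b) ^ 2 :=
      pow_le_pow_left₀ (norm_nonneg _) hc 2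
    have h2 : VectorCalculus.divergence (fun x => ζ x • w x) y ^ 2 ≤ b ^ 2 := by
      rw [← sq_abs]
      exact pow_le_pow_left₀ (abs_nonneg _) hd 2
    have ea : a ^ 2 = ζ y ^ 2 * ‖curl w y‖ ^ 2 := by rw [ha, mul_pow, sq_abs]
    have eb : b ^ 2 = ‖fderiv ℝ ζ y‖ ^ 2 * ‖w y‖ ^ 2 := by rw [hb, mul_pow]
    nlinarith [sq_nonneg (a - b)]
  · rw [curl_eq_zero_of_notMem_tsupport (notMem_tsupport_smul hy),
      divergence_eq_zero_of_notMem_tsupport (notMem_tsupport_smul hy), norm_zero]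
    have h0 : (0 : ℝ) ^ 2 + 0 ^ 2 = 0 := by norm_num
    rw [h0]
    positivity

/-- **First-order cut-off `div`–`curl` bound** (hypothesis form). For `ζ ∈ C²_c(ℝ³)` and `w` of
class `C²` and divergence free on an open `U ⊇ tsupport ζ`,
`∫ |D(ζw)|²_F ≤ 2 ∫ ζ²‖curl w‖² + 3 ∫ ‖Dζ‖²‖w‖²` in `[0, ∞]` (the `div`–`curl` identity
`∫ |D(ζw)|²_F = ∫ ‖curl (ζw)‖² + ∫ (div (ζw))²` for the compactly supported `C²` field `ζw`,
accepted `integral_frobeniusNormSq_fderiv_eq_of_hasCompactSupport`, and the pointwise bound).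
[cite: Seregin2022LocalAxisym, §2 Step 4 (arXiv:2201.00153 p. 7), first elliptic bound] -/
theorem lintegral_frobeniusNormSq_fderiv_smul_le' (hζ : ContDiff ℝ 2 ζ) (hζc : HasCompactSupport ζ)
    (hU : IsOpen U) (hζU : tsupport ζ ⊆ U) (hw : ContDiffOn ℝ 2 w U)
    (hdiv : ∀ y ∈ U, VectorCalculus.divergence w y = 0) :
    ∫⁻ x, ENNReal.ofReal (frobeniusNormSq (fderiv ℝ (fun y => ζ y • w y) x)) ≤
      2 * (∫⁻ x, ENNReal.ofReal (ζ x ^ 2 * ‖curl w x‖ ^ 2)) +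
        3 * ∫⁻ x, ENNReal.ofReal (‖fderiv ℝ ζ x‖ ^ 2 * ‖w x‖ ^ 2) := by
  set W : EuclideanSpace ℝ (Fin 3) → EuclideanSpace ℝ (Fin 3) := fun y => ζ y • w y with hW
  have hW2 : ContDiff ℝ 2 W := contDiff_cutoff_smul hζ hU hζU hw
  have hW1 : ContDiff ℝ 1 W := hW2.of_le (by norm_num)
  have hWc : HasCompactSupport W := hζc.smul_right
  have key := integral_frobeniusNormSq_fderiv_eq_of_hasCompactSupport hW2 hWc
  -- integrability: continuous integrands vanishing off `tsupport W`
  have hD0 : ∀ x ∉ tsupport W, fderiv ℝ W x = 0 := fun x hx => fderiv_of_notMem_tsupport ℝ hx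
  have hiF : Integrable fun x => frobeniusNormSq (fderiv ℝ W x) :=
    (continuous_frobeniusNormSq_fderiv hW1 one_ne_zero).integrable_of_hasCompactSupport
      (HasCompactSupport.intro hWc.isCompact fun x hx => by rw [hD0 x hx, frobeniusNormSq_zero])
  have hic : Integrable fun x => ‖curl W x‖ ^ 2 := by
    refine ((continuous_curl hW1).norm.pow 2).integrable_of_hasCompactSupport
      (HasCompactSupport.intro hWc.isCompact fun x hx => ?_)
    show ‖curl W x‖ ^ 2 = 0
    rw [curl_eq_zero_of_notMem_tsupport hx, norm_zero]; ring
  have hid : Integrable fun x => VectorCalculus.divergence W x ^ 2 := by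
    refine ((continuous_divergence (hW1.continuous_fderiv one_ne_zero)).pow 2)
      |>.integrable_of_hasCompactSupport (HasCompactSupport.intro hWc.isCompact fun x hx => ?_)
    show VectorCalculus.divergence W x ^ 2 = 0
    rw [divergence_eq_zero_of_notMem_tsupport hx]; ring
  have hsum : Integrable fun x => ‖curl W x‖ ^ 2 + VectorCalculus.divergence W x ^ 2 := hic.add hid
  have e1 : ∫⁻ x, ENNReal.ofReal (frobeniusNormSq (fderiv ℝ W x)) =
      ∫⁻ x, ENNReal.ofReal (‖curl W x‖ ^ 2 + VectorCalculus.divergence W x ^ 2) := by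
    rw [← ofReal_integral_eq_lintegral_ofReal hiF (ae_of_all _ fun x => frobeniusNormSq_nonneg _),
      key, ← integral_add hic hid, ofReal_integral_eq_lintegral_ofReal hsum
        (ae_of_all _ fun x => add_nonneg (sq_nonneg _) (sq_nonneg _))]
  rw [e1]
  have hwd : ∀ y ∈ U, DifferentiableAt ℝ w y := fun y hy =>
    (hw.contDiffAt (hU.mem_nhds hy)).differentiableAt (by norm_num)
  have hpt := norm_curl_sq_add_divergence_sq_smul_le (hζ.of_le (by norm_num)) hζU hwd hdiv
  calc ∫⁻ x, ENNReal.ofReal (‖curl W x‖ ^ 2 + VectorCalculus.divergence W x ^ 2)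
      ≤ ∫⁻ x, ENNReal.ofReal (2 * (ζ x ^ 2 * ‖curl w x‖ ^ 2) +
          3 * (‖fderiv ℝ ζ x‖ ^ 2 * ‖w x‖ ^ 2)) :=
        lintegral_mono fun x => ENNReal.ofReal_le_ofReal (hpt x)
    _ = 2 * (∫⁻ x, ENNReal.ofReal (ζ x ^ 2 * ‖curl w x‖ ^ 2)) +
          3 * ∫⁻ x, ENNReal.ofReal (‖fderiv ℝ ζ x‖ ^ 2 * ‖w x‖ ^ 2) := by
        have h2 : ∀ x, ENNReal.ofReal (2 * (ζ x ^ 2 * ‖curl w x‖ ^ 2) +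
            3 * (‖fderiv ℝ ζ x‖ ^ 2 * ‖w x‖ ^ 2)) =
            2 * ENNReal.ofReal (ζ x ^ 2 * ‖curl w x‖ ^ 2) +
              3 * ENNReal.ofReal (‖fderiv ℝ ζ x‖ ^ 2 * ‖w x‖ ^ 2) := fun x => by
          rw [ENNReal.ofReal_add (by positivity) (by positivity), ENNReal.ofReal_mul zero_le_two,
            ENNReal.ofReal_mul zero_le_three, ENNReal.ofReal_ofNat, ENNReal.ofReal_ofNat]
        have hm : Measurable fun x => 2 * ENNReal.ofReal (ζ x ^ 2 * ‖curl w x‖ ^ 2) :=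
          (((hζ.continuous.pow 2).measurable.mul
            ((measurable_curl w).norm.pow_const 2)).ennreal_ofReal).const_mul _
        simp_rw [h2]
        rw [lintegral_add_left hm, lintegral_const_mul' _ _ (by norm_num),
          lintegral_const_mul' _ _ (by norm_num)]

/-- **The first elliptic bound for the poloidal part of an axisymmetric field.** Let `u ∈ C⁴(ℝ³)`
be axisymmetric and divergence free on an open `U ⊇ tsupport ζ`, `ζ ∈ C²_c`, and let
`b = u − (u_θ/r) J` be its (smooth) poloidal part `v̄ = u_r e_r + u₃ e₃` (`angVelQuot u = u_θ/r`,
`J = rotGen`). Then `∫ |D(ζb)|²_F ≤ 2 ∫ ζ² r²Γ² + 3 ∫ ‖Dζ‖² ‖b‖²` with `Γ = angVortQuot u = ω_θ/r`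
(`r²Γ² = ω_θ² = ‖curl b‖²`, `Wei2016.norm_curl_sub_angVelQuot_smul_rotGen_sq`; `div b = div u`).
[cite: Seregin2022LocalAxisym, §2 Step 4 (arXiv:2201.00153 p. 7), first elliptic bound] -/
theorem lintegral_frobeniusNormSq_fderiv_smul_poloidal_le
    {u : EuclideanSpace ℝ (Fin 3) → EuclideanSpace ℝ (Fin 3)} (hax : IsAxisymmetric u)
    (hu : ContDiff ℝ 4 u) (hζ : ContDiff ℝ 2 ζ) (hζc : HasCompactSupport ζ) (hU : IsOpen U)
    (hζU : tsupport ζ ⊆ U) (hdiv : ∀ y ∈ U, VectorCalculus.divergence u y = 0) :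
    ∫⁻ x, ENNReal.ofReal (frobeniusNormSq
        (fderiv ℝ (fun y => ζ y • (u y - angVelQuot u y • rotGen y)) x)) ≤
      2 * (∫⁻ x, ENNReal.ofReal (ζ x ^ 2 * ((x 0 ^ 2 + x 1 ^ 2) * angVortQuot u x ^ 2))) +
        3 * ∫⁻ x, ENNReal.ofReal
          (‖fderiv ℝ ζ x‖ ^ 2 * ‖u x - angVelQuot u x • rotGen x‖ ^ 2) := by
  have hJ : ContDiff ℝ 2 (rotGen : EuclideanSpace ℝ (Fin 3) → EuclideanSpace ℝ (Fin 3)) := by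
    rw [show (rotGen : EuclideanSpace ℝ (Fin 3) → EuclideanSpace ℝ (Fin 3)) = ⇑rotGenL from
      funext fun v => rfl]
    exact rotGenL.contDiff
  have hb : ContDiff ℝ 2 fun y => u y - angVelQuot u y • rotGen y :=
    (hu.of_le (by norm_num)).sub ((contDiff_angVelQuot (n := 2) hu).smul hJ)
  have hdivb : ∀ y ∈ U, VectorCalculus.divergence (fun x => u x - angVelQuot u x • rotGen x) y = 0 :=
    fun y hy => by
      rw [Wei2016.divergence_sub_angVelQuot_smul_rotGen hax (hu.of_le (by norm_num)) y]
      exact hdiv y hy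
  refine (lintegral_frobeniusNormSq_fderiv_smul_le' hζ hζc hU hζU hb.contDiffOn hdivb).trans
    (le_of_eq ?_)
  simp_rw [Wei2016.norm_curl_sub_angVelQuot_smul_rotGen_sq hax hu]

end Cutoff

end Literature.Analysis.SereginLogSwirlOrigin.EulerScaling

end Part9

/-!
## Part 10 — port of `Summits/NavierStokesRegularity/NavierStokesRegularity/Theorems/AxisymmetricExtremalityAxisymmetricKatoGlobalStubSereginLogSwirlOriginStep3Balance.lean` (1 declarations kept)

# Seregin 2022, §2 Step 3: time-dependent cut-offs — the weighted energy `∫(η³G)²`, its time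
# derivative, and the passage from the fixed-time to the time-integrated localised energy
# inequality — crux stmt-NavierStokesRegularity-15453 (`AxisymmetricExtremality.AxisymmetricKatoGlobal`), line registered, support for stub `stub_sereginLogSwirlOrigin`

Support file (`--supports stmt-NavierStokesRegularity-15453`; theorems only, everything proved)
toward the registered stub `stub_sereginLogSwirlOrigin` = the named fact
`Literature.Analysis.FluidPDE.seregin2022_logSwirl_regularAtOrigin` (G. Seregin, J. Math. Fluid
Mech. 24 (2022), Paper 27 = arXiv:2201.00153, §2). In Step 3 (arXiv pp. 6–7) the cut-off
`η = φ(r)ψ(x₃)ξ(t)` depends on time, the energy terms are `½∂ₜ∫(Gη³)²` and `½∫G²∂ₜη⁶`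
(`G = Φ, Γ`), and the final "key estimate"
`sup_t ∫η⁶(|Γ|²+|Φ|²) + ∫_Q (η³|∇Φ|)² + (η³|∇Γ|)² ≤ C` is obtained from the differential
inequality "by more or less standard arguments", the first of which is integration in time. This
file supplies, for families jointly smooth on an OPEN time interval `S` (classical solutions on a
singularity-free slab) and a cut-off `ζ = η³` jointly smooth and vanishing off a fixed compact `K`:

* `hasDerivAt_integral_cutoff_sq` — `d/dt ∫(ζG)² = 2∫ζ∂ₜζG² + 2∫ζ²G∂ₜG` (differentiation under
  the integral sign, `hasDerivAt_integral_of_support_subset`);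
* `integral_cutoff_sq_sub_eq` — the balance `∫(ζG)²(t₂) − ∫(ζG)²(t₁) = ∫_{t₁}^{t₂}(…)dt` on
  `[t₁, t₂] ⊆ S`, with continuity of the density;
* `integral_cutoff_sq_add_le_of_forall_le` (registered sub-goal) — **from the fixed-time
  inequality to the integrated one**: if at every `t ∈ S`
  `∫ζ²G∂ₜG + ν∫|∇(ζG)|² ≤ ∫ζG²Dζ[b] + ν∫G²|∇ζ|² − 2ν∫ζG²q_ζ + ∫ζ²GR` (the shape of
  `integral_cutoff_energy_le`, sibling file `…Step3Gamma`; `R`, `b` jointly smooth), then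
  `E(t₂) + 2ν∫_{t₁}^{t₂}∫|∇(ζG)|² ≤ E(t₁) + ∫_{t₁}^{t₂}[2∫ζ∂ₜζG² + 2∫ζG²Dζ[b] + 2ν∫G²|∇ζ|²
  − 4ν∫ζG²q_ζ + 2∫ζ²GR] dt`, `E(t) = ∫(ζG)²(t)`, every time integrand being continuous on `S`
  (joint smoothness of all integrands: `IsSmoothSpaceTimeOn.mul / fderiv_slice(_apply) /
  radDerivQuot_family / timeDerivWithin`, and `continuousOn_integral_of_support_subset`).

The specialisations to `Γ = angVortQuot` and `Φ = radVelQuot ∘ curl` of a classical axisymmetric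
Navier–Stokes solution are the sibling file `…Step3Integrated`.

## Mathlib / tree search

Tree: `hasDerivAt_integral_of_support_subset`, `continuousOn_integral_of_support_subset`,
`IsSmoothSpaceTimeOn.hasDerivAt_timeLine`, `timeDerivWithin_eq_deriv`,
`IsSmoothSpaceTimeOn.mul`, `isSmoothSpaceTimeOn_const_time` (`SpaceTimeCalculus`),
`IsSmoothSpaceTimeOn.timeDerivWithin`, `.contDiff_slice`, `.continuousOn`
(`ClassicalSolutionCalculus`), `IsSmoothSpaceTimeOn.fderiv_slice(_apply)` (`EnergyToolkit`),
`IsSmoothSpaceTimeOn.radDerivQuot_family` (`HouLiSpaceTime`), `integrable_sq_mul_mul`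
(`…Step3CutoffCalculus`); the analogous GLOBAL balances `Wei2016.weighted_sq_balance`
(`Wei2016WeightedBalance`, static weight `r⁻²`, slab `[0, T]`) and `IsSmoothSpaceTimeOn.l2_balance`
(`ClassicalL2Stability`). Mathlib: `intervalIntegral.integral_eq_sub_of_hasDerivAt`,
`intervalIntegral.integral_mono_on`, `ContinuousOn.intervalIntegrable_of_Icc`;
`fderiv_eq_zero_of_forall_notMem` (`…CutoffDivCurl`). `lean search 'integral_cutoff_sq|cutoff_energy_balance'`: no matches
(2026-08-17).

## References

* G. Seregin, J. Math. Fluid Mech. 24 (2022), Paper No. 27 = arXiv:2201.00153, §2 Step 3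
  (arXiv pp. 6–7). [`Seregin2022LocalAxisym`]

Not carried from this source module (not needed by the declarations re-homed here; their consumers are Summits-side): `hasDerivAt_integral_cutoff_sq`, `integral_cutoff_sq_sub_eq`, `integral_cutoff_sq_add_le_of_forall_le`.
-/

section Part10

open _root_.MeasureTheory _root_.Set _root_.Filter _root_.Topology _root_.Function intervalIntegral
open scoped _root_.ENNReal _root_.ContDiff Laplacian
open Literature.Analysis.FluidPDE

namespace Literature.Analysis.SereginLogSwirlOrigin.EulerScaling

/-! ### Time-dependent cut-offs: the weighted energy, its derivative, continuity in time -/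

section Balance

variable {S : Set ℝ} {ζ G : ℝ → EuclideanSpace ℝ (Fin 3) → ℝ} {K : Set (EuclideanSpace ℝ (Fin 3))}

/-- **Continuity in time of a cut-off integral**: if `Ψ` is jointly continuous on `S × ℝ³` and
each slice vanishes off the compact `K`, then `t ↦ ∫ Ψ t` is continuous on `S`
(`continuousOn_integral_of_support_subset`). [folklore]
[cite: Seregin2022LocalAxisym, §2 proof of Thm. 1.2, Step 3 (arXiv:2201.00153 pp. 4–7) (source of the ARGUMENT this module implements; this declaration is the cell’s own lemma or plumbing, NOT a printed statement)] -/
theorem continuousOn_integral_cutoff {Ψ : ℝ → EuclideanSpace ℝ (Fin 3) → ℝ} (hK : IsCompact K)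
    (hΨ : ContinuousOn (uncurry Ψ) (S ×ˢ univ)) (hsupp : ∀ t ∈ S, ∀ x ∉ K, Ψ t x = 0) :
    ContinuousOn (fun t => ∫ x, Ψ t x) S :=
  continuousOn_integral_of_support_subset (μ := volume) hK hΨ hsupp

end Balance

/-! ### From the fixed-time inequality to the integrated one -/

section Integrated

variable {S : Set ℝ} {ν : ℝ} {ζ G R : ℝ → EuclideanSpace ℝ (Fin 3) → ℝ}
  {b : ℝ → EuclideanSpace ℝ (Fin 3) → EuclideanSpace ℝ (Fin 3)} {K : Set (EuclideanSpace ℝ (Fin 3))}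

end Integrated

end Literature.Analysis.SereginLogSwirlOrigin.EulerScaling

end Part10

/-!
## Part 11 — port of `Summits/NavierStokesRegularity/NavierStokesRegularity/Theorems/AxisymmetricExtremalityAxisymmetricKatoGlobalStubSereginLogSwirlOriginStep3Absorb.lean` (1 declarations kept)

# Seregin 2022, §2 Step 3: the absorption and the key estimate
# `sup_t ∫η⁶(Γ² + Φ²) + ∫∫(η³|∇Γ|)² + (η³|∇Φ|)² ≤ C` modulo the printed bound of `A₃` —
# crux stmt-NavierStokesRegularity-15453 (`AxisymmetricExtremality.AxisymmetricKatoGlobal`), line registered, support for stub `stub_sereginLogSwirlOrigin`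

Support file (`--supports stmt-NavierStokesRegularity-15453`; theorems only, everything proved)
toward the registered stub `stub_sereginLogSwirlOrigin` = the named fact
`Literature.Analysis.FluidPDE.seregin2022_logSwirl_regularAtOrigin` (G. Seregin, J. Math. Fluid
Mech. 24 (2022), Paper 27 = arXiv:2201.00153, §2). Step 3, after the two `η⁶`-weighted
identities (`…Step3Gamma`, `…Step3Integrated`), estimates `A₁ + B₁`, `A₂ + B₂` by `C(v,η)`
(boundedness of `v`, `∇ω` on `supp ∇η`), then
"`B₃ = −2∫_{S₁}(v_θ/r)(η³Φ)(η³Γ) + (1/r₁)C(v,η) ≤ (cC₁/ln(e/r₁))(∫|η³Γ|²/(r²ln²(e/r)))^{1/2}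
(∫|η³Φ|²/(r²ln²(e/r)))^{1/2} + … ≤ (cC₁/ln(e/r₁))‖∇_{x'}(η³Γ)‖‖∇_{x'}(η³Φ)‖ + …`" by (2.2) and
Lemma 2.2, bounds `A₃` with Lemma 2.1, and concludes under the smallness
`cC₁/ln(e/r₁) + cC₁²/ln⁴(e/r₁) < 2` "by more or less standard arguments" the key estimate
`sup_t∫η⁶(|Γ|² + |Φ|²) + ∫_Q(η³|∇Φ|)² + (η³|∇Γ|)² ≤ C(v,η,r₁)` (arXiv pp. 6–7). This file proves:

* `integral_horizontal_gradSq_le`, `continuousOn_integral_gradSq_cutoff` — bookkeeping;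
* `cutoff_energy_apriori` (registered sub-goal) — **the absorbed a-priori inequality** along a
  classical axisymmetric solution on a slab: with `E = ∫(ζΓ)² + ∫(ζΦ)²`,
  `D = ∫|∇(ζΓ)|² + ∫|∇(ζΦ)|²`, `θ = 8C₁/ln(e/r₁) + θ_A`:
  `E(t) + (2ν − θ)∫_{t₁}^t D ≤ E(t₁) + (Bcut + B_A + 4M|B(0,2)|)(t − t₁)`, the cut-off terms being
  bounded by the numeric hypothesis `Bcut` and `A₃` by the printed form `2A₃ ≤ θ_A D + B_A`;
* `cutoff_energy_keyEstimate` (registered sub-goal) — **the key estimate** under the smallness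
  `8C₁/ln(e/r₁) + θ_A < 2ν`: `sup_{[t₁,t₂]} E ≤ K` and `∫_{t₁}^{t₂} D ≤ K/(2ν − θ)`,
  `K = E(t₁) + (Bcut + B_A + 4M|B(0,2)|)(t₂ − t₁)`.

What remains of Step 3 after this file: the two numeric hypotheses — `Bcut` from sup-norm bounds
of `v, ∇v, ∇²v, ∇ω` on `supp ∇η` (routine), and the `A₃`-bound `2A₃ ≤ θ_A D + B_A` with
`θ_A = cC₁²/ln⁴(e/r₁)` (the paper's `A₃ = A₀ + A'₃₁ + A₃₂` manipulation with Lemma 2.1 and Lemma 2.2).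

## Mathlib / tree search

Tree: `abs_integral_angVelQuot_mul_mul_le`, `log_exp_div_eq` (`…Step3SwirlSource`, the `B₃`
bound by (2.2) and Lemma 2.2), `spaceCyl_subset_closedBall` (`…LerayLogHardy`), `angVortQuot_cutoff_energy_le`,
`radVelQuot_curl_cutoff_energy_le` (`…Step3Gamma`), `integral_cutoff_sq_sub_eq`,
`continuousOn_integral_cutoff` (`…Step3Balance`), `fderiv_eq_zero_of_forall_notMem`
(`…CutoffDivCurl`),
`IsSmoothSpaceTimeOn.timeDerivWithin_angVortQuot / timeDerivWithin_radVelQuot /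
timeDerivWithin_vorticity_eq`. Mathlib: `intervalIntegral.integral_mono_on`,
`intervalIntegral.integral_const`, `tsupport_mul_subset_left`, `measureReal_nonneg`.
`lean search 'cutoff_energy_apriori|keyEstimate|angVelQuot_mul_mul'`: no matches (2026-08-17).

## References

* G. Seregin, J. Math. Fluid Mech. 24 (2022), Paper No. 27 = arXiv:2201.00153, §2 Step 3
  (arXiv pp. 6–7: the estimate of `B₃`, "Combining all the estimates…", the key estimate).
  [`Seregin2022LocalAxisym`]

Not carried from this source module (not needed by the declarations re-homed here; their consumers are Summits-side): `continuousOn_integral_gradSq_cutoff`, `cutoff_energy_apriori`, `cutoff_energy_keyEstimate`.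
-/

section Part11

open _root_.MeasureTheory _root_.Set _root_.Filter _root_.Topology _root_.Function _root_.Metric intervalIntegral
open scoped _root_.ENNReal _root_.ContDiff
open Literature.Analysis.FluidPDE

namespace Literature.Analysis.SereginLogSwirlOrigin.EulerScaling

/-! ### Absorption and the key estimate -/

section Apriori

/-- The horizontal gradient is bounded by the full gradient in `L²`: `∫ (∂₀f)² + (∂₁f)² ≤ ∫ |∇f|²`
for `f ∈ C¹` with compact support. [folklore]
[cite: Seregin2022LocalAxisym, §2 proof of Thm. 1.2, Step 3 (arXiv:2201.00153 pp. 4–7) (source of the ARGUMENT this module implements; this declaration is the cell’s own lemma or plumbing, NOT a printed statement)] -/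
theorem integral_horizontal_gradSq_le {f : EuclideanSpace ℝ (Fin 3) → ℝ} (hf : ContDiff ℝ 1 f)
    (hfc : HasCompactSupport f) :
    ∫ x, (fderiv ℝ f x (EuclideanSpace.single 0 1) ^ 2 + fderiv ℝ f x (EuclideanSpace.single 1 1) ^ 2) ≤
      ∫ x, (fderiv ℝ f x (EuclideanSpace.single 0 1) ^ 2 + fderiv ℝ f x (EuclideanSpace.single 1 1) ^ 2 + fderiv ℝ f x (EuclideanSpace.single 2 1) ^ 2) := by
  have hi : ∀ i : Fin 3, Integrable (fun x => fderiv ℝ f x (EuclideanSpace.single i 1) ^ 2) := fun i =>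
    ((continuous_fderiv_apply_of_contDiff hf _).pow 2).integrable_of_hasCompactSupport
      (hasCompactSupport_of_eq_zero (hfc.fderiv_apply ℝ (EuclideanSpace.single i 1)) fun x hx => by simp [hx])
  have h01 : Integrable (fun x => fderiv ℝ f x (EuclideanSpace.single 0 1) ^ 2 + fderiv ℝ f x (EuclideanSpace.single 1 1) ^ 2) := (hi 0).add (hi 1)
  exact integral_mono h01 (h01.add (hi 2)) fun x => by
    simp only
    nlinarith [sq_nonneg (fderiv ℝ f x (EuclideanSpace.single 2 1))]

variable {T₀ T₁ ν : ℝ} {v : ℝ → EuclideanSpace ℝ (Fin 3) → EuclideanSpace ℝ (Fin 3)}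
  {q : ℝ → EuclideanSpace ℝ (Fin 3) → ℝ} {ζ : ℝ → EuclideanSpace ℝ (Fin 3) → ℝ}

end Apriori

end Literature.Analysis.SereginLogSwirlOrigin.EulerScaling

end Part11

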